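import Summits.QuantumFields.QCD.Theses.SpectralDefectExtinction
import Literature.MathematicalPhysics.QuantumLattice.WilsonPropagatorHeavyMass
import Literature.MathematicalPhysics.QuantumLattice.GrassmannIntegralWilsonProofs
import Literature.MathematicalPhysics.QuantumFieldTheory.SpectralDefectDensity
import Literature.Barriers.QuantumFields.WilsonDeterminantMassSplitting
import Summits.QuantumFields.QCD.Theorems.WindowExtinction.Negative.SpectralFlow
import Summits.QuantumFields.QCD.Theorems.SpectralDefectExtinctionTipPricingStubCountMeasurable
import Literature.MathematicalPhysics.QuantumFieldTheory.QCDPhaseQuenched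
import Mathlib.LinearAlgebra.Dimension.Constructions
import Mathlib.LinearAlgebra.Dimension.StrongRankCondition

/-!
# Disproof of `ExtinctionBuildsQCD` — BASE (cycles 1–3 on the filed text + the re-typed §0)

Work file of the cdisprove seats on crux `SpectralDefectExtinction.ExtinctionBuildsQCD`
(stmt-QuantumFields-18064; filed as 8968, 17572).  THIS IS THE ARCHIVE HALF: §0 (shape of the RESTATED
crux SD⁺ → THR, re-typed 2026-08-17, plus the filed clauses `Extinct`/`Tight`/`SDHyp` and the records
`FiledBridge`/`FiledHinge`), §1 spectral facts, §2 load-bearing (filed text), §3 chiral inertia / TIGHT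
pins the line, §4 volume lever (filed text), §5 index budget, §6 Weyl window / integrability /
coercivity ceiling / two-sided pin.  The ENTRY POINT with the findings index, the current cycle (§7: the
restated crux) and the integrity note is `Disproof.lean` (imports this file).  Split 2026-08-17 because
the crux-write limit is 200 kB.  All theorems sorry-free.
-/

namespace Summit.QuantumFields.QCD.Cruxes.ExtinctionBuildsQCD.Disproof

open scoped BigOperators Topology Classical MeasureTheory Matrix ComplexConjugate
open Filter MeasureTheory Matrix
open Literature.MathematicalPhysics.QuantumLattice Literature.MathematicalPhysics.QuantumFieldTheory
  Literature.Probability.LatticeModels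
open Summit.QuantumFields.QCD.Theses.SpectralDefectExtinction

/-! ## §0 Shape of the crux: a kill is a kill of the summit conjunct -/

/-- The EXTINCT clause of `SD(N_f)` for witness data `(reg, c)` at the mass tuple `m`
(verbatim from the route file). -/
def Extinct (Nf : ℕ) (reg : QCDRegularisation Nf) (c : ℝ) (m : Fin Nf → ℝ) : Prop :=
  ∀ ε : ℝ, 0 < ε → ∀ᶠ k : ℕ in Filter.atTop, ∀ S : ℕ, reg.L k ≤ S → (∫ U, ((∑ f : Fin Nf, ((Multiset.countP (fun z : ℂ => z.im = 0 ∧ z.re < -(reg.mcrit k + reg.a k * m f / reg.Zm k)) (wilsonDirac (fundamentalRep (Fin 3)) U 0 1).charpoly.roots : ℝ) + (Multiset.countP (fun z : ℂ => |z.re| < c * (reg.a k * m f / reg.Zm k)) (spinorLift gammaFive * wilsonDirac (fundamentalRep (Fin 3)) U (reg.mcrit k + reg.a k * m f / reg.Zm k) 1).charpoly.roots : ℝ)))) * ∏ f : Fin Nf, ‖fermionDet (wilsonDirac (fundamentalRep (Fin 3)) U (reg.mcrit k + reg.a k * m f / reg.Zm k) 1)‖ ∂(wilsonMeasure (d :=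 4) (L := 2 * S + 1) (fundamentalRep (Fin 3)) (reg.β k))) / (∫ U, ∏ f : Fin Nf, ‖fermionDet (wilsonDirac (fundamentalRep (Fin 3)) U (reg.mcrit k + reg.a k * m f / reg.Zm k) 1)‖ ∂(wilsonMeasure (d := 4) (L := 2 * S + 1) (fundamentalRep (Fin 3)) (reg.β k))) ≤ ε * ((2 * S + 1 : ℝ) / (2 * reg.L k + 1)) ^ 4

/-- The TIGHT clause of `SD(N_f)` for witness data `(reg, M₀)` at the mass tuple `m`
(verbatim from the route file). -/
def Tight (Nf : ℕ) (reg : QCDRegularisation Nf) (M₀ : ℝ) (m : Fin Nf → ℝ) : Prop :=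
  ∀ M : ℝ, M₀ < M → ∀ᶠ k : ℕ in Filter.atTop, 1 ≤ (∫ U, (|(Multiset.countP (fun z : ℂ => z.re < 0) (spinorLift gammaFive * wilsonDirac (fundamentalRep (Fin 3)) U (reg.mcrit k - reg.a k * M / reg.Zm k) 1).charpoly.roots : ℝ) - 6 * (2 * reg.L k + 1 : ℝ) ^ 4|) * ∏ f : Fin Nf, ‖fermionDet (wilsonDirac (fundamentalRep (Fin 3)) U (reg.mcrit k + reg.a k * m f / reg.Zm k) 1)‖ ∂(wilsonMeasure (d := 4) (L := 2 * reg.L k + 1) (fundamentalRep (Fin 3)) (reg.β k))) / (∫ U, ∏ f : Fin Nf, ‖fermionDet (wilsonDirac (fundamentalRep (Fin 3)) U (reg.mcrit k + reg.a k * m f / reg.Zm k) 1)‖ ∂(wilsonMeasure (d := 4) (L := 2 * reg.L k + 1) (fundamentalRep (Fin 3)) (reg.β k)))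

/-- `SD(N_f)`: the hypothesis of the bridge for one flavour number (= the body of the sibling crux
`WindowExtinction` at `N_f`). -/
def SDHyp (Nf : ℕ) : Prop :=
  ∃ reg : QCDRegularisation Nf, reg.HasMassScaling ∧ (reg.scheme 0 0 0).HasAsymptoticScaling ∧
    ∃ M₀ : ℝ, 0 ≤ M₀ ∧ ∃ c : ℝ, 0 < c ∧ ∀ m : Fin Nf → ℝ, (∀ f, M₀ < m f) →
      Extinct Nf reg c m ∧ Tight Nf reg M₀ m

/-- TIGHT⁺ of `SD⁺(N_f)` (verbatim clause of the RESTATED crux, stmt-18063/18064): TIGHT with the floor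
`1` raised to `max 1 (η (a_k(2L_k+1))²)` — the extensive (Leutwyler–Smilga `√V_phys`) pin. -/
def TightPlus (Nf : ℕ) (reg : QCDRegularisation Nf) (M₀ : ℝ) (m : Fin Nf → ℝ) : Prop :=
  ∃ η : ℝ, 0 < η ∧ ∀ M : ℝ, M₀ < M → ∀ᶠ k : ℕ in Filter.atTop, max 1 (η * (reg.a k * (2 * reg.L k + 1 : ℝ)) ^ 2) ≤ (∫ U, (|(Multiset.countP (fun z : ℂ => z.re < 0) (spinorLift gammaFive * wilsonDirac (fundamentalRep (Fin 3)) U (reg.mcrit k - reg.a k * M / reg.Zm k) 1).charpoly.roots : ℝ) - 6 * (2 * reg.L k + 1 : ℝ) ^ 4|) * ∏ f : Fin Nf, ‖fermionDet (wilsonDirac (fundamentalRep (Fin 3)) U (reg.mcrit k + reg.a k * m f / reg.Zm k) 1)‖ ∂(wilsonMeasure (d := 4) (L := 2 * reg.L k + 1) (fundamentalRep (Fin 3)) (reg.β k))) / (∫ U, ∏ f : Fin Nf, ‖fermionDet (wilsonDirac (fundamentalRep (Fin 3)) U (reg.mcrit k + reg.a k * m f / reg.Zm k) 1)‖ ∂(wilsonMeasure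 (d := 4) (L := 2 * reg.L k + 1) (fundamentalRep (Fin 3)) (reg.β k)))

/-- `SD⁺(N_f)`: the hypothesis of the RESTATED bridge (= body of the restated `WindowExtinction`,
stmt-18063): SD + (R1) polynomial volume cap `∃ p, ∀ᶠ k, L_k ≤ a_k^{-p}` + (BRANCH) `∀ᶠ k, −1 < m_crit(k)`
+ (R2) TIGHT⁺ in place of TIGHT. -/
def SDPlus (Nf : ℕ) : Prop :=
  ∃ reg : QCDRegularisation Nf, reg.HasMassScaling ∧ (reg.scheme 0 0 0).HasAsymptoticScaling ∧
    (∃ p : ℕ, ∀ᶠ k : ℕ in Filter.atTop, (reg.L k : ℝ) ≤ (reg.a k)⁻¹ ^ p) ∧ (∀ᶠ k : ℕ in Filter.atTop, -1 < reg.mcrit k) ∧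
      ∃ M₀ : ℝ, 0 ≤ M₀ ∧ ∃ c : ℝ, 0 < c ∧ ∀ m : Fin Nf → ℝ, (∀ f, M₀ < m f) → Extinct Nf reg c m ∧ TightPlus Nf reg M₀ m

/-- `THR(N_f)`: the conclusion of the RESTATED bridge — massive QCD above a threshold along one
mass-scaling regularisation (verbatim; the antecedent of the route's `ThresholdForm` / `ChiralDescent`). -/
def THR (Nf : ℕ) : Prop :=
  ∃ reg : QCDRegularisation Nf, reg.HasMassScaling ∧ ∃ M₁ : ℝ, 0 ≤ M₁ ∧ ∀ m : Fin Nf → ℝ, (∀ f, M₁ < m f) → ∃ (z shift : QCDField Nf → ℕ → ℝ) (T : OSData (QCDField Nf) 4), IsQCDAlong (reg.scheme m z shift) T ∧ T.IsNontrivial QCDField.glue ∧ T.IsNonGaussian QCDField.glue ∧ (∀ f g : Fin Nf, f ≠ g → T.IsNontrivial (QCDField.pseudoRe f g)) ∧ ∃ Δ > 0, T.HasMassGap Δ ∧ (reg.scheme m z shift).HasLatticeMassGap Δ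

/-- `FiledBridge`: the crux AS FILED (stmt-8968 text, `∀ N_f ∈ {2,3}, SD(N_f) → QCDOf N_f`) — kept as a
local record so that the cycle-1/2 findings about the retired text (§2, §4) keep elaborating. -/
def FiledBridge : Prop :=
  ∀ Nf : ℕ, (Nf = 2 ∨ Nf = 3) → SDHyp Nf → QCDOf Nf

/-- `FiledHinge`: the sibling crux AS FILED (stmt-8964 text, `∀ N_f ∈ {2,3}, SD(N_f)`). -/
def FiledHinge : Prop :=
  ∀ Nf : ℕ, (Nf = 2 ∨ Nf = 3) → SDHyp Nf

/-- The RESTATED crux, unbundled: `ExtinctionBuildsQCD` is `∀ N_f ∈ {2,3}, SD⁺(N_f) → THR(N_f)`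
(definitional; stmt-18064). -/
theorem extinctionBuildsQCD_iff :
    ExtinctionBuildsQCD ↔ ∀ Nf : ℕ, (Nf = 2 ∨ Nf = 3) → SDPlus Nf → THR Nf := Iff.rfl

/-- The RESTATED sibling crux, unbundled: `WindowExtinction` is `∀ N_f ∈ {2,3}, SD⁺(N_f)` (definitional; stmt-18063). -/
theorem windowExtinction_iff : WindowExtinction ↔ ∀ Nf : ℕ, (Nf = 2 ∨ Nf = 3) → SDPlus Nf :=
  Iff.rfl

/-- TIGHT⁺ implies the filed TIGHT (`1 ≤ max 1 _`). -/
theorem tight_of_tightPlus {Nf : ℕ} {reg : QCDRegularisation Nf} {M₀ : ℝ} {m : Fin Nf → ℝ}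
    (h : TightPlus Nf reg M₀ m) : Tight Nf reg M₀ m := by
  obtain ⟨η, -, h⟩ := h
  intro M hM
  filter_upwards [h M hM] with k hk
  exact le_trans (le_max_left _ _) hk

/-- SD⁺ implies the filed SD: EVERY finding below about SD-witnesses (§1–§6) applies to SD⁺-witnesses. -/
theorem sdHyp_of_sdPlus {Nf : ℕ} (h : SDPlus Nf) : SDHyp Nf := by
  obtain ⟨reg, hms, has, -, -, M₀, hM₀, c, hc, h⟩ := h
  exact ⟨reg, hms, has, M₀, hM₀, c, hc, fun m hm => ⟨(h m hm).1, tight_of_tightPlus (h m hm).2⟩⟩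

/-- The restated hinge implies the filed one. -/
theorem filedHinge_of_windowExtinction (h : WindowExtinction) : FiledHinge :=
  fun Nf hNf => sdHyp_of_sdPlus (h Nf hNf)

/-- `QCDOf N_f → THR(N_f)` (threshold `M₁ = 0`; the chiral clause of the re-typed `QCDOf` is dropped). -/
theorem thr_of_qcdOf {Nf : ℕ} (h : QCDOf Nf) : THR Nf := by
  obtain ⟨reg, hms, -, hbody⟩ := h
  exact ⟨reg, hms, 0, le_rfl, hbody⟩

/-- The bridge follows outright from its own conclusion at both flavour numbers (SD⁺ unused): the
restated crux is AT MOST "massive QCD above a threshold"-hard (cf. ideator 2's Occam sandwich: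
`HeavyThresholdYMBridge.ThresholdQCD → ExtinctionBuildsQCD`). -/
theorem extinctionBuildsQCD_of_thr (h2 : THR 2) (h3 : THR 3) : ExtinctionBuildsQCD := by
  intro Nf hNf _
  rcases hNf with rfl | rfl
  exacts [h2, h3]

/-- The summit conjunct implies the crux outright: the bridge is AT MOST summit-hard. -/
theorem extinctionBuildsQCD_of_qcd (h : _root_.QCD) : ExtinctionBuildsQCD :=
  extinctionBuildsQCD_of_thr (thr_of_qcdOf h.1) (thr_of_qcdOf h.2)

/-- Contrapositive: any refutation of the crux refutes the summit conjunct `QCD`. -/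
theorem not_qcd_of_not_extinctionBuildsQCD (h : ¬ ExtinctionBuildsQCD) : ¬ _root_.QCD :=
  fun hq => h (extinctionBuildsQCD_of_qcd hq)

/-- What a kill would have to exhibit: a flavour number with a capped, branched, extensively tight
spectrally clean regularisation AND no massive QCD above any threshold along any mass-scaling
regularisation (`¬ THR` — the negation of the threshold form of the summit conjunct). -/
theorem not_extinctionBuildsQCD_iff :
    ¬ ExtinctionBuildsQCD ↔ ∃ Nf : ℕ, (Nf = 2 ∨ Nf = 3) ∧ SDPlus Nf ∧ ¬ THR Nf := by
  rw [extinctionBuildsQCD_iff]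
  push Not
  rfl

/-- **The crux sandwiched.** Given the sibling crux (by ANY witnesses) the bridge is EQUIVALENT to its
conclusion `THR 2 ∧ THR 3`; what keeps it from BEING its conclusion is exactly the absence of a junk
inhabitant of SD⁺ (§7). -/
theorem extinctionBuildsQCD_iff_thr_of_windowExtinction (hSD : WindowExtinction) :
    ExtinctionBuildsQCD ↔ THR 2 ∧ THR 3 :=
  ⟨fun h => ⟨h 2 (Or.inl rfl) (hSD 2 (Or.inl rfl)), h 3 (Or.inr rfl) (hSD 3 (Or.inr rfl))⟩,
    fun hq => extinctionBuildsQCD_of_thr hq.1 hq.2⟩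

/-! ## §1 Configuration-wise spectral facts -/

section Spectral

variable {L : ℕ} [NeZero L]

/-- `Re⟨v, v⟩ = Σ ‖v i‖²`. -/
theorem re_star_dotProduct_self {n : Type*} [Fintype n] (v : n → ℂ) :
    (star v ⬝ᵥ v).re = ∑ i, ‖v i‖ ^ 2 := by
  rw [dotProduct, Complex.re_sum]
  refine Finset.sum_congr rfl fun i _ => ?_
  rw [Pi.star_apply, Complex.star_def, ← Complex.normSq_eq_conj_mul_self, Complex.ofReal_re,
    Complex.normSq_eq_norm_sq]

/-- A non-zero vector has positive `Σ ‖v i‖²`. -/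
theorem sum_norm_sq_pos {n : Type*} [Fintype n] {v : n → ℂ} (hv : v ≠ 0) :
    0 < ∑ i, ‖v i‖ ^ 2 := by
  obtain ⟨i, hi⟩ : ∃ i, v i ≠ 0 := by
    by_contra h
    push Not at h
    exact hv (funext h)
  exact Finset.sum_pos' (fun j _ => by positivity) ⟨i, Finset.mem_univ _, by positivity⟩

open scoped Matrix.Norms.L2Operator in
/-- Cauchy–Schwarz with the `ℓ² → ℓ²` operator norm: `‖v† A v‖ ≤ ‖A‖ · Σ‖v i‖²`
(Reed–Simon I §VI.1; same route as the tree's `re_star_dotProduct_mulVec_le_opNorm`). -/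
theorem norm_star_dotProduct_mulVec_le {n : Type*} [Fintype n] [DecidableEq n]
    (A : Matrix n n ℂ) (v : n → ℂ) :
    ‖star v ⬝ᵥ (A *ᵥ v)‖ ≤ ‖A‖ * ∑ i, ‖v i‖ ^ 2 := by
  have hinner : ∀ a b : n → ℂ,
      star a ⬝ᵥ b = inner ℂ (WithLp.toLp 2 a : EuclideanSpace ℂ n) (WithLp.toLp 2 b) :=
    fun a b => by rw [EuclideanSpace.inner_eq_star_dotProduct, dotProduct_comm]
  set x : EuclideanSpace ℂ n := WithLp.toLp 2 v with hx
  have hx2 : ‖x‖ ^ 2 = ∑ i, ‖v i‖ ^ 2 := by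
    rw [← re_star_dotProduct_self, hinner, ← inner_self_eq_norm_sq (𝕜 := ℂ)]
    rfl
  calc ‖star v ⬝ᵥ (A *ᵥ v)‖
      = ‖inner ℂ x (Matrix.toEuclideanCLM (n := n) (𝕜 := ℂ) A x)‖ := by
        rw [hinner, hx, Matrix.toEuclideanCLM_toLp]
    _ ≤ ‖x‖ * ‖Matrix.toEuclideanCLM (n := n) (𝕜 := ℂ) A x‖ := norm_inner_le_norm _ _
    _ ≤ ‖x‖ * (‖Matrix.toEuclideanCLM (n := n) (𝕜 := ℂ) A‖ * ‖x‖) := by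
        gcongr
        exact ContinuousLinearMap.le_opNorm _ _
    _ = ‖A‖ * ∑ i, ‖v i‖ ^ 2 := by rw [← hx2, Matrix.cstar_norm_def]; ring

open scoped Matrix.Norms.L2Operator in
/-- **Wilson positivity and the width of the Wilson band, configuration-wise**: for every `SU(3)`
field `U`, every bare mass `m` and every spinor `v`,
`m Σ‖v‖² ≤ Re⟨v, D_W(U,m,1) v⟩ ≤ (m + 8) Σ‖v‖²` — from `D_W(m) = (m+4)·1 − Σ_μ W_μ` with four
hopping operators of `ℓ²`-norm `≤ 1` (tree `wilsonDirac_eq_sub_sum_wilsonHop`,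
`l2_opNorm_wilsonHop_le`; HJL (2.14)). The lower bound is `Re D_W(U,0,1) ≥ 0` (the Wilson term is
`½Σ∇†∇`), the upper bound says the hole's shadow on the real axis is `[0, 8]`. -/
theorem re_star_dotProduct_wilsonDirac_mem (U : GaugeConfig 4 L SU3) (m : ℝ)
    (v : TorusSite 4 L × Fin 3 × Fin 4 → ℂ) :
    m * ∑ i, ‖v i‖ ^ 2 ≤ (star v ⬝ᵥ (wilsonDirac (fundamentalRep (Fin 3)) U m 1 *ᵥ v)).re ∧
      (star v ⬝ᵥ (wilsonDirac (fundamentalRep (Fin 3)) U m 1 *ᵥ v)).re ≤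
        (m + 8) * ∑ i, ‖v i‖ ^ 2 := by
  have hρ : ∀ g : SU3, fundamentalRep (Fin 3) g ∈ Matrix.unitaryGroup (Fin 3) ℂ :=
    fundamentalRep_mem_unitaryGroup
  set N2 : ℝ := ∑ i, ‖v i‖ ^ 2 with hN2
  have hhop : ∀ μ : Fin 4, |(star v ⬝ᵥ (wilsonHop (fundamentalRep (Fin 3)) U μ *ᵥ v)).re| ≤ N2 := by
    intro μ
    refine (Complex.abs_re_le_norm _).trans ((norm_star_dotProduct_mulVec_le _ v).trans ?_)
    have h1 := l2_opNorm_wilsonHop_le (fundamentalRep (Fin 3)) hρ U μ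
    have hN : 0 ≤ N2 := Finset.sum_nonneg fun i _ => by positivity
    nlinarith
  have hre : (star v ⬝ᵥ (wilsonDirac (fundamentalRep (Fin 3)) U m 1 *ᵥ v)).re =
      (m + 4) * N2 - ∑ μ, (star v ⬝ᵥ (wilsonHop (fundamentalRep (Fin 3)) U μ *ᵥ v)).re := by
    rw [wilsonDirac_eq_sub_sum_wilsonHop (fundamentalRep (Fin 3)) hρ U m, sub_mulVec,
      smul_mulVec, one_mulVec, sum_mulVec, dotProduct_sub, dotProduct_smul, dotProduct_sum,
      Complex.sub_re, smul_eq_mul, Complex.re_ofReal_mul, Complex.re_sum, re_star_dotProduct_self]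
  have hsum : |∑ μ, (star v ⬝ᵥ (wilsonHop (fundamentalRep (Fin 3)) U μ *ᵥ v)).re| ≤ 4 * N2 := by
    refine (Finset.abs_sum_le_sum_abs _ _).trans ?_
    calc ∑ μ, |(star v ⬝ᵥ (wilsonHop (fundamentalRep (Fin 3)) U μ *ᵥ v)).re|
        ≤ ∑ _μ : Fin 4, N2 := Finset.sum_le_sum fun μ _ => hhop μ
      _ = 4 * N2 := by simp
  rw [hre]
  constructor <;> cases abs_le.1 hsum <;> linarith

/-- **No sign defects below a non-positive threshold.** The massless `r = 1` Wilson–Dirac operator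
of ANY `SU(3)` gauge field on ANY torus has no real eigenvalue `< t ≤ 0`: a real eigenvalue `λ < 0`
would make `D_W(U, -λ, 1)` singular, contradicting heavy-mass invertibility (`κ < 1/8`,
`wilsonDirac_det_ne_zero_of_pos`). -/
theorem countP_signDefect_eq_zero (U : GaugeConfig 4 L SU3) {t : ℝ} (ht : t ≤ 0) :
    Multiset.countP (fun z : ℂ => z.im = 0 ∧ z.re < t)
      (wilsonDirac (fundamentalRep (Fin 3)) U 0 1).charpoly.roots = 0 := by
  rw [Multiset.countP_eq_zero]
  rintro z hz ⟨hzim, hzre⟩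
  set D₀ := wilsonDirac (fundamentalRep (Fin 3)) U 0 1 with hD₀
  have hne : D₀.charpoly ≠ 0 := (Matrix.charpoly_monic _).ne_zero
  have heval : (Matrix.scalar _ z - D₀).det = 0 := by
    rw [← Matrix.eval_charpoly]; exact (Polynomial.mem_roots hne).1 hz
  have hz' : z = ((z.re : ℝ) : ℂ) := Complex.ext (by simp) (by simp [hzim])
  have hpos : 0 < -z.re := by linarith
  have hdet := wilsonDirac_det_ne_zero_of_pos (fundamentalRep (Fin 3))
    fundamentalRep_mem_unitaryGroup U hpos
  rw [wilsonDirac_mass_eq_add_scalar (fundamentalRep (Fin 3)) U (-z.re) 1] at hdet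
  apply hdet
  have hmat : wilsonDirac (fundamentalRep (Fin 3)) U 0 1 + Matrix.scalar _ (((-z.re : ℝ)) : ℂ) =
      -(Matrix.scalar _ z - D₀) := by
    rw [neg_sub, sub_eq_add_neg, ← map_neg, Complex.ofReal_neg, ← hz']
  rw [hmat, Matrix.det_neg, heval, mul_zero]

/-- **Every real eigenvalue of the massless Wilson–Dirac operator lies in `[0, 8]`** (the shadow
of the Wilson hole): a root `z` of the characteristic polynomial with `Im z = 0` has
`0 ≤ Re z ≤ 8` (Rayleigh quotient of an eigenvector and `re_star_dotProduct_wilsonDirac_mem`). -/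
theorem re_mem_Icc_of_real_root (U : GaugeConfig 4 L SU3) {z : ℂ}
    (hz : z ∈ (wilsonDirac (fundamentalRep (Fin 3)) U 0 1).charpoly.roots) (hzim : z.im = 0) :
    0 ≤ z.re ∧ z.re ≤ 8 := by
  set D₀ := wilsonDirac (fundamentalRep (Fin 3)) U 0 1 with hD₀
  have hne : D₀.charpoly ≠ 0 := (Matrix.charpoly_monic _).ne_zero
  have heval : (Matrix.scalar _ z - D₀).det = 0 := by
    rw [← Matrix.eval_charpoly]; exact (Polynomial.mem_roots hne).1 hz
  obtain ⟨v, hv0, hv⟩ := Matrix.exists_mulVec_eq_zero_iff.2 heval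
  have hDv : D₀ *ᵥ v = z • v := by
    rw [sub_mulVec, sub_eq_zero, scalar_apply, ← smul_one_eq_diagonal, smul_mulVec,
      one_mulVec] at hv
    exact hv.symm
  have hq : (star v ⬝ᵥ (D₀ *ᵥ v)).re = z.re * ∑ i, ‖v i‖ ^ 2 := by
    rw [hDv, dotProduct_smul, smul_eq_mul, Complex.mul_re, re_star_dotProduct_self, hzim,
      zero_mul, sub_zero]
  have h := re_star_dotProduct_wilsonDirac_mem U 0 v
  rw [hq, zero_mul, zero_add] at h
  have hN := sum_norm_sq_pos hv0
  exact ⟨nonneg_of_mul_nonneg_left h.1 hN, le_of_mul_le_mul_right h.2 hN⟩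

/-- **Coercivity off the line, configuration-wise.** For every bare mass `μ` (contentful for
`μ > 0`), every root `z` of the characteristic polynomial of the Hermitian Wilson operator
`Γ₅ D_W(U, μ, 1)` has `|Re z| ≥ μ`:
if `Γ₅ D v = z v` then `D v = z Γ₅ v`, so `μ‖v‖² ≤ Re⟨v, Dv⟩ = Re(z⟨v, Γ₅ v⟩) ≤ |z| ‖v‖²`, and
`z` is real (`Γ₅ D` Hermitian, barrier file `isHermitian_gammaFive_mul_wilsonDirac`). -/
theorem le_abs_re_of_mem_roots_hermitianWilson (U : GaugeConfig 4 L SU3) (μ : ℝ)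
    {z : ℂ} (hz : z ∈ (spinorLift gammaFive *
      wilsonDirac (fundamentalRep (Fin 3)) U μ 1).charpoly.roots) : μ ≤ |z.re| := by
  set Γ : Matrix (TorusSite 4 L × Fin 3 × Fin 4) (TorusSite 4 L × Fin 3 × Fin 4) ℂ :=
    spinorLift gammaFive with hΓ
  set D := wilsonDirac (fundamentalRep (Fin 3)) U μ 1 with hD
  have hne : (Γ * D).charpoly ≠ 0 := (Matrix.charpoly_monic _).ne_zero
  -- `z` is real: `Γ₅ D` is Hermitian
  have hH : (Γ * D).IsHermitian :=
    Literature.Barriers.QuantumFields.isHermitian_gammaFive_mul_wilsonDirac (fundamentalRep (Fin 3))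
      fundamentalRep_mem_unitaryGroup U μ 1
  have hzim : z.im = 0 := by
    have hz2 := hz
    rw [hH.roots_charpoly_eq_eigenvalues, Multiset.mem_map] at hz2
    obtain ⟨i, -, rfl⟩ := hz2
    simp
  -- an eigenvector
  have heval : (Matrix.scalar _ z - Γ * D).det = 0 := by
    rw [← Matrix.eval_charpoly]; exact (Polynomial.mem_roots hne).1 hz
  obtain ⟨v, hv0, hv⟩ := Matrix.exists_mulVec_eq_zero_iff.2 heval
  have hHv : Γ *ᵥ (D *ᵥ v) = z • v := by
    rw [sub_mulVec, sub_eq_zero, scalar_apply, ← smul_one_eq_diagonal, smul_mulVec,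
      one_mulVec, ← mulVec_mulVec] at hv
    exact hv.symm
  have hΓΓ : Γ * Γ = 1 := spinorLift_gammaFive_mul_self
  have hDv : D *ᵥ v = z • (Γ *ᵥ v) := by
    calc D *ᵥ v = (Γ * Γ * D) *ᵥ v := by rw [hΓΓ, Matrix.one_mul]
      _ = Γ *ᵥ (Γ *ᵥ (D *ᵥ v)) := by simp only [mulVec_mulVec, Matrix.mul_assoc]
      _ = z • (Γ *ᵥ v) := by rw [hHv, mulVec_smul]
  -- the chirality form `g = ⟨v, Γ₅ v⟩` has `‖g‖ ≤ ‖v‖²`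
  set N2 : ℝ := ∑ i, ‖v i‖ ^ 2 with hN2
  have hN2pos : 0 < N2 := sum_norm_sq_pos hv0
  have hΓv : ∀ p, (Γ *ᵥ v) p = (![1, 1, -1, -1] : Fin 4 → ℂ) p.2.2 * v p := by
    intro p
    rw [hΓ, spinorLift_gammaFive_eq_diagonal, mulVec_diagonal]
  have hg : ‖star v ⬝ᵥ (Γ *ᵥ v)‖ ≤ N2 := by
    rw [dotProduct]
    refine (norm_sum_le _ _).trans (le_of_eq ?_)
    refine Finset.sum_congr rfl fun p _ => ?_
    rw [hΓv, Pi.star_apply, norm_mul, norm_mul, Complex.star_def, Complex.norm_conj]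
    have h1 : ‖(![1, 1, -1, -1] : Fin 4 → ℂ) p.2.2‖ = 1 := by
      rcases p with ⟨x, a, α⟩
      fin_cases α <;> simp
    rw [h1, one_mul, sq]
  -- Wilson positivity: `Re⟨v, D v⟩ ≥ μ ‖v‖²`
  have hpos : μ * N2 ≤ (star v ⬝ᵥ (D *ᵥ v)).re := (re_star_dotProduct_wilsonDirac_mem U μ v).1
  -- combine
  have hup : (star v ⬝ᵥ (D *ᵥ v)).re ≤ |z.re| * N2 := by
    rw [hDv, dotProduct_smul, smul_eq_mul]
    have hz' : z = ((z.re : ℝ) : ℂ) := Complex.ext (by simp) (by simp [hzim])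
    calc (z * (star v ⬝ᵥ (Γ *ᵥ v))).re ≤ ‖z * (star v ⬝ᵥ (Γ *ᵥ v))‖ := Complex.re_le_norm _
      _ = |z.re| * ‖star v ⬝ᵥ (Γ *ᵥ v)‖ := by
          rw [norm_mul, hz', Complex.norm_real, Real.norm_eq_abs, Complex.ofReal_re]
      _ ≤ |z.re| * N2 := mul_le_mul_of_nonneg_left hg (abs_nonneg _)
  exact le_of_mul_le_mul_right (hpos.trans hup) hN2pos

/-- **No coercivity defects in a window narrower than the bare mass.** For any window
half-width `w ≤ μ`, `Γ₅ D_W(U, μ, 1)` has no eigenvalue with `|Re| < w`. -/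
theorem countP_coercivityDefect_eq_zero (U : GaugeConfig 4 L SU3) {μ w : ℝ} (hw : w ≤ μ) :
    Multiset.countP (fun z : ℂ => |z.re| < w)
      (spinorLift gammaFive * wilsonDirac (fundamentalRep (Fin 3)) U μ 1).charpoly.roots = 0 := by
  rw [Multiset.countP_eq_zero]
  intro z hz hlt
  have := le_abs_re_of_mem_roots_hermitianWilson U μ hz
  linarith

end Spectral


/-! ## §2 Load-bearing analysis: without TIGHT the bridge is the summit conjunct -/

section LoadBearing

variable {Nf : ℕ}

/-- **The EXTINCT integrand vanishes identically when the line sits at non-negative bare mass.**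
For every regularisation step with `m_crit(k) ≥ 0`, every `c ≤ 1`, every positive mass tuple and
EVERY gauge field: no sign defects (threshold `-(m_crit + a m_f/Z) < 0`,
`countP_signDefect_eq_zero`) and no coercivity defects (window `c a m_f/Z ≤ m_crit + a m_f/Z`,
`countP_coercivityDefect_eq_zero`). -/
theorem defectCount_eq_zero (reg : QCDRegularisation Nf) {k : ℕ} (hk : 0 ≤ reg.mcrit k)
    {c : ℝ} (hc1 : c ≤ 1) (m : Fin Nf → ℝ) (hm : ∀ f, 0 < m f) {S : ℕ} [NeZero S]
    (U : GaugeConfig 4 S SU3) :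
    (∑ f : Fin Nf, ((Multiset.countP (fun z : ℂ => z.im = 0 ∧ z.re < -(reg.mcrit k + reg.a k * m f / reg.Zm k)) (wilsonDirac (fundamentalRep (Fin 3)) U 0 1).charpoly.roots : ℝ) + (Multiset.countP (fun z : ℂ => |z.re| < c * (reg.a k * m f / reg.Zm k)) (spinorLift gammaFive * wilsonDirac (fundamentalRep (Fin 3)) U (reg.mcrit k + reg.a k * m f / reg.Zm k) 1).charpoly.roots : ℝ))) = 0 := by
  refine Finset.sum_eq_zero fun f _ => ?_
  have hw : 0 < reg.a k * m f / reg.Zm k := div_pos (mul_pos (reg.a_pos k) (hm f)) (reg.Zm_pos k)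
  have hcw : c * (reg.a k * m f / reg.Zm k) ≤ reg.mcrit k + reg.a k * m f / reg.Zm k := by
    nlinarith
  rw [countP_signDefect_eq_zero U (by linarith), countP_coercivityDefect_eq_zero U hcw,
    Nat.cast_zero, add_zero]

/-- **EXTINCT is free for a line at non-negative bare mass.** For EVERY regularisation with
`m_crit(k) ≥ 0` for all `k` (no scaling, coupling or volume hypothesis used), every `c ≤ 1` and
every positive mass tuple, the EXTINCT clause holds — its numerator is the integral of `0`. -/
theorem extinct_of_mcrit_nonneg (reg : QCDRegularisation Nf) (hcrit : ∀ k, 0 ≤ reg.mcrit k)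
    {c : ℝ} (hc1 : c ≤ 1) (m : Fin Nf → ℝ) (hm : ∀ f, 0 < m f) : Extinct Nf reg c m := by
  intro ε hε
  refine Filter.Eventually.of_forall fun k S _ => ?_
  simp only [defectCount_eq_zero reg (hcrit k) hc1 m hm, zero_mul, integral_zero, zero_div]
  positivity

variable (Nf) in
/-- `SD(N_f)` with the TIGHT clause deleted. -/
def SDWithoutTight : Prop :=
  ∃ reg : QCDRegularisation Nf, reg.HasMassScaling ∧ (reg.scheme 0 0 0).HasAsymptoticScaling ∧
    ∃ M₀ : ℝ, 0 ≤ M₀ ∧ ∃ c : ℝ, 0 < c ∧ ∀ m : Fin Nf → ℝ, (∀ f, M₀ < m f) → Extinct Nf reg c m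

/-- `SD` is `SDWithoutTight` plus TIGHT (sanity: the deletion is faithful). -/
theorem sdWithoutTight_of_sdHyp (h : SDHyp Nf) : SDWithoutTight Nf := by
  obtain ⟨reg, h1, h2, M₀, hM₀, c, hc, h⟩ := h
  exact ⟨reg, h1, h2, M₀, hM₀, c, hc, fun m hm => (h m hm).1⟩

variable (Nf) in
/-- **Junk witness.** The degenerate tree regularisation `canonicalAF` (`a_k = 1/(k+1)`,
`L_k = (k+1)²`, `β_k = afBeta N_f 1 a_k`, `m_crit ≡ 0`, `Z_m(k) = (log a_k⁻²)^{γ₀/(2β₀)}`) is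
mass-scaling, asymptotically scaling and satisfies EXTINCT with `M₀ = 0`, `c = 1`. -/
theorem sdWithoutTight_canonicalAF : SDWithoutTight Nf :=
  ⟨QCDRegularisation.canonicalAF Nf, QCDRegularisation.canonicalAF_hasMassScaling,
    QCDScheme.zeroAF_hasAsymptoticScaling, 0, le_rfl, 1, one_pos,
    fun m hm => extinct_of_mcrit_nonneg _ (fun _ => le_rfl) le_rfl m hm⟩

/-- The crux with TIGHT deleted from its hypothesis. -/
def ExtinctionBuildsQCDWithoutTight : Prop :=
  ∀ Nf : ℕ, (Nf = 2 ∨ Nf = 3) → SDWithoutTight Nf → QCDOf Nf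

/-- **LOAD-BEARING: without TIGHT the bridge IS the summit conjunct** (`QCD = QCDOf 2 ∧ QCDOf 3`).
Any proof of `ExtinctionBuildsQCD` must use TIGHT; EXTINCT (sign AND coercivity counts, any
`c ≤ 1`), mass scaling and asymptotic scaling together carry no information. -/
theorem extinctionBuildsQCDWithoutTight_iff_qcd : ExtinctionBuildsQCDWithoutTight ↔ _root_.QCD :=
  ⟨fun h => ⟨h 2 (Or.inl rfl) (sdWithoutTight_canonicalAF 2),
      h 3 (Or.inr rfl) (sdWithoutTight_canonicalAF 3)⟩,
    fun hq Nf hNf _ => by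
      rcases hNf with rfl | rfl
      exacts [hq.1, hq.2]⟩

/-- **Collapse schema for candidate repairs of TIGHT.** Replacing TIGHT by ANY side condition `P`
on the regularisation that the degenerate witness `canonicalAF` happens to satisfy — e.g.
"`m_crit(k) ∈ [-8, 0]`", "`m_crit(k) → 0`", "`|m_crit(k)| ≤ C g₀(k)²`", "`m_crit` flavour-blind and
monotone" — still yields a statement equivalent to the summit conjunct. Only a condition with
INDEX content (net chirality of real modes just past the line) can pin the line. -/
theorem bridge_collapse_schema (P : ∀ Nf : ℕ, QCDRegularisation Nf → Prop)
    (hP : ∀ Nf, P Nf (QCDRegularisation.canonicalAF Nf)) :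
    (∀ Nf : ℕ, (Nf = 2 ∨ Nf = 3) →
      (∃ reg : QCDRegularisation Nf, P Nf reg ∧ reg.HasMassScaling ∧
        (reg.scheme 0 0 0).HasAsymptoticScaling ∧ ∃ M₀ : ℝ, 0 ≤ M₀ ∧ ∃ c : ℝ, 0 < c ∧
          ∀ m : Fin Nf → ℝ, (∀ f, M₀ < m f) → Extinct Nf reg c m) → QCDOf Nf) ↔ _root_.QCD := by
  have hw : ∀ Nf, ∃ reg : QCDRegularisation Nf, P Nf reg ∧ reg.HasMassScaling ∧
      (reg.scheme 0 0 0).HasAsymptoticScaling ∧ ∃ M₀ : ℝ, 0 ≤ M₀ ∧ ∃ c : ℝ, 0 < c ∧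
        ∀ m : Fin Nf → ℝ, (∀ f, M₀ < m f) → Extinct Nf reg c m := fun Nf =>
    ⟨QCDRegularisation.canonicalAF Nf, hP Nf, QCDRegularisation.canonicalAF_hasMassScaling,
      QCDScheme.zeroAF_hasAsymptoticScaling, 0, le_rfl, 1, one_pos,
      fun m hm => extinct_of_mcrit_nonneg _ (fun _ => le_rfl) le_rfl m hm⟩
  exact ⟨fun h => ⟨h 2 (Or.inl rfl) (hw 2), h 3 (Or.inr rfl) (hw 3)⟩,
    fun hq Nf hNf _ => by
      rcases hNf with rfl | rfl
      exacts [hq.1, hq.2]⟩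

/-- Instance of the schema: pinning the line into the shadow of the Wilson hole, `m_crit(k) ∈
[-8, 0]` for all `k` (which TIGHT does force, §3), is NOT a substitute for TIGHT. -/
theorem extinctionBuildsQCDWithLinePinned_iff_qcd :
    (∀ Nf : ℕ, (Nf = 2 ∨ Nf = 3) →
      (∃ reg : QCDRegularisation Nf, (∀ k, -8 ≤ reg.mcrit k ∧ reg.mcrit k ≤ 0) ∧
        reg.HasMassScaling ∧ (reg.scheme 0 0 0).HasAsymptoticScaling ∧ ∃ M₀ : ℝ, 0 ≤ M₀ ∧
          ∃ c : ℝ, 0 < c ∧ ∀ m : Fin Nf → ℝ, (∀ f, M₀ < m f) → Extinct Nf reg c m) → QCDOf Nf) ↔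
      _root_.QCD :=
  bridge_collapse_schema (fun _ reg => ∀ k, -8 ≤ reg.mcrit k ∧ reg.mcrit k ≤ 0)
    fun _ _ => ⟨by norm_num [QCDRegularisation.canonicalAF], le_rfl⟩

end LoadBearing


/-! ## §3 TIGHT pins the line into `[-8, 0]`: chiral inertia of `Γ₅ D_W(U, m₀, 1)` off the hole -/

section Inertia

variable {n : Type*} [Fintype n] [DecidableEq n]

/-- **The Hermitian form in eigen-coordinates**: `Re⟨v, A v⟩ = Σ_i λ_i ‖(U† v)_i‖²` for a Hermitian
matrix `A = U diag(λ) U†` (Mathlib's `eigenvectorUnitary`). -/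
theorem re_form_eq_sum_eigenvalues {A : Matrix n n ℂ} (hA : A.IsHermitian) (v : n → ℂ) :
    (star v ⬝ᵥ (A *ᵥ v)).re =
      ∑ i, hA.eigenvalues i * ‖((hA.eigenvectorUnitary : Matrix n n ℂ)ᴴ *ᵥ v) i‖ ^ 2 := by
  set U : Matrix n n ℂ := (hA.eigenvectorUnitary : Matrix n n ℂ) with hUdef
  have hof : (RCLike.ofReal ∘ hA.eigenvalues : n → ℂ) = fun i => ((hA.eigenvalues i : ℝ) : ℂ) := rfl
  have hU : A = U * diagonal (fun i => ((hA.eigenvalues i : ℝ) : ℂ)) * Uᴴ := by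
    have h := hA.spectral_theorem
    rw [Unitary.conjStarAlgAut_apply, star_eq_conjTranspose, hof] at h
    exact h
  set w := Uᴴ *ᵥ v with hw
  calc (star v ⬝ᵥ (A *ᵥ v)).re
      = (star v ⬝ᵥ ((U * diagonal (fun i => ((hA.eigenvalues i : ℝ) : ℂ)) * Uᴴ) *ᵥ v)).re := by
        rw [← hU]
    _ = (star w ⬝ᵥ (diagonal (fun i => ((hA.eigenvalues i : ℝ) : ℂ)) *ᵥ w)).re := by
        rw [← mulVec_mulVec, ← mulVec_mulVec, dotProduct_mulVec, hw, star_mulVec,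
          conjTranspose_conjTranspose]
    _ = ∑ i, hA.eigenvalues i * ‖w i‖ ^ 2 := by
        rw [dotProduct, Complex.re_sum]
        refine Finset.sum_congr rfl fun i _ => ?_
        rw [mulVec_diagonal, Pi.star_apply, Complex.star_def]
        have : (starRingEnd ℂ) (w i) * (((hA.eigenvalues i : ℝ) : ℂ) * w i) =
            ((hA.eigenvalues i : ℝ) : ℂ) * ((starRingEnd ℂ) (w i) * w i) := by ring
        rw [this, ← Complex.normSq_eq_conj_mul_self, Complex.re_ofReal_mul, Complex.ofReal_re,
          Complex.normSq_eq_norm_sq]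

/-- **Inertia lower bound (Sylvester, one direction).** If the real quadratic form
`s · Re⟨v, A v⟩` of a Hermitian matrix `A` is positive on the image of a linear map `E` from
`ι → ℂ` (off `c = 0`), then `A` has at least `card ι` eigenvalues `λ` with `s λ > 0` (counted in
Mathlib's enumeration `hA.eigenvalues`). Proof: `c ↦ (U† E c)|_{s λ > 0}` is injective, since a
kernel vector would have `s Re⟨Ec, A Ec⟩ = Σ_{s λ_i ≤ 0} s λ_i ‖(U†Ec)_i‖² ≤ 0`. -/
theorem card_le_card_eigenvalues_of_form_pos {A : Matrix n n ℂ} (hA : A.IsHermitian) (s : ℝ)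
    {ι : Type*} [Fintype ι] (E : (ι → ℂ) →ₗ[ℂ] (n → ℂ))
    (hpos : ∀ c : ι → ℂ, c ≠ 0 → 0 < s * (star (E c) ⬝ᵥ (A *ᵥ E c)).re) :
    Fintype.card ι ≤ (Finset.univ.filter fun i => 0 < s * hA.eigenvalues i).card := by
  set U : Matrix n n ℂ := (hA.eigenvectorUnitary : Matrix n n ℂ) with hUdef
  let P : Type _ := {i : n // 0 < s * hA.eigenvalues i}
  -- the comparison map `c ↦ (U† E c)|_P`
  let φ : (ι → ℂ) →ₗ[ℂ] (P → ℂ) :=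
    (LinearMap.funLeft ℂ ℂ (Subtype.val : P → n)) ∘ₗ (Matrix.mulVecLin Uᴴ) ∘ₗ E
  have hφ : ∀ c, φ c = fun i : P => (Uᴴ *ᵥ E c) i.val := fun c => rfl
  have hinj : Function.Injective φ := by
    rw [← LinearMap.ker_eq_bot, LinearMap.ker_eq_bot']
    intro c hc
    by_contra hc0
    have hlt := hpos c hc0
    have hzero : ∀ i : n, 0 < s * hA.eigenvalues i → (Uᴴ *ᵥ E c) i = 0 := fun i hi => by
      have := congrFun (hφ c ▸ hc) ⟨i, hi⟩
      simpa using this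
    have hle : s * (star (E c) ⬝ᵥ (A *ᵥ E c)).re ≤ 0 := by
      rw [re_form_eq_sum_eigenvalues hA (E c), Finset.mul_sum]
      refine Finset.sum_nonpos fun i _ => ?_
      by_cases hi : 0 < s * hA.eigenvalues i
      · rw [hzero i hi, norm_zero]; simp
      · push Not at hi
        have : 0 ≤ ‖((hA.eigenvectorUnitary : Matrix n n ℂ)ᴴ *ᵥ E c) i‖ ^ 2 := by positivity
        nlinarith
    linarith
  have h := LinearMap.finrank_le_finrank_of_injective hinj
  rw [Module.finrank_pi, Module.finrank_pi] at h
  simpa [P, Fintype.card_subtype] using h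

/-- Counting roots of the characteristic polynomial of a Hermitian matrix through Mathlib's
eigenvalue enumeration. -/
theorem countP_roots_charpoly_eq_card {A : Matrix n n ℂ} (hA : A.IsHermitian) (p : ℂ → Prop)
    [DecidablePred p] :
    A.charpoly.roots.countP p =
      (Finset.univ.filter fun i => p ((hA.eigenvalues i : ℝ) : ℂ)).card := by
  rw [hA.roots_charpoly_eq_eigenvalues, Multiset.countP_map, Finset.card_def, Finset.filter_val]
  rfl

/-- **Chiral inertia.** If a Hermitian `A` has `s Re⟨v,Av⟩ > 0` on the image of `Ep` and
`< 0` on the image of `Em`, with `card ιp + card ιm = card n`, then `A` has exactly `card ιm`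
eigenvalues with `s λ < 0` (as roots of the characteristic polynomial, with multiplicity) — and no
zero eigenvalue. -/
theorem countP_neg_eq_of_chiral {A : Matrix n n ℂ} (hA : A.IsHermitian)
    {ιp ιm : Type*} [Fintype ιp] [Fintype ιm]
    (Ep : (ιp → ℂ) →ₗ[ℂ] (n → ℂ)) (Em : (ιm → ℂ) →ₗ[ℂ] (n → ℂ))
    (hpos : ∀ c : ιp → ℂ, c ≠ 0 → 0 < (star (Ep c) ⬝ᵥ (A *ᵥ Ep c)).re)
    (hneg : ∀ c : ιm → ℂ, c ≠ 0 → (star (Em c) ⬝ᵥ (A *ᵥ Em c)).re < 0)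
    (hcard : Fintype.card ιp + Fintype.card ιm = Fintype.card n) :
    A.charpoly.roots.countP (fun z => z.re < 0) = Fintype.card ιm := by
  have hp := card_le_card_eigenvalues_of_form_pos hA 1 Ep (fun c hc => by simpa using hpos c hc)
  have hm := card_le_card_eigenvalues_of_form_pos hA (-1) Em
    (fun c hc => by have := hneg c hc; linarith)
  simp only [one_mul] at hp
  simp only [neg_mul, one_mul, Left.neg_pos_iff] at hm
  -- the two eigenvalue sets are disjoint
  have hdisj : Disjoint (Finset.univ.filter fun i => 0 < hA.eigenvalues i)
      (Finset.univ.filter fun i => hA.eigenvalues i < 0) := by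
    rw [Finset.disjoint_filter]
    intro i _ h1 h2
    linarith
  have hunion : ((Finset.univ.filter fun i => 0 < hA.eigenvalues i) ∪
      (Finset.univ.filter fun i => hA.eigenvalues i < 0)).card ≤ Fintype.card n :=
    Finset.card_le_univ _
  rw [Finset.card_union_of_disjoint hdisj] at hunion
  rw [countP_roots_charpoly_eq_card hA]
  have : (Finset.univ.filter fun i => ((hA.eigenvalues i : ℝ) : ℂ).re < 0) =
      (Finset.univ.filter fun i => hA.eigenvalues i < 0) := by
    simp only [Complex.ofReal_re]
  rw [this]
  omega

end Inertia

section ChiralWilson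

variable {L : ℕ} [NeZero L]

/-- Half-spinor index: site × colour × two spin components. -/
abbrev HalfIdx (L : ℕ) : Type := TorusSite 4 L × Fin 3 × Fin 2

/-- **Chiral embedding**: place a half-spinor into the spin components `o, o+1` (`o = 0`: the
`γ₅ = +1` components, `o = 2`: the `γ₅ = -1` components of `gammaFive = diag(1,1,-1,-1)`). -/
def spinEmbed (o : ℕ) : (HalfIdx L → ℂ) →ₗ[ℂ] (QuarkIdx L → ℂ) where
  toFun c p := if h : o ≤ p.2.2.val ∧ p.2.2.val < o + 2 then
      c (p.1, p.2.1, ⟨p.2.2.val - o, by omega⟩) else 0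
  map_add' c d := by
    funext p
    simp only [Pi.add_apply]
    split_ifs <;> simp
  map_smul' a c := by
    funext p
    simp only [Pi.smul_apply, smul_eq_mul, RingHom.id_apply]
    split_ifs <;> simp

omit [NeZero L] in
theorem spinEmbed_apply (o : ℕ) (c : HalfIdx L → ℂ) (p : QuarkIdx L) :
    spinEmbed o c p = if h : o ≤ p.2.2.val ∧ p.2.2.val < o + 2 then
      c (p.1, p.2.1, ⟨p.2.2.val - o, by omega⟩) else 0 := rfl

omit [NeZero L] in
/-- The chiral embedding is injective. -/
theorem spinEmbed_ne_zero {o : ℕ} (ho : o + 2 ≤ 4) {c : HalfIdx L → ℂ} (hc : c ≠ 0) :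
    spinEmbed o c ≠ 0 := by
  intro h
  apply hc
  funext q
  obtain ⟨x, a, j⟩ := q
  have hj := j.isLt
  have := congrFun h (x, a, ⟨j.val + o, by omega⟩)
  rw [spinEmbed_apply, dif_pos ⟨by simp, by simp; omega⟩] at this
  simpa using this

/-- `Γ₅` acts as `+1` on the image of the upper embedding and as `-1` on the lower one. -/
theorem gammaFive_mulVec_spinEmbed (c : HalfIdx L → ℂ) :
    spinorLift (L := L) (N := 3) gammaFive *ᵥ spinEmbed 0 c = spinEmbed 0 c ∧
      spinorLift (L := L) (N := 3) gammaFive *ᵥ spinEmbed 2 c = -spinEmbed 2 c := by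
  constructor
  · funext p
    rw [spinorLift_gammaFive_eq_diagonal, mulVec_diagonal, spinEmbed_apply]
    obtain ⟨x, a, α⟩ := p
    fin_cases α <;> simp
  · funext p
    rw [Pi.neg_apply, spinorLift_gammaFive_eq_diagonal, mulVec_diagonal, spinEmbed_apply]
    obtain ⟨x, a, α⟩ := p
    fin_cases α <;> simp

omit [NeZero L] in
/-- `Γ₅` is Hermitian (inline, as in the barrier file). -/
theorem conjTranspose_spinorLift_gammaFive' :
    (spinorLift (L := L) (N := 3) gammaFive)ᴴ = spinorLift gammaFive := by
  rw [spinorLift_gammaFive_eq_diagonal, diagonal_conjTranspose]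
  congr 1
  funext p
  obtain ⟨x, a, α⟩ := p
  fin_cases α <;> simp

/-- On a `γ₅`-eigenvector with eigenvalue `ε = ±1`, the Hermitian Wilson form is `ε Re⟨v, D v⟩`:
`⟨v, Γ₅ D v⟩ = ⟨Γ₅ v, D v⟩`. -/
theorem form_gammaFive_mul_of_chiral (D : Matrix (QuarkIdx L) (QuarkIdx L) ℂ)
    (v : QuarkIdx L → ℂ) (ε : ℂ) (hv : spinorLift (L := L) (N := 3) gammaFive *ᵥ v = ε • v) :
    star v ⬝ᵥ ((spinorLift gammaFive * D) *ᵥ v) = (starRingEnd ℂ) ε * (star v ⬝ᵥ (D *ᵥ v)) := by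
  rw [← mulVec_mulVec, dotProduct_mulVec, ← conjTranspose_conjTranspose (spinorLift gammaFive),
    ← star_mulVec, conjTranspose_spinorLift_gammaFive', hv, star_smul, smul_dotProduct,
    smul_eq_mul, Complex.star_def]

/-- `card (HalfIdx L) = 6 L⁴`. -/
theorem card_halfIdx : Fintype.card (HalfIdx L) = 6 * L ^ 4 := by
  simp only [HalfIdx, TorusSite, Fintype.card_prod, Fintype.card_fun, ZMod.card, Fintype.card_fin]
  ring

/-- **Chiral inertia of the Hermitian Wilson operator off the hole.** For every `SU(3)` gauge
field on the torus of side `L` and every bare mass `m₀ > 0` or `m₀ < -8`, `Γ₅ D_W(U, m₀, 1)` has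
EXACTLY `6 L⁴` negative eigenvalues (half of `12 L⁴`), counted as roots of the characteristic
polynomial: `Re⟨v, D_W(m₀) v⟩` has a sign on all of `ℂ^{12L⁴}` (`re_star_dotProduct_wilsonDirac_mem`),
so `⟨v, Γ₅ D v⟩ = ±Re⟨v, Dv⟩` is definite on the two `6L⁴`-dimensional chirality sectors
(Sylvester). Hence the TIGHT integrand `|n₋ − 6(2L_k+1)⁴|` VANISHES IDENTICALLY whenever the
probe mass `m_crit(k) − a_k M/Z_k` leaves `[-8, 0]`. -/
theorem negCount_hermitianWilson_eq {m₀ : ℝ} (hm : 0 < m₀ ∨ m₀ < -8) (U : GaugeConfig 4 L SU3) :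
    Multiset.countP (fun z : ℂ => z.re < 0)
      (spinorLift gammaFive * wilsonDirac (fundamentalRep (Fin 3)) U m₀ 1).charpoly.roots =
        6 * L ^ 4 := by
  set D := wilsonDirac (fundamentalRep (Fin 3)) U m₀ 1 with hD
  have hH : (spinorLift gammaFive * D).IsHermitian :=
    Literature.Barriers.QuantumFields.isHermitian_gammaFive_mul_wilsonDirac (fundamentalRep (Fin 3))
      fundamentalRep_mem_unitaryGroup U m₀ 1
  have hcard : Fintype.card (HalfIdx L) + Fintype.card (HalfIdx L) = Fintype.card (QuarkIdx L) := by
    rw [card_halfIdx, card_quarkIdx]; ring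
  -- the form on the two chiral sectors
  have hup : ∀ c : HalfIdx L → ℂ, (star (spinEmbed 0 c) ⬝ᵥ
      ((spinorLift gammaFive * D) *ᵥ spinEmbed 0 c)).re =
        (star (spinEmbed 0 c) ⬝ᵥ (D *ᵥ spinEmbed 0 c)).re := by
    intro c
    rw [form_gammaFive_mul_of_chiral D _ 1 (by rw [one_smul]; exact (gammaFive_mulVec_spinEmbed c).1),
      map_one, one_mul]
  have hdown : ∀ c : HalfIdx L → ℂ, (star (spinEmbed 2 c) ⬝ᵥ
      ((spinorLift gammaFive * D) *ᵥ spinEmbed 2 c)).re =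
        -(star (spinEmbed 2 c) ⬝ᵥ (D *ᵥ spinEmbed 2 c)).re := by
    intro c
    rw [form_gammaFive_mul_of_chiral D _ (-1)
      (by rw [neg_one_smul]; exact (gammaFive_mulVec_spinEmbed c).2), map_neg, map_one, neg_one_mul,
      Complex.neg_re]
  rw [← card_halfIdx (L := L)]
  rcases hm with hm | hm
  · refine countP_neg_eq_of_chiral hH (spinEmbed 0) (spinEmbed 2)
      (fun c hc => ?_) (fun c hc => ?_) hcard
    · rw [hup]
      have h := (re_star_dotProduct_wilsonDirac_mem U m₀ (spinEmbed 0 c)).1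
      have hN := sum_norm_sq_pos (spinEmbed_ne_zero (o := 0) (by norm_num) hc)
      nlinarith
    · rw [hdown]
      have h := (re_star_dotProduct_wilsonDirac_mem U m₀ (spinEmbed 2 c)).1
      have hN := sum_norm_sq_pos (spinEmbed_ne_zero (o := 2) le_rfl hc)
      nlinarith
  · refine countP_neg_eq_of_chiral hH (spinEmbed 2) (spinEmbed 0)
      (fun c hc => ?_) (fun c hc => ?_) hcard
    · rw [hdown]
      have h := (re_star_dotProduct_wilsonDirac_mem U m₀ (spinEmbed 2 c)).2
      have hN := sum_norm_sq_pos (spinEmbed_ne_zero (o := 2) le_rfl hc)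
      nlinarith
    · rw [hup]
      have h := (re_star_dotProduct_wilsonDirac_mem U m₀ (spinEmbed 0 c)).2
      have hN := sum_norm_sq_pos (spinEmbed_ne_zero (o := 0) (by norm_num) hc)
      nlinarith

end ChiralWilson

section TightPins

variable {Nf : ℕ}

/-- **TIGHT forces the probes into `[-8, 0]`.** For ANY witness data, if TIGHT holds at the mass
tuple `m` then for every `M > M₀`, eventually `m_crit(k) − a_k M/Z_m(k) ∈ [-8, 0]` — off this
interval the TIGHT integrand is identically zero (`negCount_hermitianWilson_eq`), the ratio is
`0 < 1`. In particular every junk witness with the line at bare mass `≥ δ > 0` (or `≤ -8 - δ`)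
infinitely often FAILS TIGHT, although it satisfies EXTINCT for free (§2). -/
theorem Tight.eventually_probe_mem (reg : QCDRegularisation Nf) (M₀ : ℝ) (m : Fin Nf → ℝ)
    (h : Tight Nf reg M₀ m) {M : ℝ} (hM : M₀ < M) :
    ∀ᶠ k : ℕ in Filter.atTop,
      reg.mcrit k - reg.a k * M / reg.Zm k ∈ Set.Icc (-8 : ℝ) 0 := by
  filter_upwards [h M hM] with k hk
  by_contra hout
  have hout' : 0 < reg.mcrit k - reg.a k * M / reg.Zm k ∨ reg.mcrit k - reg.a k * M / reg.Zm k < -8 := by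
    simp only [Set.mem_Icc, not_and_or, not_le] at hout
    tauto
  simp only [negCount_hermitianWilson_eq hout', Nat.cast_mul, Nat.cast_pow, Nat.cast_add,
    Nat.cast_ofNat, Nat.cast_one, sub_self, abs_zero, zero_mul, integral_zero, zero_div] at hk
  exact absurd hk (by norm_num)

/-- Consequence for the full hypothesis: a spectrally clean regularisation has its line pinned,
`limsup m_crit(k) ≤ 0` and `liminf m_crit(k) ≥ -8` in the precise form below. -/
theorem SDHyp.line_pinned (h : SDHyp Nf) :
    ∃ reg : QCDRegularisation Nf, ∃ M₀ : ℝ, 0 ≤ M₀ ∧ reg.HasMassScaling ∧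
      (∃ c : ℝ, 0 < c ∧ ∀ m : Fin Nf → ℝ, (∀ f, M₀ < m f) → Extinct Nf reg c m ∧ Tight Nf reg M₀ m) ∧
      ∀ M : ℝ, M₀ < M → ∀ᶠ k : ℕ in Filter.atTop,
        reg.mcrit k - reg.a k * M / reg.Zm k ∈ Set.Icc (-8 : ℝ) 0 := by
  obtain ⟨reg, h1, -, M₀, hM₀, c, hc, h⟩ := h
  refine ⟨reg, M₀, hM₀, h1, ⟨c, hc, h⟩, fun M hM => ?_⟩
  exact Tight.eventually_probe_mem reg M₀ (fun _ => M₀ + 1) (h _ fun _ => by linarith).2 hM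

end TightPins


section Independence

variable (Nf : ℕ)

/-- **Junk witness with a positive line**: the degenerate regularisation `canonicalAF` with the
line moved to bare mass `m_crit ≡ 1` (deep in the `κ < 1/8` region). -/
noncomputable def shiftedAF : QCDRegularisation Nf :=
  { QCDRegularisation.canonicalAF Nf with mcrit := fun _ => 1 }

/-- It is mass-scaling (same `Z_m`, `a` as `canonicalAF`). -/
theorem shiftedAF_hasMassScaling : (shiftedAF Nf).HasMassScaling :=
  QCDRegularisation.canonicalAF_hasMassScaling

/-- It is asymptotically scaling (same `β`, `a` as `QCDScheme.zeroAF`). -/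
theorem shiftedAF_hasAsymptoticScaling : ((shiftedAF Nf).scheme 0 0 0).HasAsymptoticScaling :=
  QCDScheme.zeroAF_hasAsymptoticScaling

/-- It satisfies EXTINCT for every positive mass tuple, with `c = 1` (§2). -/
theorem shiftedAF_extinct (m : Fin Nf → ℝ) (hm : ∀ f, 0 < m f) : Extinct Nf (shiftedAF Nf) 1 m :=
  extinct_of_mcrit_nonneg _ (fun _ => zero_le_one) le_rfl m hm

/-- Its TIGHT probes are eventually POSITIVE (for asymptotically free flavour numbers, where the
mass exponent `γ₀/(2β₀)` is non-negative so that `Z_m(k) ≥ 1`): `1 − M/((k+1) Z_m(k)) > 0`. -/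
theorem shiftedAF_probe_pos (hNf : Nf ≤ 16) {M : ℝ} (hM : 0 < M) :
    ∀ᶠ k : ℕ in Filter.atTop,
      0 < (shiftedAF Nf).mcrit k - (shiftedAF Nf).a k * M / (shiftedAF Nf).Zm k := by
  have hp : 0 ≤ massExponent Nf := by
    unfold massExponent gammaCoeff₀ betaCoeff₀
    have : (Nf : ℝ) ≤ 16 := by exact_mod_cast hNf
    apply div_nonneg (by positivity)
    apply mul_nonneg zero_le_two
    exact div_nonneg (by linarith) (by positivity)
  obtain ⟨K, hK⟩ := exists_nat_gt M
  filter_upwards [Filter.eventually_ge_atTop (max K 1)] with k hk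
  have hk1 : 1 ≤ k := le_of_max_le_right hk
  have hkK : K ≤ k := le_of_max_le_left hk
  have ha : (shiftedAF Nf).a k = ((k : ℝ) + 1)⁻¹ := rfl
  have hcrit : (shiftedAF Nf).mcrit k = 1 := rfl
  have hZ : 1 ≤ (shiftedAF Nf).Zm k := by
    show 1 ≤ (if k = 0 then (1 : ℝ) else
      Real.log (1 / (QCDScheme.zeroAF Nf).a k ^ 2) ^ massExponent Nf)
    rw [if_neg (by omega)]
    apply Real.one_le_rpow _ hp
    have hak : (QCDScheme.zeroAF Nf).a k = ((k : ℝ) + 1)⁻¹ := rfl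
    rw [hak, Real.le_log_iff_exp_le (by positivity)]
    have hk2 : (2 : ℝ) ≤ (k : ℝ) + 1 := by
      have : (1 : ℝ) ≤ k := by exact_mod_cast hk1
      linarith
    calc Real.exp 1 ≤ 3 := by have := Real.exp_one_lt_d9; linarith
      _ ≤ 1 / ((k : ℝ) + 1)⁻¹ ^ 2 := by rw [inv_pow, one_div, inv_inv]; nlinarith
  rw [ha, hcrit]
  have hkM : M < (k : ℝ) + 1 := by
    have : (K : ℝ) ≤ k := by exact_mod_cast hkK
    linarith
  have hfrac : ((k : ℝ) + 1)⁻¹ * M / (shiftedAF Nf).Zm k ≤ ((k : ℝ) + 1)⁻¹ * M :=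
    div_le_self (by positivity) hZ
  have hlt : ((k : ℝ) + 1)⁻¹ * M < 1 := by
    rw [inv_mul_lt_iff₀ (by positivity)]
    linarith
  linarith

/-- **It FAILS TIGHT** for every threshold `M₀ ≥ 0` and every mass tuple (§3: TIGHT pins the
probes into `[-8, 0]`, but here they are eventually positive). -/
theorem shiftedAF_not_tight (hNf : Nf ≤ 16) {M₀ : ℝ} (hM₀ : 0 ≤ M₀) (m : Fin Nf → ℝ) :
    ¬ Tight Nf (shiftedAF Nf) M₀ m := by
  intro h
  have h1 := Tight.eventually_probe_mem _ _ _ h (M := M₀ + 1) (by linarith)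
  have h2 := shiftedAF_probe_pos Nf hNf (M := M₀ + 1) (by linarith)
  obtain ⟨k, hk1, hk2⟩ := (h1.and h2).exists
  exact absurd hk1.2 (not_le.2 hk2)

/-- **TIGHT is logically independent of the rest of `SD`** (for every asymptotically free
`N_f ≤ 16`, in particular `N_f = 2, 3`): there is a mass-scaling, asymptotically scaling
regularisation satisfying EXTINCT for all positive masses (with `c = 1`) and failing TIGHT for
every admissible threshold and every mass tuple. Together with §2: EXTINCT ∧ scalings prove
nothing, TIGHT is the load-bearing clause, and it is not a consequence of the others. -/
theorem tight_independent (hNf : Nf ≤ 16) :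
    ∃ reg : QCDRegularisation Nf, reg.HasMassScaling ∧ (reg.scheme 0 0 0).HasAsymptoticScaling ∧
      (∀ m : Fin Nf → ℝ, (∀ f, 0 < m f) → Extinct Nf reg 1 m) ∧
      ∀ M₀ : ℝ, 0 ≤ M₀ → ∀ m : Fin Nf → ℝ, ¬ Tight Nf reg M₀ m :=
  ⟨shiftedAF Nf, shiftedAF_hasMassScaling Nf, shiftedAF_hasAsymptoticScaling Nf,
    shiftedAF_extinct Nf, fun _ hM₀ m => shiftedAF_not_tight Nf hNf hM₀ m⟩

end Independence


/-! ## §4 The volume lever: `SD` does not bound `L_k` above; TIGHT at the tip MODULO infinite-volume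
index spreading, and then the bridge is the summit conjunct

The pricing that is supposed to defeat a TIP witness (a line at `m_crit(k) ≥ 0`, for which EXTINCT is
free, §2) compares the Boltzmann cost `e^{-β_k s}` of an ultra-deep real mode of `D_W(U,0,1)` in
`[0, a_k M/Z_k)` with the entropy of the scheme torus, `(2L_k+1)⁴`, tacitly `≍ a_k⁻⁴`. But `SD` quantifies
`∃ reg : QCDRegularisation N_f`, and the structure constrains the volumes ONLY by `a_k L_k → ∞`
(`QCDRegularisation.tendsto_L`): the witness may take `L_k` as large as it likes — `exp(exp(1/a_k))` is
admissible — while `HasMassScaling`, `HasAsymptoticScaling` do not mention `L` at all, EXTINCT stays free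
for `m_crit ≥ 0` at every volume, and TIGHT is evaluated on the scheme's OWN torus `(2L_k+1)⁴`. So for
the junk family `tipReg L'` (`canonicalAF` with volumes `L'`) the whole of `SD(N_f)` reduces to a
statement with NO continuum content: `IndexSpreadBox N_f` — at the FIXED bare parameters
`(β_k, a_k, Z_k, m_crit = 0)` of step `k`, the phase-quenched first absolute moment of the spectral index
`n₋(Γ₅ D_W(U, -a_k M/Z_k, 1)) - 6(2L'+1)⁴` is `≥ 1` on all sufficiently large tori `(2L'+1)⁴`, uniformly
for masses and `M` in a compact box `[1/(K+1), K+1]` (an infinite-volume statement of lattice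
statistical mechanics at fixed cutoff: no `a → 0`, no OS axioms, no gap; NOT uniform down to `M → 0⁺`,
which would be false — see the CORRECTION in the docstring of `IndexSpreadBox`). `sdHyp_of_indexSpreadBox : IndexSpreadBox N_f → SD(N_f)` and
`extinctionBuildsQCD_iff_qcd_of_indexSpreadBox : IndexSpreadBox 2 → IndexSpreadBox 3 → (ExtinctionBuildsQCD ↔ QCD)`.

WHY `IndexSpreadBox` SHOULD HOLD (heuristic, not provable now; recorded for the planner). By §5 the index at
probe `-δ` (`δ = a_k M/Z_k`) is the net chirality of the real modes of `D_W(U,0,1)` in `[0, δ]`. (i) RATE: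
a smooth lattice instanton of radius `ρ̂ ≳ δ^{-1/2}` inside a cold patch (links within `≲ δ^{1/2}` of a pure
gauge over `≳ ρ̂⁴` sites) carries ONE simple real mode in `(0, δ)` of definite chirality; a simple real
eigenvalue of a `γ₅`-Hermitian matrix cannot leave the axis under small perturbations, so this is an OPEN
set of gauge fields, of positive (hyper-small, `~ e^{-c ρ̂⁴ log(1/δ)}`) probability per site under the
Wilson measure at ANY `β_k`, and the phase-quenched tilt `∏_f |det D_W(U, a_k m_f/Z_k)|` changes conditional
block probabilities only by `e^{±C R⁴ Z_k/(a_k m_f)}` (`‖D_W(m₀)⁻¹‖ ≤ 1/m₀`, §1), a `k`-dependent constant.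
(ii) SYMMETRY: a one-axis reflection conjugates `Γ₅ D_W` to `-Γ₅ D_W` (it anticommutes `γ₅`), preserves the
Wilson measure and the `|det|` weights, so the index law is symmetric, `E₊[index] = 0`. (iii) SPREADING:
distant cold patches are asymptotically independent (Gaussian small-ball events are even positively
correlated), so on `(2L'+1)⁴ ≫ rate⁻¹` sites the index is a symmetric sum of many weakly dependent `±1`'s and
`E₊|index| → ∞`. Only (iii) — a central-limit statement for a non-local spectral functional — is beyond
present technique; it is fixed-cutoff statistical mechanics, incomparably weaker than `QCDOf N_f`.
(The now PROVED sibling crux `TipNoBinding` — no real eigenvalue in `[1/√L, λ_R)` for fields supported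
in a box of radius `R` — does not touch (i): its `λ_R` depends on `R` (a truncated instanton of radius
`ρ̂ < R` has a real mode at `≍ ρ̂⁻²`, so `λ_R ≲ R⁻²`), while the tip family uses objects of lattice size
`≍ (Z_k/(a_k M))^{1/2} → ∞`; and the pricing of `TipPricing` counts against `a_k⁻⁴`, not `(2L_k+1)⁴`.)

CONSEQUENCE. In truth-value the hypothesis `SD(N_f)` of the bridge is (junk-)TRUE and the sibling crux
`WindowExtinction` junk-provable modulo `IndexSpreadBox`; the bridge `ExtinctionBuildsQCD` is then LITERALLY
`QCD`: the route's cut `SD ∧ BRIDGE` carries no decomposition. REPAIRS that restore the intended pin (for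
the planner; each defeats the tip witness heuristically, none is a theorem): (R1) cap the volume,
`∃ p, ∀ᶠ k, (reg.L k : ℝ) ≤ (reg.a k)⁻¹ ^ p` (then `(2L_k+1)⁴ · rate → 0` for tip modes, whose rate
is smaller than any power of `a_k`); (R2) make TIGHT EXTENSIVE at the physical susceptibility scale,
`∃ η > 0, ∀ M > M₀, ∀ᶠ k, E₊|index_k(M)| ≥ η (a_k (2 L_k + 1))²` (honest: `E|Q| ≍ (χ_t V_phys)^{1/2}`; tip junk:
`(rate_k V_lat)^{1/2} = o(a_k² V_lat^{1/2})`); (R3) demand TIGHT on the torus of side `2⌈(a_k)⁻¹⌉+1`-type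
fixed physical multiple rather than on the scheme's own torus. (R1) is the cheapest and loses nothing
for the honest witness (which needs `a_k L_k → ∞` slowly anyway, or EXTINCT's total count on the scheme
torus cannot vanish). -/

section VolumeLever

variable {Nf : ℕ}

/-- The TIGHT ratio of witness data `reg` at step `k`, mass tuple `m`, probe parameter `M`, evaluated on
the torus of half-side `L'` (TIGHT itself is the case `L' = reg.L k`, `tight_iff_tightRatio`). -/
noncomputable def tightRatio (reg : QCDRegularisation Nf) (k L' : ℕ) (m : Fin Nf → ℝ) (M : ℝ) : ℝ :=
  (∫ U, (|(Multiset.countP (fun z : ℂ => z.re < 0) (spinorLift gammaFive * wilsonDirac (fundamentalRep (Fin 3)) U (reg.mcrit k - reg.a k * M / reg.Zm k) 1).charpoly.roots : ℝ) - 6 * (2 * L' + 1 : ℝ) ^ 4|) * ∏ f : Fin Nf, ‖fermionDet (wilsonDirac (fundamentalRep (Fin 3)) U (reg.mcrit k + reg.a k * m f / reg.Zm k) 1)‖ ∂(wilsonMeasure (d := 4) (L := 2 * L' + 1) (fundamentalRep (Fin 3)) (reg.β k))) / (∫ U, ∏ f : Fin Nf, ‖fermionDet (wilsonDirac (fundamentalRep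 (Fin 3)) U (reg.mcrit k + reg.a k * m f / reg.Zm k) 1)‖ ∂(wilsonMeasure (d := 4) (L := 2 * L' + 1) (fundamentalRep (Fin 3)) (reg.β k)))

/-- TIGHT is "eventually the ratio on the scheme's own torus is `≥ 1`" (definitional). -/
theorem tight_iff_tightRatio (reg : QCDRegularisation Nf) (M₀ : ℝ) (m : Fin Nf → ℝ) :
    Tight Nf reg M₀ m ↔ ∀ M : ℝ, M₀ < M → ∀ᶠ k : ℕ in Filter.atTop, 1 ≤ tightRatio reg k (reg.L k) m M :=
  Iff.rfl

/-- **The volume is witness data.** `reg` with its torus half-sides replaced by ANY sequence `L'` with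
`a_k L'_k → ∞` is again a `QCDRegularisation`. -/
def withVolume (reg : QCDRegularisation Nf) (L' : ℕ → ℕ)
    (hL' : Tendsto (fun k => reg.a k * L' k) atTop atTop) : QCDRegularisation Nf :=
  { reg with L := L', tendsto_L := hL' }

/-- The volume datum of `withVolume reg L'` is `L'`. -/
@[simp] theorem withVolume_L (reg : QCDRegularisation Nf) (L' : ℕ → ℕ)
    (hL' : Tendsto (fun k => reg.a k * L' k) atTop atTop) : (withVolume reg L' hL').L = L' := rfl

/-- Mass scaling does not see the volume. -/
theorem withVolume_hasMassScaling_iff (reg : QCDRegularisation Nf) (L' : ℕ → ℕ)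
    (hL' : Tendsto (fun k => reg.a k * L' k) atTop atTop) :
    (withVolume reg L' hL').HasMassScaling ↔ reg.HasMassScaling := Iff.rfl

/-- Asymptotic scaling does not see the volume. -/
theorem withVolume_hasAsymptoticScaling_iff (reg : QCDRegularisation Nf) (L' : ℕ → ℕ)
    (hL' : Tendsto (fun k => reg.a k * L' k) atTop atTop) :
    ((withVolume reg L' hL').scheme 0 0 0).HasAsymptoticScaling ↔
      (reg.scheme 0 0 0).HasAsymptoticScaling := Iff.rfl

/-- The TIGHT ratio on a given torus does not see the scheme's volume datum. -/
theorem tightRatio_withVolume (reg : QCDRegularisation Nf) (L' : ℕ → ℕ)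
    (hL' : Tendsto (fun k => reg.a k * L' k) atTop atTop) (k L'' : ℕ) (m : Fin Nf → ℝ) (M : ℝ) :
    tightRatio (withVolume reg L' hL') k L'' m M = tightRatio reg k L'' m M := rfl

/-- EXTINCT (which DOES see the volume: it ranges over the tori `S ≥ L_k` and is normalised per scheme
torus) is nevertheless free at EVERY volume for a line at non-negative bare mass (§2: integrand `≡ 0`). -/
theorem extinct_withVolume_of_mcrit_nonneg (reg : QCDRegularisation Nf) (L' : ℕ → ℕ)
    (hL' : Tendsto (fun k => reg.a k * L' k) atTop atTop) (hcrit : ∀ k, 0 ≤ reg.mcrit k)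
    {c : ℝ} (hc1 : c ≤ 1) (m : Fin Nf → ℝ) (hm : ∀ f, 0 < m f) :
    Extinct Nf (withVolume reg L' hL') c m :=
  extinct_of_mcrit_nonneg (withVolume reg L' hL') hcrit hc1 m hm

variable (Nf) in
/-- **The tip family**: `canonicalAF` (`m_crit ≡ 0`, `a_k = 1/(k+1)`, `β_k = afBeta N_f 1 a_k`,
`Z_m(k) = (log a_k⁻²)^{γ₀/(2β₀)}`) with arbitrary admissible volumes `L'`. -/
noncomputable def tipReg (L' : ℕ → ℕ)
    (hL' : Tendsto (fun k => (QCDRegularisation.canonicalAF Nf).a k * L' k) atTop atTop) :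
    QCDRegularisation Nf :=
  withVolume (QCDRegularisation.canonicalAF Nf) L' hL'

variable (Nf) in
/-- **Infinite-volume index spreading at fixed cutoff** (the statement `SD(N_f)` reduces to on the tip
family). For every bound `K` on the masses there is `k₀` such that at every LATER step `k` — i.e. at the
FIXED bare parameters `β_k = afBeta N_f 1 (k+1)⁻¹`, `a_k = (k+1)⁻¹`, `Z_k = (log (k+1)²)^{γ₀/(2β₀)}`,
line `m_crit = 0` — the phase-quenched (weights `∏_f |det D_W(U, a_k m_f/Z_k, 1)|`) expectation of
`|n₋(Γ₅ D_W(U, -a_k M/Z_k, 1)) - 6(2L'+1)⁴|` on the torus `(2L'+1)⁴` is `≥ 1` for ALL sufficiently large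
`L'`, uniformly for masses and probe parameter in the COMPACT box `[1/(K+1), K+1]`. A thermodynamic-limit
statement about lattice `SU(3)` gauge fields with a positive quasi-local tilt at ONE coupling: no
continuum limit, no OS data, no mass gap. Heuristically TRUE (module docstring of §4: tip real modes have
a positive rate per site, the index law is reflection-symmetric, distant cold patches decorrelate); its
central-limit part is not provable now.

CORRECTION (cycle 2, same seat). The first landed form of this hypothesis, `Negative.IndexSpread`
(`Theorems/…/Negative/VolumeLever.lean`, p75044), asked for uniformity in `M ∈ (0, K]` at FIXED volume
`L'`; that form is FALSE, not merely unproved: for every gauge field off the null set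
`det D_W(U,0,1) = 0` the index at probe `-δ` vanishes once `δ` is below the least real eigenvalue
(`index_eq_zero_of_no_realMode`, §5), so by dominated convergence `E₊|index(-a_k M/Z_k)| → 0` as
`M → 0⁺` at fixed `(k, L')`. The theorems of `VolumeLever.lean` remain true (implications) but say
nothing; the box form below is the intended hypothesis and `VolumeLeverBox.lean` supersedes. -/
def IndexSpreadBox : Prop :=
  ∀ K : ℕ, ∃ k₀ : ℕ, ∀ k : ℕ, k₀ ≤ k → ∃ L₀ : ℕ, ∀ L' : ℕ, L₀ ≤ L' →
    ∀ m : Fin Nf → ℝ, (∀ f, ((K : ℝ) + 1)⁻¹ ≤ m f ∧ m f ≤ K + 1) →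
      ∀ M : ℝ, ((K : ℝ) + 1)⁻¹ ≤ M → M ≤ K + 1 →
        1 ≤ tightRatio (QCDRegularisation.canonicalAF Nf) k L' m M

/-- **The tip family is TIGHT modulo `IndexSpreadBox`**: a diagonal choice of volumes
`L_k := max (L_k^{can}, max_{K ≤ k} L₀(K, k))` makes `tipReg L` satisfy TIGHT with threshold `M₀ = 0` for
every positive mass tuple. -/
theorem tight_tipReg_of_indexSpreadBox (h : IndexSpreadBox Nf) :
    ∃ (L' : ℕ → ℕ) (hL' : Tendsto (fun k => (QCDRegularisation.canonicalAF Nf).a k * L' k) atTop atTop),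
      ∀ m : Fin Nf → ℝ, (∀ f, 0 < m f) → Tight Nf (tipReg Nf L' hL') 0 m := by
  classical
  choose k₀ hk₀ using h
  -- `L₀ K k` for `k ≥ k₀ K` (junk `0` otherwise)
  have hL₀ : ∀ K k : ℕ, ∃ L₀ : ℕ, k₀ K ≤ k → ∀ L' : ℕ, L₀ ≤ L' →
      ∀ m : Fin Nf → ℝ, (∀ f, ((K : ℝ) + 1)⁻¹ ≤ m f ∧ m f ≤ K + 1) →
        ∀ M : ℝ, ((K : ℝ) + 1)⁻¹ ≤ M → M ≤ K + 1 →
          1 ≤ tightRatio (QCDRegularisation.canonicalAF Nf) k L' m M := by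
    intro K k
    by_cases hk : k₀ K ≤ k
    · obtain ⟨L₀, hL⟩ := hk₀ K k hk
      exact ⟨L₀, fun _ => hL⟩
    · exact ⟨0, fun h => absurd h hk⟩
  choose L₀ hL₀' using hL₀
  set can := QCDRegularisation.canonicalAF Nf with hcan
  -- the diagonal volumes
  let L : ℕ → ℕ := fun k => max (can.L k) ((Finset.range (k + 1)).sup fun K => L₀ K k)
  have hLge : ∀ k, can.L k ≤ L k := fun k => le_max_left _ _
  have hLge' : ∀ K k, K ≤ k → L₀ K k ≤ L k := fun K k hKk =>
    (Finset.le_sup (f := fun K => L₀ K k) (Finset.mem_range.2 (Nat.lt_succ_of_le hKk))).trans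
      (le_max_right _ _)
  have hL : Tendsto (fun k => can.a k * L k) atTop atTop := by
    refine tendsto_atTop_mono (fun k => ?_) can.tendsto_L
    exact mul_le_mul_of_nonneg_left (by exact_mod_cast hLge k) (can.a_pos k).le
  refine ⟨L, hL, fun m hm M hM => ?_⟩
  -- a common box `[1/(K+1), K+1]` containing the masses and the probe parameter
  obtain ⟨K, hK⟩ : ∃ K : ℕ, (∀ f, ((K : ℝ) + 1)⁻¹ ≤ m f ∧ m f ≤ K + 1) ∧
      ((K : ℝ) + 1)⁻¹ ≤ M ∧ M ≤ K + 1 := by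
    set B : ℝ := max (max M M⁻¹) (∑ f, (m f + (m f)⁻¹)) with hB
    refine ⟨⌈B⌉₊, fun f => ⟨?_, ?_⟩, ?_, ?_⟩
    · refine inv_le_of_inv_le₀ (hm f) ?_
      calc (m f)⁻¹ ≤ m f + (m f)⁻¹ := le_add_of_nonneg_left (hm f).le
        _ ≤ ∑ g, (m g + (m g)⁻¹) := Finset.single_le_sum
            (fun g _ => add_nonneg (hm g).le (inv_nonneg.2 (hm g).le)) (Finset.mem_univ f)
        _ ≤ B := le_max_right _ _
        _ ≤ ⌈B⌉₊ + 1 := (Nat.le_ceil _).trans (le_add_of_nonneg_right zero_le_one)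
    · calc m f ≤ m f + (m f)⁻¹ := le_add_of_nonneg_right (inv_nonneg.2 (hm f).le)
        _ ≤ ∑ g, (m g + (m g)⁻¹) := Finset.single_le_sum
            (fun g _ => add_nonneg (hm g).le (inv_nonneg.2 (hm g).le)) (Finset.mem_univ f)
        _ ≤ B := le_max_right _ _
        _ ≤ ⌈B⌉₊ + 1 := (Nat.le_ceil _).trans (le_add_of_nonneg_right zero_le_one)
    · refine inv_le_of_inv_le₀ hM ?_
      calc M⁻¹ ≤ max M M⁻¹ := le_max_right _ _
        _ ≤ B := le_max_left _ _
        _ ≤ ⌈B⌉₊ + 1 := (Nat.le_ceil _).trans (le_add_of_nonneg_right zero_le_one)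
    · calc M ≤ max M M⁻¹ := le_max_left _ _
        _ ≤ B := le_max_left _ _
        _ ≤ ⌈B⌉₊ + 1 := (Nat.le_ceil _).trans (le_add_of_nonneg_right zero_le_one)
  filter_upwards [Filter.eventually_ge_atTop (max (k₀ K) K)] with k hk
  have hk₀K : k₀ K ≤ k := le_of_max_le_left hk
  have hKk : K ≤ k := le_of_max_le_right hk
  -- the scheme's own torus at step `k` is `L k`, and the ratio does not see the volume datum
  exact hL₀' K k hk₀K (L k) (hLge' K k hKk) m hK.1 M hK.2.1 hK.2.2

/-- **`SD(N_f)` with ANY extra side condition met by the tip family holds modulo `IndexSpreadBox`.** The tip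
regularisation is mass-scaling, asymptotically scaling, EXTINCT for all positive masses with `c = 1`
(free, §2) and TIGHT with `M₀ = 0` — the "spectrally clean, tight" witness `WindowExtinction` asks for,
with its line at bare mass ZERO (quarks infinitely heavy in physical units: it sits `|m_crit^{phys}(g₀)| ≍ g₀²`
lattice units, i.e. `≍ g₀²/a_k → ∞` physical units, above the physical critical line). -/
theorem sdWith_of_indexSpreadBox (P : QCDRegularisation Nf → Prop) (hP : ∀ L' hL', P (tipReg Nf L' hL'))
    (h : IndexSpreadBox Nf) :
    ∃ reg : QCDRegularisation Nf, P reg ∧ reg.HasMassScaling ∧ (reg.scheme 0 0 0).HasAsymptoticScaling ∧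
      ∃ M₀ : ℝ, 0 ≤ M₀ ∧ ∃ c : ℝ, 0 < c ∧ ∀ m : Fin Nf → ℝ, (∀ f, M₀ < m f) →
        Extinct Nf reg c m ∧ Tight Nf reg M₀ m := by
  obtain ⟨L', hL', hT⟩ := tight_tipReg_of_indexSpreadBox h
  exact ⟨tipReg Nf L' hL', hP L' hL', QCDRegularisation.canonicalAF_hasMassScaling,
    QCDScheme.zeroAF_hasAsymptoticScaling, 0, le_rfl, 1, one_pos, fun m hm =>
      ⟨extinct_withVolume_of_mcrit_nonneg _ L' hL' (fun _ => le_rfl) le_rfl m hm, hT m hm⟩⟩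

/-- **`SD(N_f)` holds modulo `IndexSpreadBox`** (tip witness). -/
theorem sdHyp_of_indexSpreadBox (h : IndexSpreadBox Nf) : SDHyp Nf := by
  obtain ⟨reg, -, h⟩ := sdWith_of_indexSpreadBox (fun _ => True) (fun _ _ => trivial) h
  exact ⟨reg, h⟩

/-- Hence the sibling crux AS FILED (stmt-8964 text) is junk-provable modulo index spreading:
**`IndexSpreadBox 2 → IndexSpreadBox 3 → FiledHinge`**, witnessed by tip families (lines at bare mass `0`),
not by physical QCD.  (RETIRED TEXT: the restated `WindowExtinction` = SD⁺ escapes this — the tip family has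
FREE volumes, so it fails the cap R1, and under the cap it fails TIGHT⁺, §7.) -/
theorem filedHinge_of_indexSpreadBox (h2 : IndexSpreadBox 2) (h3 : IndexSpreadBox 3) : FiledHinge := by
  intro Nf hNf
  rcases hNf with rfl | rfl
  exacts [sdHyp_of_indexSpreadBox h2, sdHyp_of_indexSpreadBox h3]

/-- **COLLAPSE MODULO INDEX SPREADING (RETIRED TEXT).** If the fixed-cutoff, infinite-volume statement
`IndexSpreadBox` holds for `N_f = 2, 3` (no continuum content), then the bridge AS FILED (stmt-8968,
`FiledBridge`) is LITERALLY the summit conjunct `QCD = QCDOf 2 ∧ QCDOf 3`: its hypothesis is discharged by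
the tip family, whose "spectral cleanliness" says nothing about light quarks.  This finding drove the two
restatements (17572, 18064); the restated decl adopts the repairs R1 (cap) + R2 (extensive TIGHT⁺). -/
theorem filedBridge_iff_qcd_of_indexSpreadBox (h2 : IndexSpreadBox 2) (h3 : IndexSpreadBox 3) :
    FiledBridge ↔ _root_.QCD :=
  ⟨fun h => ⟨h 2 (Or.inl rfl) (sdHyp_of_indexSpreadBox h2), h 3 (Or.inr rfl) (sdHyp_of_indexSpreadBox h3)⟩,
    fun hq Nf hNf _ => by
      rcases hNf with rfl | rfl
      exacts [hq.1, hq.2]⟩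

/-- Negative form (RETIRED TEXT): modulo index spreading, a refutation of the filed crux is exactly a
refutation of `QCD`. -/
theorem not_filedBridge_iff_not_qcd_of_indexSpreadBox (h2 : IndexSpreadBox 2) (h3 : IndexSpreadBox 3) :
    ¬ FiledBridge ↔ ¬ _root_.QCD :=
  not_congr (filedBridge_iff_qcd_of_indexSpreadBox h2 h3)

/-- **Collapse schema with side conditions.** For ANY candidate side condition `P` on the regularisation
that the tip family satisfies at every admissible volume (e.g. `∀ᶠ k, -1 < m_crit k` — the physical-branch
clause suggested in FINDINGS-ideator1 F4 —, `m_crit(k) → 0`, `|m_crit(k)| ≤ C g₀(k)²`, `m_crit ∈ [-8,0]`):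
adding `P` to `SD` does not undo the collapse modulo `IndexSpreadBox`. Only a condition that sees the VOLUME
(R1–R3 of the module docstring) can. -/
theorem collapse_schema_of_indexSpreadBox (P : ∀ Nf : ℕ, QCDRegularisation Nf → Prop)
    (hP : ∀ Nf L' hL', P Nf (tipReg Nf L' hL')) (h2 : IndexSpreadBox 2) (h3 : IndexSpreadBox 3) :
    (∀ Nf : ℕ, (Nf = 2 ∨ Nf = 3) →
      (∃ reg : QCDRegularisation Nf, P Nf reg ∧ reg.HasMassScaling ∧
        (reg.scheme 0 0 0).HasAsymptoticScaling ∧ ∃ M₀ : ℝ, 0 ≤ M₀ ∧ ∃ c : ℝ, 0 < c ∧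
          ∀ m : Fin Nf → ℝ, (∀ f, M₀ < m f) → Extinct Nf reg c m ∧ Tight Nf reg M₀ m) → QCDOf Nf) ↔
      _root_.QCD :=
  ⟨fun h => ⟨h 2 (Or.inl rfl) (sdWith_of_indexSpreadBox (P 2) (hP 2) h2),
      h 3 (Or.inr rfl) (sdWith_of_indexSpreadBox (P 3) (hP 3) h3)⟩,
    fun hq Nf hNf _ => by
      rcases hNf with rfl | rfl
      exacts [hq.1, hq.2]⟩

/-- Instance: the physical-branch clause `∀ k, -1 < m_crit k` (FINDINGS-ideator1 F4's recommended
addition) is met by the tip family (`m_crit ≡ 0`), so it does not restore the cut. -/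
theorem collapse_with_branchClause_of_indexSpreadBox (h2 : IndexSpreadBox 2) (h3 : IndexSpreadBox 3) :
    (∀ Nf : ℕ, (Nf = 2 ∨ Nf = 3) →
      (∃ reg : QCDRegularisation Nf, (∀ k, -1 < reg.mcrit k ∧ reg.mcrit k ≤ 0) ∧ reg.HasMassScaling ∧
        (reg.scheme 0 0 0).HasAsymptoticScaling ∧ ∃ M₀ : ℝ, 0 ≤ M₀ ∧ ∃ c : ℝ, 0 < c ∧
          ∀ m : Fin Nf → ℝ, (∀ f, M₀ < m f) → Extinct Nf reg c m ∧ Tight Nf reg M₀ m) → QCDOf Nf) ↔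
      _root_.QCD :=
  collapse_schema_of_indexSpreadBox (fun _ reg => ∀ k, -1 < reg.mcrit k ∧ reg.mcrit k ≤ 0)
    (fun _ _ _ _ => ⟨by norm_num [tipReg, withVolume, QCDRegularisation.canonicalAF],
      le_rfl⟩) h2 h3

end VolumeLever



/-! ## §5 The index budget: jumps of the spectral index are real modes of `D_W(U,0,1)` (cycle 2)

Configuration-wise, for EVERY `SU(3)` gauge field: `abs_negCount_hermitianWilson_sub_le` —
`|n₋(Γ₅D_W(U,b,1)) - n₋(Γ₅D_W(U,a,1))| ≤ #{real eigenvalues λ of D_W(U,0,1) with -b ≤ λ ≤ -a}` (algebraic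
multiplicity) for all `a ≤ b`; hence (`negCount_hermitianWilson_eq` at `b = 1`)
`abs_index_le_realModeCount`: `|n₋(Γ₅D_W(U,p,1)) - 6L⁴| ≤ #{real λ ≤ -p}` for every probe `p`, and
`tight_integrand_le_signDefects_add_band`: TIGHT integrand `≤` EXTINCT sign defects `+` real modes in
the band `[-(m_crit + w_f), -(m_crit - w_M)]` at the line; `index_eq_zero_of_no_realMode`.
Mechanism (no eigenvalue perturbation theory): Sylvester inertia on both eigen-half-spaces of
`H(s) = Γ₅D_W(U,0,1) + sΓ₅` gives `n₋(H s) ≤ n₋(H t) ≤ n₋(H s) + n₀(H s)` near `s`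
(`negRootCount_local`); `n₀ ≤` algebraic multiplicity (`zeroRootCount_le_count`); an ℕ-valued function
with such local jumps varies over `[a,b]` by at most `#(roots ∩ [a,b])`
(`abs_sub_le_countP_of_local_jumps`: locally constant off the roots ⇒ constant on root-free intervals
by connectedness; induction over the roots inside, endpoints paid once).

READING FOR THE CRUX. TIGHT (`E₊|index_k(M)| ≥ 1` on the scheme torus) can only be met by real modes
of the massless Wilson operator in `[0, a_k M/Z_k - m_crit(k)]`: within `a_k M/Z_k` of the TIP of the
hole for the tip family of §4 (so `IndexSpreadBox` is exactly a statement about ultra-deep real modes and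
their net chirality), inside the band of bare width `a_k(m_f + M)/Z_k` at the line for an honest witness
(there EXTINCT(a) removes everything below the band: `E₊[band modes] ≥ 1 - ε`, the two-sided pin of card
`tight-two-sided-pin`, now with its lemma (ii) PROVED). Landing: `Negative/InertiaPencil.lean`,
`Negative/CrossingBudget.lean`, `Negative/IndexBudget.lean`. -/

section IndexBudgetMatrix

variable {n : Type*}

/-- Extension by zero from the coordinates singled out by a predicate. -/
noncomputable def extendByZero (p : n → Prop) [DecidablePred p] : ({i // p i} → ℂ) →ₗ[ℂ] (n → ℂ) where
  toFun c i := if h : p i then c ⟨i, h⟩ else 0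
  map_add' c d := by
    funext i
    simp only [Pi.add_apply]
    split_ifs <;> simp
  map_smul' a c := by
    funext i
    simp only [Pi.smul_apply, smul_eq_mul, RingHom.id_apply]
    split_ifs <;> simp

theorem extendByZero_apply (p : n → Prop) [DecidablePred p] (c : {i // p i} → ℂ) (i : n) :
    extendByZero p c i = if h : p i then c ⟨i, h⟩ else 0 := rfl

theorem extendByZero_apply_of_pos {p : n → Prop} [DecidablePred p] (c : {i // p i} → ℂ) {i : n}
    (hi : p i) : extendByZero p c i = c ⟨i, hi⟩ := by
  rw [extendByZero_apply, dif_pos hi]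

theorem extendByZero_apply_of_neg {p : n → Prop} [DecidablePred p] (c : {i // p i} → ℂ) {i : n}
    (hi : ¬ p i) : extendByZero p c i = 0 := by
  rw [extendByZero_apply, dif_neg hi]

/-- Extension by zero is injective. -/
theorem extendByZero_ne_zero {p : n → Prop} [DecidablePred p] {c : {i // p i} → ℂ} (hc : c ≠ 0) :
    extendByZero p c ≠ 0 := by
  intro h
  apply hc
  funext ⟨i, hi⟩
  have := congrFun h i
  rwa [extendByZero_apply_of_pos c hi] at this

/-- `Σ_i ‖ext c i‖² = Σ_j ‖c j‖²`. -/
theorem sum_norm_sq_extendByZero [Fintype n] (p : n → Prop) [DecidablePred p] (c : {i // p i} → ℂ) :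
    ∑ i, ‖extendByZero p c i‖ ^ 2 = ∑ j, ‖c j‖ ^ 2 := by
  have h1 : ∑ i, ‖extendByZero p c i‖ ^ 2 =
      ∑ i ∈ Finset.univ.filter p, ‖extendByZero p c i‖ ^ 2 := by
    rw [Finset.sum_filter]
    refine Finset.sum_congr rfl fun i _ => ?_
    split_ifs with hi
    · rfl
    · rw [extendByZero_apply_of_neg c hi, norm_zero]; simp
  rw [h1, Finset.sum_subtype (Finset.univ.filter p) (p := p) (fun i => by simp)]
  refine Finset.sum_congr rfl fun j _ => ?_
  rw [extendByZero_apply_of_pos c j.2]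

/-- A real multiple of a Hermitian matrix added to a Hermitian matrix is Hermitian. -/
theorem isHermitian_add_real_smul {A Γ : Matrix n n ℂ} (hA : A.IsHermitian) (hΓ : Γ.IsHermitian)
    (t : ℝ) : (A + ((t : ℝ) : ℂ) • Γ).IsHermitian := by
  unfold Matrix.IsHermitian at *
  rw [conjTranspose_add, conjTranspose_smul, hA, hΓ, Complex.star_def, Complex.conj_ofReal]

variable [Fintype n] [DecidableEq n]

/-- A unitary matrix preserves `Σ ‖v i‖²`. -/
theorem sum_norm_sq_mulVec_of_mem_unitaryGroup {U : Matrix n n ℂ} (hU : U ∈ Matrix.unitaryGroup n ℂ)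
    (w : n → ℂ) : ∑ i, ‖(U *ᵥ w) i‖ ^ 2 = ∑ i, ‖w i‖ ^ 2 := by
  have hUU : Uᴴ * U = 1 := by
    have := Matrix.mem_unitaryGroup_iff'.1 hU
    simpa [Matrix.star_eq_conjTranspose] using this
  rw [← re_star_dotProduct_self, ← re_star_dotProduct_self, star_mulVec, ← dotProduct_mulVec,
    mulVec_mulVec, hUU, one_mulVec]

/-- `Uᴴ (U w) = w` for a unitary matrix. -/
theorem conjTranspose_mulVec_mulVec_of_mem_unitaryGroup {U : Matrix n n ℂ}
    (hU : U ∈ Matrix.unitaryGroup n ℂ) (w : n → ℂ) : Uᴴ *ᵥ (U *ᵥ w) = w := by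
  have hUU : Uᴴ * U = 1 := by
    have := Matrix.mem_unitaryGroup_iff'.1 hU
    simpa [Matrix.star_eq_conjTranspose] using this
  rw [mulVec_mulVec, hUU, one_mulVec]

/-- Negative-eigenvalue count of a matrix, as in TIGHT: roots of the characteristic polynomial with
negative real part, with multiplicity. -/
noncomputable def negRootCount (M : Matrix n n ℂ) : ℕ := M.charpoly.roots.countP fun z => z.re < 0

/-- Positive-eigenvalue count (roots with positive real part, with multiplicity). -/
noncomputable def posRootCount (M : Matrix n n ℂ) : ℕ := M.charpoly.roots.countP fun z => 0 < z.re

/-- Zero-eigenvalue count (multiplicity of the root `0` of the characteristic polynomial). -/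
noncomputable def zeroRootCount (M : Matrix n n ℂ) : ℕ := M.charpoly.roots.countP fun z => z = 0

theorem negRootCount_eq_card {M : Matrix n n ℂ} (hM : M.IsHermitian) :
    negRootCount M = (Finset.univ.filter fun i => hM.eigenvalues i < 0).card := by
  rw [negRootCount, countP_roots_charpoly_eq_card hM]
  simp only [Complex.ofReal_re]

theorem posRootCount_eq_card {M : Matrix n n ℂ} (hM : M.IsHermitian) :
    posRootCount M = (Finset.univ.filter fun i => 0 < hM.eigenvalues i).card := by
  rw [posRootCount, countP_roots_charpoly_eq_card hM]
  simp only [Complex.ofReal_re]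

theorem zeroRootCount_eq_card {M : Matrix n n ℂ} (hM : M.IsHermitian) :
    zeroRootCount M = (Finset.univ.filter fun i => hM.eigenvalues i = 0).card := by
  rw [zeroRootCount, countP_roots_charpoly_eq_card hM]
  simp only [Complex.ofReal_eq_zero]

/-- `neg + pos + zero = card n` for a Hermitian matrix. -/
theorem negRootCount_add_posRootCount_add_zeroRootCount {M : Matrix n n ℂ} (hM : M.IsHermitian) :
    negRootCount M + posRootCount M + zeroRootCount M = Fintype.card n := by
  rw [negRootCount_eq_card hM, posRootCount_eq_card hM, zeroRootCount_eq_card hM,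
    Finset.card_filter, Finset.card_filter, Finset.card_filter, ← Finset.sum_add_distrib,
    ← Finset.sum_add_distrib, ← Finset.card_univ, Finset.card_eq_sum_ones]
  refine Finset.sum_congr rfl fun i _ => ?_
  rcases lt_trichotomy (hM.eigenvalues i) 0 with h | h | h
  · rw [if_pos h, if_neg h.not_gt, if_neg h.ne]
  · rw [if_neg (by rw [h]; exact lt_irrefl 0), if_neg (by rw [h]; exact lt_irrefl 0), if_pos h]
  · rw [if_neg h.not_gt, if_pos h, if_neg h.ne']

/-- `neg + pos ≤ card n` for a Hermitian matrix. -/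
theorem negRootCount_add_posRootCount_le {M : Matrix n n ℂ} (hM : M.IsHermitian) :
    negRootCount M + posRootCount M ≤ Fintype.card n := by
  have := negRootCount_add_posRootCount_add_zeroRootCount hM
  omega

/-- **Local semicontinuity of the inertia along an affine Hermitian pencil.** For Hermitian `A`, `Γ`
with `|Re⟨v, Γ v⟩| ≤ ‖v‖²`, along `H(t) = A + t Γ`: near every `s`, the negative count cannot drop
and can rise by at most the nullity of `H(s)` — `n₋(H s) ≤ n₋(H t) ≤ n₋(H s) + n₀(H s)` for
`|t - s| < r(s)`, `r(s)` the smallest non-zero `|eigenvalue|` of `H(s)` (Sylvester's law of inertia on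
the negative and positive eigenspaces of `H(s)`; no eigenvalue perturbation theory is used). -/
theorem negRootCount_local {A Γ : Matrix n n ℂ} (hA : A.IsHermitian) (hΓ : Γ.IsHermitian)
    (hΓv : ∀ v : n → ℂ, |(star v ⬝ᵥ (Γ *ᵥ v)).re| ≤ ∑ i, ‖v i‖ ^ 2) (s : ℝ) :
    ∃ r : ℝ, 0 < r ∧ ∀ t : ℝ, |t - s| < r →
      negRootCount (A + ((s : ℝ) : ℂ) • Γ) ≤ negRootCount (A + ((t : ℝ) : ℂ) • Γ) ∧
        negRootCount (A + ((t : ℝ) : ℂ) • Γ) ≤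
          negRootCount (A + ((s : ℝ) : ℂ) • Γ) + zeroRootCount (A + ((s : ℝ) : ℂ) • Γ) := by
  set Hs : Matrix n n ℂ := A + ((s : ℝ) : ℂ) • Γ with hHs_def
  have hHs : Hs.IsHermitian := isHermitian_add_real_smul hA hΓ s
  set e : n → ℝ := hHs.eigenvalues with he
  set U : Matrix n n ℂ := (hHs.eigenvectorUnitary : Matrix n n ℂ) with hU
  have hUmem : U ∈ Matrix.unitaryGroup n ℂ := (hHs.eigenvectorUnitary).2
  -- the radius: smallest non-zero |eigenvalue| (or 1 if there is none)
  let S : Finset n := Finset.univ.filter fun i => e i ≠ 0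
  let r : ℝ := if hS : S.Nonempty then S.inf' hS (fun i => |e i|) else 1
  have hr : 0 < r := by
    simp only [r]
    split_ifs with hS
    · rw [Finset.lt_inf'_iff]
      intro i hi
      exact abs_pos.2 (Finset.mem_filter.1 hi).2
    · exact one_pos
  have hre : ∀ i, e i ≠ 0 → r ≤ |e i| := by
    intro i hi
    have hiS : i ∈ S := Finset.mem_filter.2 ⟨Finset.mem_univ _, hi⟩
    have hS : S.Nonempty := ⟨i, hiS⟩
    simp only [r, dif_pos hS]
    exact Finset.inf'_le (fun i => |e i|) hiS
  refine ⟨r, hr, fun t ht => ?_⟩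
  set Ht : Matrix n n ℂ := A + ((t : ℝ) : ℂ) • Γ with hHt_def
  have hHt : Ht.IsHermitian := isHermitian_add_real_smul hA hΓ t
  have hHts : Ht = Hs + (((t - s : ℝ)) : ℂ) • Γ := by
    simp only [hHt_def, hHs_def, Complex.ofReal_sub, sub_smul, add_assoc, add_sub_cancel]
  -- the form of `Ht` on a vector, split
  have hform : ∀ v : n → ℂ, (star v ⬝ᵥ (Ht *ᵥ v)).re =
      (star v ⬝ᵥ (Hs *ᵥ v)).re + (t - s) * (star v ⬝ᵥ (Γ *ᵥ v)).re := by
    intro v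
    rw [hHts, add_mulVec, smul_mulVec, dotProduct_add, dotProduct_smul, Complex.add_re,
      smul_eq_mul, Complex.re_ofReal_mul]
  -- the form of `Hs` on `U (ext c)` in eigen-coordinates
  have hformS : ∀ (p : n → Prop) [DecidablePred p] (c : {i // p i} → ℂ),
      (star (U *ᵥ extendByZero p c) ⬝ᵥ (Hs *ᵥ (U *ᵥ extendByZero p c))).re =
        ∑ i, e i * ‖extendByZero p c i‖ ^ 2 := by
    intro p _ c
    rw [re_form_eq_sum_eigenvalues hHs, ← hU, conjTranspose_mulVec_mulVec_of_mem_unitaryGroup hUmem]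
  -- (i) the negative count cannot drop
  have hneg : negRootCount Hs ≤ negRootCount Ht := by
    rw [negRootCount_eq_card hHs, negRootCount_eq_card hHt, ← Fintype.card_subtype]
    have h := card_le_card_eigenvalues_of_form_pos hHt (-1)
      ((Matrix.mulVecLin U) ∘ₗ extendByZero (fun i => e i < 0)) (fun c hc => ?_)
    · simpa only [neg_mul, one_mul, Left.neg_pos_iff] using h
    · simp only [LinearMap.coe_comp, Function.comp_apply, Matrix.mulVecLin_apply, neg_mul, one_mul,
        Left.neg_pos_iff]
      set v := U *ᵥ extendByZero (fun i => e i < 0) c with hv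
      have hN2 : ∑ i, ‖v i‖ ^ 2 = ∑ i, ‖extendByZero (fun i => e i < 0) c i‖ ^ 2 :=
        sum_norm_sq_mulVec_of_mem_unitaryGroup hUmem _
      have hN2pos : 0 < ∑ i, ‖extendByZero (fun i => e i < 0) c i‖ ^ 2 :=
        sum_norm_sq_pos (extendByZero_ne_zero hc)
      have h1 : (star v ⬝ᵥ (Hs *ᵥ v)).re ≤ -r * ∑ i, ‖extendByZero (fun i => e i < 0) c i‖ ^ 2 := by
        rw [hv, hformS, Finset.mul_sum]
        refine Finset.sum_le_sum fun i _ => ?_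
        by_cases hi : e i < 0
        · have := hre i hi.ne
          rw [abs_of_neg hi] at this
          have h0 : 0 ≤ ‖extendByZero (fun i => e i < 0) c i‖ ^ 2 := by positivity
          nlinarith
        · rw [extendByZero_apply_of_neg c hi, norm_zero]; simp
      have h2 : (t - s) * (star v ⬝ᵥ (Γ *ᵥ v)).re ≤ |t - s| * ∑ i, ‖v i‖ ^ 2 := by
        calc (t - s) * (star v ⬝ᵥ (Γ *ᵥ v)).re ≤ |(t - s) * (star v ⬝ᵥ (Γ *ᵥ v)).re| := le_abs_self _
          _ = |t - s| * |(star v ⬝ᵥ (Γ *ᵥ v)).re| := abs_mul _ _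
          _ ≤ |t - s| * ∑ i, ‖v i‖ ^ 2 := mul_le_mul_of_nonneg_left (hΓv v) (abs_nonneg _)
      rw [hform, hN2] at *
      nlinarith
  -- (ii) the positive count cannot drop
  have hpos : posRootCount Hs ≤ posRootCount Ht := by
    rw [posRootCount_eq_card hHs, posRootCount_eq_card hHt, ← Fintype.card_subtype]
    have h := card_le_card_eigenvalues_of_form_pos hHt 1
      ((Matrix.mulVecLin U) ∘ₗ extendByZero (fun i => 0 < e i)) (fun c hc => ?_)
    · simpa only [one_mul] using h
    · simp only [LinearMap.coe_comp, Function.comp_apply, Matrix.mulVecLin_apply, one_mul]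
      set v := U *ᵥ extendByZero (fun i => 0 < e i) c with hv
      have hN2 : ∑ i, ‖v i‖ ^ 2 = ∑ i, ‖extendByZero (fun i => 0 < e i) c i‖ ^ 2 :=
        sum_norm_sq_mulVec_of_mem_unitaryGroup hUmem _
      have hN2pos : 0 < ∑ i, ‖extendByZero (fun i => 0 < e i) c i‖ ^ 2 :=
        sum_norm_sq_pos (extendByZero_ne_zero hc)
      have h1 : r * ∑ i, ‖extendByZero (fun i => 0 < e i) c i‖ ^ 2 ≤ (star v ⬝ᵥ (Hs *ᵥ v)).re := by
        rw [hv, hformS, Finset.mul_sum]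
        refine Finset.sum_le_sum fun i _ => ?_
        by_cases hi : 0 < e i
        · have := hre i hi.ne'
          rw [abs_of_pos hi] at this
          have h0 : 0 ≤ ‖extendByZero (fun i => 0 < e i) c i‖ ^ 2 := by positivity
          nlinarith
        · rw [extendByZero_apply_of_neg c hi, norm_zero]; simp
      have h2 : -(|t - s| * ∑ i, ‖v i‖ ^ 2) ≤ (t - s) * (star v ⬝ᵥ (Γ *ᵥ v)).re := by
        rw [neg_le]
        calc -((t - s) * (star v ⬝ᵥ (Γ *ᵥ v)).re) ≤ |(t - s) * (star v ⬝ᵥ (Γ *ᵥ v)).re| :=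
            neg_le_abs _
          _ = |t - s| * |(star v ⬝ᵥ (Γ *ᵥ v)).re| := abs_mul _ _
          _ ≤ |t - s| * ∑ i, ‖v i‖ ^ 2 := mul_le_mul_of_nonneg_left (hΓv v) (abs_nonneg _)
      rw [hform, hN2] at *
      nlinarith
  -- (iii) bookkeeping
  have h3 := negRootCount_add_posRootCount_le hHt
  have h4 := negRootCount_add_posRootCount_add_zeroRootCount hHs
  exact ⟨hneg, by omega⟩

/-- **The nullity along the pencil is at most the algebraic multiplicity of the real eigenvalue.**
With `Γ² = 1`, `Γ (A + s Γ) = Γ A + s`, so `n₀(A + sΓ) = dim ker (ΓA + s) ≤ mult_{-s}(charpoly (Γ A))`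
(geometric ≤ algebraic multiplicity, Mathlib `LinearMap.finrank_eigenspace_le`). -/
theorem zeroRootCount_le_count {A Γ : Matrix n n ℂ} (hA : A.IsHermitian) (hΓ : Γ.IsHermitian)
    (hΓ2 : Γ * Γ = 1) (s : ℝ) :
    zeroRootCount (A + ((s : ℝ) : ℂ) • Γ) ≤ (Γ * A).charpoly.roots.count (((-s : ℝ) : ℂ)) := by
  set Hs : Matrix n n ℂ := A + ((s : ℝ) : ℂ) • Γ with hHs_def
  have hHs : Hs.IsHermitian := isHermitian_add_real_smul hA hΓ s
  -- nullity = card n - rank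
  have hz : zeroRootCount Hs + Hs.rank = Fintype.card n := by
    rw [zeroRootCount_eq_card hHs, hHs.rank_eq_card_non_zero_eigs, Fintype.card_subtype]
    exact Finset.card_filter_add_card_filter_not _
  -- rank is invariant under left multiplication by the involution `Γ`
  have hunit : IsUnit Γ.det := by
    have h : Γ.det * Γ.det = 1 := by rw [← det_mul, hΓ2, det_one]
    exact IsUnit.of_mul_eq_one _ h
  have hrank : Hs.rank = (Γ * A + ((s : ℝ) : ℂ) • (1 : Matrix n n ℂ)).rank := by
    rw [← rank_mul_eq_right_of_isUnit_det Γ Hs hunit, hHs_def, mul_add, Matrix.mul_smul, hΓ2]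
  -- rank-nullity for `M = ΓA + s`
  set M : Matrix n n ℂ := Γ * A + ((s : ℝ) : ℂ) • (1 : Matrix n n ℂ) with hM
  have hrn : M.rank + Module.finrank ℂ (LinearMap.ker M.mulVecLin) = Fintype.card n := by
    rw [Matrix.rank, LinearMap.finrank_range_add_finrank_ker, Module.finrank_fintype_fun_eq_card]
  -- the kernel is the eigenspace of `ΓA` at `-s`
  have hker : LinearMap.ker M.mulVecLin =
      Module.End.eigenspace (Matrix.toLin' (Γ * A)) (((-s : ℝ) : ℂ)) := by
    ext v
    rw [LinearMap.mem_ker, Module.End.mem_eigenspace_iff, Matrix.mulVecLin_apply, Matrix.toLin'_apply,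
      hM, add_mulVec, smul_mulVec, one_mulVec, Complex.ofReal_neg, neg_smul, ← eq_neg_iff_add_eq_zero]
  have hle : Module.finrank ℂ (LinearMap.ker M.mulVecLin) ≤
      (Γ * A).charpoly.roots.count (((-s : ℝ) : ℂ)) := by
    rw [hker, Polynomial.count_roots, ← Matrix.charpoly_toLin']
    exact LinearMap.finrank_eigenspace_le _ _
  omega

/-! ### The abstract crossing budget: a step function with controlled local jumps -/

omit [Fintype n] [DecidableEq n] in
/-- Counting with three mutually exclusive sub-predicates of `[a, b]`. -/
theorem count_add_count_add_countP_le (R : Multiset ℝ) {a b : ℝ} (hab : a < b) :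
    R.count a + R.count b + R.countP (fun s => a < s ∧ s < b) ≤
      R.countP (fun s => a ≤ s ∧ s ≤ b) := by
  induction R using Multiset.induction_on with
  | empty => simp
  | cons x R ih =>
    rw [Multiset.count_cons, Multiset.count_cons, Multiset.countP_cons, Multiset.countP_cons]
    have key : (if a = x then 1 else 0) + (if b = x then 1 else 0) +
        (if a < x ∧ x < b then 1 else 0) ≤ (if a ≤ x ∧ x ≤ b then (1 : ℕ) else 0) := by
      by_cases hax : a = x
      · subst hax
        rw [if_pos rfl, if_neg hab.ne', if_neg (fun h => lt_irrefl _ h.1), if_pos ⟨le_rfl, hab.le⟩]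
      · by_cases hbx : b = x
        · subst hbx
          rw [if_neg hax, if_pos rfl, if_neg (fun h => lt_irrefl _ h.2), if_pos ⟨hab.le, le_rfl⟩]
        · rw [if_neg hax, if_neg hbx]
          by_cases hm : a < x ∧ x < b
          · rw [if_pos hm, if_pos ⟨hm.1.le, hm.2.le⟩]
          · rw [if_neg hm]; exact Nat.zero_le _
    omega

omit [Fintype n] [DecidableEq n] in
/-- Monotonicity of `countP` in the predicate. -/
theorem countP_mono_pred (R : Multiset ℝ) {p q : ℝ → Prop} [DecidablePred p] [DecidablePred q]
    (h : ∀ x, p x → q x) : R.countP p ≤ R.countP q := by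
  rw [Multiset.countP_eq_card_filter, Multiset.countP_eq_card_filter]
  exact Multiset.card_le_card (Multiset.monotone_filter_right R h)

omit [Fintype n] [DecidableEq n] in
/-- Splitting a count at a distinguished point. -/
theorem countP_eq_count_add_countP (R : Multiset ℝ) {p q : ℝ → Prop} [DecidablePred p]
    [DecidablePred q] (s₀ : ℝ) (hiff : ∀ x ∈ R, p x ↔ (x = s₀ ∨ q x)) (hdisj : ∀ x, q x → x ≠ s₀) :
    R.countP p = R.count s₀ + R.countP q := by
  classical
  rw [Multiset.countP_eq_card_filter, Multiset.countP_eq_card_filter, Multiset.count_eq_card_filter_eq,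
    ← Multiset.card_add, Multiset.filter_congr hiff, Multiset.filter_add_filter]
  have h0 : Multiset.filter (fun x => s₀ = x ∧ q x) R = 0 :=
    Multiset.filter_eq_nil.2 fun x _ h => hdisj x h.2 h.1.symm
  rw [h0, add_zero]
  congr 1
  exact Multiset.filter_congr fun x _ => by rw [eq_comm]

omit [Fintype n] [DecidableEq n] in
/-- **Abstract crossing budget.** Let `f : ℝ → ℕ` be a function which near every point `s` cannot
drop and can rise by at most `z s` (`f s ≤ f t ≤ f s + z s` for `|t - s| < r(s)`), where the jump
allowance `z` is dominated by the multiplicity function of a finite multiset `R` of reals. Then the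
variation of `f` over `[a, b]` is at most the number of points of `R` in `[a, b]`, with multiplicity:
`|f b - f a| ≤ #(R ∩ [a, b])`. (Topology: `f` is locally constant off `R`, so constant on root-free
intervals by connectedness; the roots are crossed one at a time.) -/
theorem abs_sub_le_countP_of_local_jumps (f z : ℝ → ℕ) (R : Multiset ℝ)
    (hloc : ∀ s : ℝ, ∃ r : ℝ, 0 < r ∧ ∀ t : ℝ, |t - s| < r → f s ≤ f t ∧ f t ≤ f s + z s)
    (hzR : ∀ s, z s ≤ R.count s) {a b : ℝ} (hab : a ≤ b) :
    |(f b : ℤ) - f a| ≤ R.countP (fun s => a ≤ s ∧ s ≤ b) := by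
  classical
  -- (E) constancy on jump-free closed intervals
  have hE : ∀ u v : ℝ, u ≤ v → (∀ s, u ≤ s → s ≤ v → z s = 0) → f u = f v := by
    intro u v huv hz
    have hlc : IsLocallyConstant (fun x : Set.Icc u v => f x.1) := by
      rw [IsLocallyConstant.iff_eventually_eq]
      intro x
      obtain ⟨r, hr, hloc'⟩ := hloc x.1
      have hz0 : z x.1 = 0 := hz x.1 x.2.1 x.2.2
      have hball : ∀ t, |t - x.1| < r → f t = f x.1 := fun t ht => by
        have := hloc' t ht; omega
      have hmem : {y : Set.Icc u v | |(y : ℝ) - x.1| < r} ∈ 𝓝 x := by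
        have hopen : IsOpen {y : Set.Icc u v | |(y : ℝ) - x.1| < r} := by
          have : {y : Set.Icc u v | |(y : ℝ) - x.1| < r} =
              (fun y : Set.Icc u v => (y : ℝ)) ⁻¹' Metric.ball x.1 r := by
            ext y; simp [Metric.mem_ball, Subtype.dist_eq, Real.dist_eq]
          rw [this]
          exact continuous_subtype_val.isOpen_preimage _ Metric.isOpen_ball
        exact hopen.mem_nhds (by simp [hr])
      filter_upwards [hmem] with y hy
      exact hball y hy
    haveI : PreconnectedSpace (Set.Icc u v) := Subtype.preconnectedSpace isPreconnected_Icc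
    exact hlc.apply_eq_of_preconnectedSpace ⟨u, le_rfl, huv⟩ ⟨v, huv, le_rfl⟩
  -- `z` vanishes off `R`
  have hz_off : ∀ s, s ∉ R → z s = 0 := fun s hs => by
    have := hzR s; rw [Multiset.count_eq_zero_of_notMem hs] at this; omega
  -- (STEP) endpoints off `R`: induction on the number of distinct points of `R` strictly inside
  have hstep : ∀ N : ℕ, ∀ a' b' : ℝ, a' ≤ b' → a' ∉ R → b' ∉ R →
      (R.toFinset.filter fun s => a' < s ∧ s < b').card = N →
        |(f b' : ℤ) - f a'| ≤ R.countP (fun s => a' < s ∧ s < b') := by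
    intro N
    induction N with
    | zero =>
      intro a' b' hab' ha' hb' hcard
      have hfree : ∀ s, a' ≤ s → s ≤ b' → z s = 0 := by
        intro s h1 h2
        by_cases hs : s ∈ R
        · exfalso
          have hsa : s ≠ a' := fun h => ha' (h ▸ hs)
          have hsb : s ≠ b' := fun h => hb' (h ▸ hs)
          have hmem : s ∈ R.toFinset.filter fun s => a' < s ∧ s < b' :=
            Finset.mem_filter.2 ⟨Multiset.mem_toFinset.2 hs, lt_of_le_of_ne h1 hsa.symm,
              lt_of_le_of_ne h2 hsb⟩
          rw [Finset.card_eq_zero] at hcard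
          rw [hcard] at hmem
          exact absurd hmem (Finset.notMem_empty _)
        · exact hz_off s hs
      rw [hE a' b' hab' hfree, sub_self, abs_zero]
      positivity
    | succ N ih =>
      intro a' b' hab' ha' hb' hcard
      set S := R.toFinset.filter fun s => a' < s ∧ s < b' with hS_def
      have hSne : S.Nonempty := by rw [← Finset.card_pos, hcard]; exact Nat.succ_pos _
      set s₀ := S.min' hSne with hs₀_def
      have hs₀S : s₀ ∈ S := Finset.min'_mem _ _
      have hs₀R : s₀ ∈ R := Multiset.mem_toFinset.1 (Finset.mem_filter.1 hs₀S).1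
      have hs₀a : a' < s₀ := (Finset.mem_filter.1 hs₀S).2.1
      have hs₀b : s₀ < b' := (Finset.mem_filter.1 hs₀S).2.2
      have hSmin : ∀ x ∈ S, s₀ ≤ x := fun x hx => Finset.min'_le _ _ hx
      obtain ⟨r, hr, hlocr⟩ := hloc s₀
      -- the next point to the right of `s₀` (capped by `b'` and by `s₀ + r`)
      set T := insert b' (R.toFinset.filter fun x => s₀ < x) with hT_def
      have hTne : T.Nonempty := Finset.insert_nonempty _ _
      set c := min (s₀ + r) (T.min' hTne) with hc_def
      have hTgt : ∀ x ∈ T, s₀ < x := by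
        intro x hx
        rcases Finset.mem_insert.1 hx with rfl | hx
        · exact hs₀b
        · exact (Finset.mem_filter.1 hx).2
      have hc₀ : s₀ < c := lt_min (by linarith) ((Finset.lt_min'_iff _ _).2 hTgt)
      have hcb : c ≤ b' := (min_le_right _ _).trans (Finset.min'_le _ _ (Finset.mem_insert_self _ _))
      have hcr : c ≤ s₀ + r := min_le_left _ _
      have hcR : ∀ x ∈ R, s₀ < x → c ≤ x := fun x hx hxs =>
        (min_le_right _ _).trans (Finset.min'_le _ _ (Finset.mem_insert_of_mem
          (Finset.mem_filter.2 ⟨Multiset.mem_toFinset.2 hx, hxs⟩)))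
      set a'' := (s₀ + c) / 2 with ha''_def
      have h1 : s₀ < a'' := by rw [ha''_def]; linarith
      have h2 : a'' < c := by rw [ha''_def]; linarith
      have ha''R : a'' ∉ R := fun h => absurd (hcR _ h h1) (not_le.2 h2)
      have ha''b : a'' ≤ b' := (h2.trans_le hcb).le
      -- the points strictly inside `(a'', b')` are those of `S` other than `s₀`
      have hfilt : (R.toFinset.filter fun s => a'' < s ∧ s < b') = S.erase s₀ := by
        ext x
        simp only [Finset.mem_filter, Finset.mem_erase, hS_def, Multiset.mem_toFinset]
        constructor
        · rintro ⟨hxR, hxa, hxb⟩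
          exact ⟨(h1.trans hxa).ne', hxR, hs₀a.trans (h1.trans hxa), hxb⟩
        · rintro ⟨hxne, hxR, hxa, hxb⟩
          have hxS : x ∈ S := Finset.mem_filter.2 ⟨Multiset.mem_toFinset.2 hxR, hxa, hxb⟩
          have hlt : s₀ < x := lt_of_le_of_ne (hSmin x hxS) (Ne.symm hxne)
          exact ⟨hxR, h2.trans_le (hcR x hxR hlt), hxb⟩
      have hcard' : (R.toFinset.filter fun s => a'' < s ∧ s < b').card = N := by
        rw [hfilt, Finset.card_erase_of_mem hs₀S, hcard]; rfl
      have hIH := ih a'' b' ha''b ha''R hb' hcard'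
      -- the jump across `s₀`
      set t := max a' (s₀ - r / 2) with ht_def
      have hta : a' ≤ t := le_max_left _ _
      have hts : t < s₀ := max_lt hs₀a (by linarith)
      have htr : |t - s₀| < r := by
        rw [abs_sub_lt_iff]; constructor <;> [linarith; linarith [le_max_right a' (s₀ - r / 2)]]
      have ha''r : |a'' - s₀| < r := by
        rw [abs_sub_lt_iff]; constructor <;> linarith
      have hft : f a' = f t := by
        refine hE a' t hta fun s hs1 hs2 => ?_
        by_cases hsR : s ∈ R
        · exfalso
          have hsa : s ≠ a' := fun h => ha' (h ▸ hsR)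
          have hsS : s ∈ S := Finset.mem_filter.2
            ⟨Multiset.mem_toFinset.2 hsR, lt_of_le_of_ne hs1 hsa.symm, (hs2.trans_lt hts).trans hs₀b⟩
          exact absurd (hSmin s hsS) (not_le.2 (hs2.trans_lt hts))
        · exact hz_off s hsR
      have hj1 := hlocr t htr
      have hj2 := hlocr a'' ha''r
      have hzs₀ := hzR s₀
      have hjump : |(f a'' : ℤ) - f a'| ≤ R.count s₀ := by
        rw [hft, abs_le]; constructor <;> omega
      -- count bookkeeping: points of `R` in `(a', b')` are `s₀` or in `(a'', b')`
      have hsplit : R.countP (fun s => a' < s ∧ s < b') =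
          R.count s₀ + R.countP (fun s => a'' < s ∧ s < b') := by
        refine countP_eq_count_add_countP R s₀ (fun x hx => ⟨fun h => ?_, fun h => ?_⟩)
          (fun x hx hxs => absurd hxs (h1.trans hx.1).ne')
        · by_cases hxs : x = s₀
          · exact Or.inl hxs
          · have hxS : x ∈ S := Finset.mem_filter.2 ⟨Multiset.mem_toFinset.2 hx, h⟩
            have hlt : s₀ < x := lt_of_le_of_ne (hSmin x hxS) (Ne.symm hxs)
            exact Or.inr ⟨h2.trans_le (hcR x hx hlt), h.2⟩
        · rcases h with rfl | h
          · exact ⟨hs₀a, hs₀b⟩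
          · exact ⟨hs₀a.trans (h1.trans h.1), h.2⟩
      calc |(f b' : ℤ) - f a'| = |((f b' : ℤ) - f a'') + ((f a'' : ℤ) - f a')| := by ring_nf
        _ ≤ |(f b' : ℤ) - f a''| + |(f a'' : ℤ) - f a'| := abs_add_le _ _
        _ ≤ R.countP (fun s => a'' < s ∧ s < b') + R.count s₀ := add_le_add hIH hjump
        _ = R.countP (fun s => a' < s ∧ s < b') := by rw [hsplit]; push_cast; ring
  -- (FINAL) general endpoints: shrink into `(a, b)` off `R`, pay the endpoint jumps once
  rcases hab.eq_or_lt with rfl | hab'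
  · rw [sub_self, abs_zero]; positivity
  obtain ⟨ra, hra, hloca⟩ := hloc a
  obtain ⟨rb, hrb, hlocb⟩ := hloc b
  -- `a'`
  set Ta := insert b (R.toFinset.filter fun x => a < x) with hTa_def
  have hTane : Ta.Nonempty := Finset.insert_nonempty _ _
  set ca := min (a + ra) (Ta.min' hTane) with hca_def
  have hTagt : ∀ x ∈ Ta, a < x := by
    intro x hx
    rcases Finset.mem_insert.1 hx with rfl | hx
    · exact hab'
    · exact (Finset.mem_filter.1 hx).2
  have hca₀ : a < ca := lt_min (by linarith) ((Finset.lt_min'_iff _ _).2 hTagt)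
  have hcab : ca ≤ b := (min_le_right _ _).trans (Finset.min'_le _ _ (Finset.mem_insert_self _ _))
  have hcar : ca ≤ a + ra := min_le_left _ _
  have hcaR : ∀ x ∈ R, a < x → ca ≤ x := fun x hx hxs =>
    (min_le_right _ _).trans (Finset.min'_le _ _ (Finset.mem_insert_of_mem
      (Finset.mem_filter.2 ⟨Multiset.mem_toFinset.2 hx, hxs⟩)))
  set a' := (a + ca) / 2 with ha'_def
  have ha1 : a < a' := by rw [ha'_def]; linarith
  have ha2 : a' < ca := by rw [ha'_def]; linarith
  have ha'R : a' ∉ R := fun h => absurd (hcaR _ h ha1) (not_le.2 ha2)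
  have ha'b : a' < b := ha2.trans_le hcab
  -- `b'`
  set Tb := insert a' (R.toFinset.filter fun x => x < b) with hTb_def
  have hTbne : Tb.Nonempty := Finset.insert_nonempty _ _
  set cb := max (b - rb) (Tb.max' hTbne) with hcb_def
  have hTblt : ∀ x ∈ Tb, x < b := by
    intro x hx
    rcases Finset.mem_insert.1 hx with rfl | hx
    · exact ha'b
    · exact (Finset.mem_filter.1 hx).2
  have hcb₀ : cb < b := max_lt (by linarith) ((Finset.max'_lt_iff _ _).2 hTblt)
  have hcba : a' ≤ cb := (Finset.le_max' _ _ (Finset.mem_insert_self _ _)).trans (le_max_right _ _)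
  have hcbr : b - rb ≤ cb := le_max_left _ _
  have hcbR : ∀ x ∈ R, x < b → x ≤ cb := fun x hx hxs =>
    (Finset.le_max' _ _ (Finset.mem_insert_of_mem
      (Finset.mem_filter.2 ⟨Multiset.mem_toFinset.2 hx, hxs⟩))).trans (le_max_right _ _)
  set b' := (cb + b) / 2 with hb'_def
  have hb1 : cb < b' := by rw [hb'_def]; linarith
  have hb2 : b' < b := by rw [hb'_def]; linarith
  have hb'R : b' ∉ R := fun h => absurd (hcbR _ h hb2) (not_le.2 hb1)
  have ha'b' : a' ≤ b' := (hcba.trans_lt hb1).le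
  -- the interior estimate
  have hint := hstep _ a' b' ha'b' ha'R hb'R rfl
  have hint' : |(f b' : ℤ) - f a'| ≤ R.countP (fun s => a < s ∧ s < b) :=
    hint.trans (by
      exact_mod_cast countP_mono_pred R (p := fun s => a' < s ∧ s < b') (q := fun s => a < s ∧ s < b)
        fun x hx => ⟨ha1.trans hx.1, hx.2.trans hb2⟩)
  -- the endpoint jumps
  have hja := hloca a' (by rw [abs_sub_lt_iff]; constructor <;> linarith)
  have hjb := hlocb b' (by rw [abs_sub_lt_iff]; constructor <;> linarith)
  have hza := hzR a
  have hzb := hzR b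
  have hfin := count_add_count_add_countP_le R hab'
  rw [abs_le] at hint' ⊢
  constructor <;> omega

/-- **Crossing budget for a Hermitian pencil `A + tΓ` with `Γ² = 1`.** The negative counts at two
parameters `a ≤ b` differ by at most the number of REAL eigenvalues (with algebraic multiplicity) of
`Γ A` in `[-b, -a]`: every change of `n₋(A + tΓ)` happens at a `t` with `ΓA + t` singular and is at
most the nullity there. -/
theorem abs_negRootCount_sub_le_countP_real {A Γ : Matrix n n ℂ} (hA : A.IsHermitian)
    (hΓ : Γ.IsHermitian) (hΓ2 : Γ * Γ = 1)
    (hΓv : ∀ v : n → ℂ, |(star v ⬝ᵥ (Γ *ᵥ v)).re| ≤ ∑ i, ‖v i‖ ^ 2) {a b : ℝ} (hab : a ≤ b) :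
    |(negRootCount (A + ((b : ℝ) : ℂ) • Γ) : ℤ) - negRootCount (A + ((a : ℝ) : ℂ) • Γ)| ≤
      (Γ * A).charpoly.roots.countP (fun z => z.im = 0 ∧ -b ≤ z.re ∧ z.re ≤ -a) := by
  classical
  set R : Multiset ℝ := (((Γ * A).charpoly.roots.filter fun z : ℂ => z.im = 0).map fun z : ℂ => -z.re)
    with hR
  have h := abs_sub_le_countP_of_local_jumps (fun t => negRootCount (A + ((t : ℝ) : ℂ) • Γ))
    (fun t => zeroRootCount (A + ((t : ℝ) : ℂ) • Γ)) R (negRootCount_local hA hΓ hΓv) (fun s => ?_) hab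
  · refine h.trans (le_of_eq ?_)
    congr 1
    rw [hR, Multiset.countP_map, Multiset.filter_filter, ← Multiset.countP_eq_card_filter]
    exact Multiset.countP_congr rfl fun z _ => propext
      ⟨fun h => ⟨h.2, by linarith [h.1.2], by linarith [h.1.1]⟩,
        fun h => ⟨⟨by linarith [h.2.2], by linarith [h.2.1]⟩, h.1⟩⟩
  · -- `n₀(A + sΓ) ≤ mult_{-s} ≤ #(R ∋ s)`
    refine (zeroRootCount_le_count hA hΓ hΓ2 s).trans ?_
    rw [hR, Multiset.count_map, Multiset.filter_filter, Multiset.count_eq_card_filter_eq]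
    refine Multiset.card_le_card (Multiset.monotone_filter_right _ fun z hz => ?_)
    subst hz
    exact ⟨by simp, by simp⟩

end IndexBudgetMatrix

/-! ### The Wilson instance: index jumps of `Γ₅ D_W(U, μ, 1)` are real modes of `D_W(U, 0, 1)` -/

section IndexBudgetWilson

variable {L : ℕ} [NeZero L]

/-- The chirality form is bounded by the norm: `|Re⟨v, Γ₅ v⟩| ≤ Σ‖v‖²` (`Γ₅ = diag(±1)`). -/
theorem abs_re_form_gammaFive_le (v : QuarkIdx L → ℂ) :
    |(star v ⬝ᵥ (spinorLift (L := L) (N := 3) gammaFive *ᵥ v)).re| ≤ ∑ i, ‖v i‖ ^ 2 := by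
  refine (Complex.abs_re_le_norm _).trans ?_
  rw [dotProduct]
  refine (norm_sum_le _ _).trans (le_of_eq ?_)
  refine Finset.sum_congr rfl fun p _ => ?_
  rw [spinorLift_gammaFive_eq_diagonal, mulVec_diagonal, Pi.star_apply, norm_mul, norm_mul,
    Complex.star_def, Complex.norm_conj]
  have h1 : ‖(![1, 1, -1, -1] : Fin 4 → ℂ) p.2.2‖ = 1 := by
    rcases p with ⟨x, a, α⟩
    fin_cases α <;> simp
  rw [h1, one_mul, sq]

/-- `Γ₅ D_W(U, μ, 1) = Γ₅ D_W(U, 0, 1) + μ Γ₅`: the Hermitian Wilson operators form an affine pencil in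
the bare mass. -/
theorem gammaFive_mul_wilsonDirac_eq_add_smul (U : GaugeConfig 4 L SU3) (μ : ℝ) :
    spinorLift gammaFive * wilsonDirac (fundamentalRep (Fin 3)) U μ 1 =
      spinorLift gammaFive * wilsonDirac (fundamentalRep (Fin 3)) U 0 1 +
        ((μ : ℝ) : ℂ) • spinorLift (L := L) (N := 3) gammaFive := by
  rw [wilsonDirac_mass_eq_add_scalar (fundamentalRep (Fin 3)) U μ 1, mul_add, scalar_apply,
    ← smul_one_eq_diagonal, Matrix.mul_smul, mul_one]

/-- **Index jumps are real modes (crossing budget for the Hermitian Wilson family).** For every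
`SU(3)` gauge field and bare masses `a ≤ b`, the negative-eigenvalue counts of `Γ₅ D_W(U, b, 1)` and
`Γ₅ D_W(U, a, 1)` (roots of the characteristic polynomial with negative real part, with multiplicity —
the count inside TIGHT) differ by at most the number of REAL eigenvalues `λ` of the massless operator
`D_W(U, 0, 1)` with `-b ≤ λ ≤ -a`, counted with algebraic multiplicity: a level of the Hermitian family
crosses zero only where `D_W(U,0,1) + μ` is singular, and by at most its nullity (Sylvester on both
sides of the crossing; geometric ≤ algebraic multiplicity). This is the lemma typed as a stub
(`negCount_sub_le_realBandCount`) in `Cruxes/ExtinctionBuildsQCD/Sketch-ideator3.lean`. -/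
theorem abs_negCount_hermitianWilson_sub_le (U : GaugeConfig 4 L SU3) {a b : ℝ} (hab : a ≤ b) :
    |(Multiset.countP (fun z : ℂ => z.re < 0)
        (spinorLift gammaFive * wilsonDirac (fundamentalRep (Fin 3)) U b 1).charpoly.roots : ℤ) -
      Multiset.countP (fun z : ℂ => z.re < 0)
        (spinorLift gammaFive * wilsonDirac (fundamentalRep (Fin 3)) U a 1).charpoly.roots| ≤
      Multiset.countP (fun z : ℂ => z.im = 0 ∧ -b ≤ z.re ∧ z.re ≤ -a)
        (wilsonDirac (fundamentalRep (Fin 3)) U 0 1).charpoly.roots := by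
  set Γ : Matrix (QuarkIdx L) (QuarkIdx L) ℂ := spinorLift gammaFive with hΓ_def
  set D := wilsonDirac (fundamentalRep (Fin 3)) U 0 1 with hD
  have hA : (Γ * D).IsHermitian :=
    Literature.Barriers.QuantumFields.isHermitian_gammaFive_mul_wilsonDirac (fundamentalRep (Fin 3))
      fundamentalRep_mem_unitaryGroup U 0 1
  have hΓ : Γ.IsHermitian := conjTranspose_spinorLift_gammaFive'
  have hΓ2 : Γ * Γ = 1 := spinorLift_gammaFive_mul_self
  have hD' : Γ * (Γ * D) = D := by rw [← Matrix.mul_assoc, hΓ2, Matrix.one_mul]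
  have h := abs_negRootCount_sub_le_countP_real hA hΓ hΓ2 abs_re_form_gammaFive_le hab
  rw [hD'] at h
  simpa only [negRootCount, hΓ_def, hD, ← gammaFive_mul_wilsonDirac_eq_add_smul] using h

/-- **The TIGHT integrand is a count of real modes below the probe.** For every gauge field and
every probe mass `p`, `|n₋(Γ₅ D_W(U, p, 1)) - 6L⁴| ≤ #{real eigenvalues λ of D_W(U,0,1) with λ ≤ -p}`
(with multiplicity; all real eigenvalues are `≥ 0`, so this is the count in `[0, -p]`, empty for
`p > 0`). Chiral inertia at `b = 1` (`negCount_hermitianWilson_eq`) plus the crossing budget. In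
particular the spectral index at probe `p` vanishes unless the massless Wilson operator has a real
mode in `[0, -p]`: for a TIP witness (`m_crit(k) ≥ 0`, probe `-a_k M/Z_k + m_crit(k)`) TIGHT asks for
real modes within `a_k M/Z_k` of the tip of the Wilson hole, on average at least one per scheme torus;
for an honest witness (`m_crit(k) < 0`) see `tight_integrand_le_signDefects_add_band`. -/
theorem abs_index_le_realModeCount (U : GaugeConfig 4 L SU3) (p : ℝ) :
    |(Multiset.countP (fun z : ℂ => z.re < 0)
        (spinorLift gammaFive * wilsonDirac (fundamentalRep (Fin 3)) U p 1).charpoly.roots : ℤ) -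
      6 * (L : ℤ) ^ 4| ≤
      (Multiset.countP (fun z : ℂ => z.im = 0 ∧ z.re ≤ -p)
        (wilsonDirac (fundamentalRep (Fin 3)) U 0 1).charpoly.roots : ℤ) := by
  rcases le_or_gt p 0 with hp | hp
  · have h := abs_negCount_hermitianWilson_sub_le U (show p ≤ 1 by linarith)
    rw [negCount_hermitianWilson_eq (Or.inl one_pos) U] at h
    push_cast at h
    rw [abs_sub_comm] at h
    refine h.trans (le_of_eq ?_)
    congr 1
    refine Multiset.countP_congr rfl fun z hz => propext ⟨fun h => ⟨h.1, h.2.2⟩, fun h => ⟨h.1, ?_, h.2⟩⟩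
    have := (re_mem_Icc_of_real_root U hz h.1).1
    linarith
  · rw [negCount_hermitianWilson_eq (Or.inl hp) U]
    simp

/-- **TIGHT integrand ≤ sign defects + band modes (honest line).** For a line at `m_crit`, a flavour
window `w_f ≥ 0` (bare mass `m_crit + w_f`, `w_f = a_k m_f/Z_k`) and a probe `m_crit - w_M`, `w_M ≥ 0`:
`|n₋(Γ₅ D_W(U, m_crit - w_M, 1)) - 6L⁴| ≤ #{real λ < -(m_crit + w_f)} + #{real λ ∈ [-(m_crit + w_f), -(m_crit - w_M)]}`
— the EXTINCT sign-defect count of that flavour (verbatim the route's `countP`) plus the number of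
real modes of `D_W(U,0,1)` in the band of bare width `w_f + w_M` at the line. Integrated against the
phase-quenched weight this is the content of TIGHT ∧ EXTINCT(a): `E₊[band modes] ≥ 1 - E₊[sign defects]`
(cf. idea card `tight-two-sided-pin`; the integration needs measurability of the counts in `U`, not
done here). -/
theorem tight_integrand_le_signDefects_add_band (U : GaugeConfig 4 L SU3) (mcrit wf wM : ℝ)
    (hwf : 0 ≤ wf) (hwM : 0 ≤ wM) :
    |(Multiset.countP (fun z : ℂ => z.re < 0)
        (spinorLift gammaFive * wilsonDirac (fundamentalRep (Fin 3)) U (mcrit - wM) 1).charpoly.roots : ℤ) -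
      6 * (L : ℤ) ^ 4| ≤
      (Multiset.countP (fun z : ℂ => z.im = 0 ∧ z.re < -(mcrit + wf))
          (wilsonDirac (fundamentalRep (Fin 3)) U 0 1).charpoly.roots : ℤ) +
        (Multiset.countP (fun z : ℂ => z.im = 0 ∧ -(mcrit + wf) ≤ z.re ∧ z.re ≤ -(mcrit - wM))
          (wilsonDirac (fundamentalRep (Fin 3)) U 0 1).charpoly.roots : ℤ) := by
  refine (abs_index_le_realModeCount U (mcrit - wM)).trans (le_of_eq ?_)
  set R := (wilsonDirac (fundamentalRep (Fin 3)) U 0 1).charpoly.roots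
  rw [Multiset.countP_eq_countP_filter_add R (fun z : ℂ => z.im = 0 ∧ z.re ≤ -(mcrit - wM))
    (fun z : ℂ => z.re < -(mcrit + wf)), Multiset.countP_filter, Multiset.countP_filter]
  have e1 : Multiset.countP (fun z : ℂ => (z.im = 0 ∧ z.re ≤ -(mcrit - wM)) ∧ z.re < -(mcrit + wf)) R =
      Multiset.countP (fun z : ℂ => z.im = 0 ∧ z.re < -(mcrit + wf)) R := by
    refine Multiset.countP_congr rfl fun z _ => propext ⟨fun h => ⟨h.1.1, h.2⟩, fun h => ⟨⟨h.1, ?_⟩, h.2⟩⟩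
    linarith [h.2]
  have e2 : Multiset.countP (fun z : ℂ => (z.im = 0 ∧ z.re ≤ -(mcrit - wM)) ∧ ¬ z.re < -(mcrit + wf)) R =
      Multiset.countP (fun z : ℂ => z.im = 0 ∧ -(mcrit + wf) ≤ z.re ∧ z.re ≤ -(mcrit - wM)) R :=
    Multiset.countP_congr rfl fun z _ => propext
      ⟨fun h => ⟨h.1.1, not_lt.1 h.2, h.1.2⟩, fun h => ⟨⟨h.1, h.2.2⟩, not_lt.2 h.2.1⟩⟩
  rw [e1, e2]
  push_cast
  rfl

/-- **No real mode in `[0, -p]` ⇒ zero index at probe `p`** (configuration-wise). The spectral index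
that TIGHT integrates vanishes on every gauge field whose massless Wilson operator has no real
eigenvalue `≤ -p`; TIGHT therefore forces, eventually in `k` and for every `M > M₀`, a phase-quenched
probability `≥ (6(2L_k+1)⁴)⁻¹`-positive — indeed an expected count `≥ 1` — of real modes of
`D_W(U,0,1)` in `[0, a_k M/Z_k - m_crit(k)]` on the scheme torus (the tip when `m_crit ≥ 0`, the band at
the line when `m_crit < 0`). -/
theorem index_eq_zero_of_no_realMode (U : GaugeConfig 4 L SU3) {p : ℝ}
    (h0 : Multiset.countP (fun z : ℂ => z.im = 0 ∧ z.re ≤ -p)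
      (wilsonDirac (fundamentalRep (Fin 3)) U 0 1).charpoly.roots = 0) :
    Multiset.countP (fun z : ℂ => z.re < 0)
        (spinorLift gammaFive * wilsonDirac (fundamentalRep (Fin 3)) U p 1).charpoly.roots =
      6 * L ^ 4 := by
  have h := abs_index_le_realModeCount U p
  rw [h0, Nat.cast_zero] at h
  have h' := sub_eq_zero.1 (abs_nonpos_iff.1 h)
  exact_mod_cast h'

/-- **Reading for the tip family (§4).** At step `k` of `tipReg L'` (line at bare mass `0`) the TIGHT
integrand on ANY torus and ANY gauge field is at most the number of real modes of the massless Wilson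
operator within `a_k M/Z_k` of the tip of the hole: `IndexSpreadBox` is precisely a statement about
ultra-deep real modes (and their net chirality). -/
theorem tipReg_tight_integrand_le_tipModes {Nf S : ℕ} [NeZero S] (U : GaugeConfig 4 S SU3)
    (L' : ℕ → ℕ) (hL' : Tendsto (fun k => (QCDRegularisation.canonicalAF Nf).a k * L' k) atTop atTop)
    (k : ℕ) (M : ℝ) :
    |(Multiset.countP (fun z : ℂ => z.re < 0)
        (spinorLift gammaFive * wilsonDirac (fundamentalRep (Fin 3)) U
          ((tipReg Nf L' hL').mcrit k - (tipReg Nf L' hL').a k * M / (tipReg Nf L' hL').Zm k) 1).charpoly.roots : ℤ) -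
      6 * (S : ℤ) ^ 4| ≤
      (Multiset.countP (fun z : ℂ => z.im = 0 ∧ z.re ≤ (tipReg Nf L' hL').a k * M / (tipReg Nf L' hL').Zm k)
        (wilsonDirac (fundamentalRep (Fin 3)) U 0 1).charpoly.roots : ℤ) := by
  have h := abs_index_le_realModeCount U
    ((tipReg Nf L' hL').mcrit k - (tipReg Nf L' hL').a k * M / (tipReg Nf L' hL').Zm k)
  have hcrit : (tipReg Nf L' hL').mcrit k = 0 := rfl
  simpa only [hcrit, zero_sub, neg_neg] using h

/-- **Reading for an honest line.** For any witness data `reg`, step `k`, flavour `f`, masses `m_f ≥ 0`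
and probe parameter `M ≥ 0`, on ANY gauge field: the TIGHT integrand is at most the EXTINCT sign-defect
count of flavour `f` (verbatim the route's `countP`) plus the number of real modes of `D_W(U,0,1)` in
the band `[-m_crit(k) - a_k m_f/Z_k, -m_crit(k) + a_k M/Z_k]` at the line. -/
theorem tight_integrand_le_extinctSignDefects_add_band {Nf S : ℕ} [NeZero S] (U : GaugeConfig 4 S SU3)
    (reg : QCDRegularisation Nf) (k : ℕ) {mf M : ℝ} (hmf : 0 ≤ mf) (hM : 0 ≤ M) :
    |(Multiset.countP (fun z : ℂ => z.re < 0)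
        (spinorLift gammaFive * wilsonDirac (fundamentalRep (Fin 3)) U
          (reg.mcrit k - reg.a k * M / reg.Zm k) 1).charpoly.roots : ℤ) - 6 * (S : ℤ) ^ 4| ≤
      (Multiset.countP (fun z : ℂ => z.im = 0 ∧ z.re < -(reg.mcrit k + reg.a k * mf / reg.Zm k))
          (wilsonDirac (fundamentalRep (Fin 3)) U 0 1).charpoly.roots : ℤ) +
        (Multiset.countP (fun z : ℂ => z.im = 0 ∧ -(reg.mcrit k + reg.a k * mf / reg.Zm k) ≤ z.re ∧
            z.re ≤ -(reg.mcrit k - reg.a k * M / reg.Zm k))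
          (wilsonDirac (fundamentalRep (Fin 3)) U 0 1).charpoly.roots : ℤ) :=
  tight_integrand_le_signDefects_add_band U (reg.mcrit k) (reg.a k * mf / reg.Zm k)
    (reg.a k * M / reg.Zm k) (div_nonneg (mul_nonneg (reg.a_pos k).le hmf) (reg.Zm_pos k).le)
    (div_nonneg (mul_nonneg (reg.a_pos k).le hM) (reg.Zm_pos k).le)

end IndexBudgetWilson


/-! ## §6 (cycle 3) The Weyl window budget, measurability of the EXTINCT integrand, the COERCIVITY
CEILING `c ≤ 1`, and the two-sided pin in three currencies (window / band / unitary shell)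

LANDING (proposed cycle 3, four files ≤ 400 lines, namespace `…Theorems.ExtinctionBuildsQCD.Negative`):
`Negative/WeylWindow.lean` (§6a–b), `Negative/ExtinctIntegrable.lean` (§6c), `Negative/CoercivityCeiling.lean` (§6d),
`Negative/TwoSidedPin.lean` (§6e). Inputs from sibling seats: Weyl counting stability `card_filter_lt_neg_le`
(`WindowExtinction/Negative/SpectralFlowLocal.lean`) and root-count measurability `countMeas_measurable_countP`
(`Theorems/SpectralDefectExtinctionTipPricingStubCountMeasurable.lean`).

FINDINGS. (i) `tight_integrand_le_window_add_realModes`: TIGHT's integrand is bounded by a WINDOW count of the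
Hermitian operator at the flavour mass plus the real modes at/below the flavour threshold — pointwise, every `U`
(= card `weyl-transport-unitary-pin`'s stub `index_le_unitaryModCount_add_realBand`, its sign hypotheses dropped;
`abs_negCount_sub_le_windowCount` = its stub `negCount_hW_sub_le_modCount`).
(ii) `integrable_extinctIntegrand`: EXTINCT is contentful (its integrand is integrable), and so are TIGHT's and all
window/band/shell functionals (`integrable_natCount_mul_weight`).
(iii) `c_le_one_of_extinct_tight` / `SDHyp.c_le_one` / `not_sdHyp_with_one_lt`: every `SD` witness has `c ≤ 1` — the
statistical coercivity `‖(D_W+m_f(k))⁻¹‖ ≤ Z_k/(c a_k m_f)` the bridge inherits can never have `c > 1`, because TIGHT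
makes the line critical; the strengthening "`SD` with `c > 1`" is UNSATISFIABLE (so the bridge with that hypothesis is
vacuously true, and `WindowExtinction` with `1 < c` is false).
(iv) `eventually_windowRatio_ge`, `eventually_bandRatio_ge`, `eventually_shellRatio_ge`, `seaShellPin`,
`SDHyp.two_sided_pin`: what TIGHT ∧ EXTINCT actually hand to a prover — per flavour, per `M > M₀`, per `ε`, eventually:
`E₊ #{|λ(Γ₅D_W(U,m_f(k),1))| ≤ a_k(m_f+M)/Z_k} ≥ 1 − ε`, `E₊ #{real λ(D_W(U,0,1)) ∈ [−m_f(k), −m_crit(k)+a_kM/Z_k]} ≥ 1 − ε`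
and `E₊ #{c·a_k m_f/Z_k ≤ |λ(Γ₅D_W(U,m_f(k),1))| ≤ a_k(m_f+M)/Z_k} ≥ 1 − ε` on the scheme torus (the last is card
`weyl-transport-unitary-pin`'s measure-level stub `seaShellPin`, PROVED with the better constant `1 − ε` and without its
`0 < c` / negative-line hypotheses). WHY NO KILL FROM HERE: the window forced by TIGHT has width `a_k(m_f+M)/Z_k`,
EXTINCT(b) clears `c·a_k m_f/Z_k`, ratio `(m_f+M)/m_f > 1 ≥ c` for every admissible `M, m_f` — consistent for every
`c ≤ 1`; different tuples carry different weights (unbounded reweighting), different flavours give the same ratio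
obstruction; TIGHT is an `L¹` statement (`E|index| ≥ 1`), compatible with a Poisson-thin index, so no w.h.p. upgrade. -/

section CycleThree

open Summit.QuantumFields.QCD.Theorems.WindowExtinction.Negative
  (card_filter_lt_neg_le pencil_diff_bound pencil_isHermitian countP_neg_add_pos_add_zero
    countP_roots_eq_card_filter hermitianWilsonDirac_eq_pencil)
open Summit.QuantumFields.QCD.Cruxes.TipPricing.HermitianFlowCoarea (countMeas_measurable_countP)

/-! ## §6a Weyl window budget for a Hermitian pencil -/

section Pencil

variable {n : Type*} [Fintype n] [DecidableEq n]

omit [DecidableEq n] in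
/-- A filter contained in the union of two filters has at most the sum of their cardinalities. -/
theorem card_filter_le_add {p q r : n → Prop} [DecidablePred p] [DecidablePred q] [DecidablePred r]
    (h : ∀ i, p i → q i ∨ r i) :
    (Finset.univ.filter p).card ≤ (Finset.univ.filter q).card + (Finset.univ.filter r).card := by
  calc (Finset.univ.filter p).card ≤ (Finset.univ.filter q ∪ Finset.univ.filter r).card :=
        Finset.card_le_card fun i hi => by
          rw [Finset.mem_union, Finset.mem_filter, Finset.mem_filter]
          rcases h i (Finset.mem_filter.1 hi).2 with h | h
          · exact Or.inl ⟨Finset.mem_univ _, h⟩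
          · exact Or.inr ⟨Finset.mem_univ _, h⟩
    _ ≤ _ := Finset.card_union_le _ _

omit [Fintype n] [DecidableEq n] in
/-- Monotonicity of `Multiset.countP` in the predicate (any type). -/
theorem countP_le_countP_of_imp {α : Type*} (s : Multiset α) {p q : α → Prop} [DecidablePred p]
    [DecidablePred q] (h : ∀ x, p x → q x) : s.countP p ≤ s.countP q := by
  rw [Multiset.countP_eq_card_filter, Multiset.countP_eq_card_filter]
  exact Multiset.card_le_card (Multiset.monotone_filter_right s h)

variable {Γ D : Matrix n n ℂ}

/-- **Weyl window budget for the pencil `H(m) = ΓD + mΓ`** (`Γ` a Hermitian unitary, `ΓD` Hermitian):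
the negative-eigenvalue counts at two parameters differ by at most the number of eigenvalues of `H(s)`
in the closed window `[−|t − s|, |t − s|]`. Proof: `‖H(t) − H(s)‖ ≤ |t − s|`, so by counting stability
(`card_filter_lt_neg_le`, Weyl) `#{λ(H s) < −w} ≤ ν(t)` and `#{λ(H s) > w} ≤ π(t) ≤ N − ν(t)`. -/
theorem pencil_negCount_sub_le_window (hΓ : Γᴴ = Γ) (hΓ2 : Γ * Γ = 1) (hD : (Γ * D)ᴴ = Γ * D)
    (s t : ℝ) :
    |((Γ * D + (s : ℂ) • Γ).charpoly.roots.countP (fun z => z.re < 0) : ℤ) -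
        ((Γ * D + (t : ℂ) • Γ).charpoly.roots.countP (fun z => z.re < 0) : ℤ)| ≤
      ((Γ * D + (s : ℂ) • Γ).charpoly.roots.countP (fun z => |z.re| ≤ |t - s|) : ℤ) := by
  set w : ℝ := |t - s| with hw
  have hw0 : 0 ≤ w := abs_nonneg _
  have hA := pencil_isHermitian (D := D) hΓ hD s
  have hB := pencil_isHermitian (D := D) hΓ hD t
  have hE : ∀ v : n → ℂ,
      |(star v ⬝ᵥ ((Γ * D + (t : ℂ) • Γ) - (Γ * D + (s : ℂ) • Γ)) *ᵥ v).re| ≤ w * ∑ i, ‖v i‖ ^ 2 :=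
    pencil_diff_bound hΓ hΓ2 s t
  have h1 : (Finset.univ.filter fun i => hA.eigenvalues i < -w).card ≤
      (Finset.univ.filter fun i => hB.eigenvalues i < 0).card := by
    convert card_filter_lt_neg_le hA hB (σ := 1) (δ := w) (Or.inl rfl) hE using 3 <;> simp
  have h2 : (Finset.univ.filter fun i => w < hA.eigenvalues i).card ≤
      (Finset.univ.filter fun i => 0 < hB.eigenvalues i).card := by
    convert card_filter_lt_neg_le hA hB (σ := -1) (δ := w) (Or.inr rfl) hE using 3 <;> simp
  have htri := countP_neg_add_pos_add_zero hB
  rw [countP_roots_eq_card_filter hB (· < 0), countP_roots_eq_card_filter hB (0 < ·),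
    countP_roots_eq_card_filter hB (· = 0)] at htri
  rw [countP_roots_eq_card_filter hA (· < 0), countP_roots_eq_card_filter hB (· < 0),
    countP_roots_eq_card_filter hA (fun x => |x| ≤ w)]
  -- (a) `ν(s) ≤ #{λ(H s) < -w} + window`
  have ha : (Finset.univ.filter fun i => hA.eigenvalues i < 0).card ≤
      (Finset.univ.filter fun i => hA.eigenvalues i < -w).card +
        (Finset.univ.filter fun i => |hA.eigenvalues i| ≤ w).card :=
    card_filter_le_add fun i hi => by
      by_cases h : hA.eigenvalues i < -w
      · exact Or.inl h
      · exact Or.inr (abs_le.2 ⟨not_lt.1 h, by linarith⟩)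
  -- (b) `#{λ(H s) ≤ w} ≤ ν(s) + window`
  have hb : (Finset.univ.filter fun i => ¬ w < hA.eigenvalues i).card ≤
      (Finset.univ.filter fun i => hA.eigenvalues i < 0).card +
        (Finset.univ.filter fun i => |hA.eigenvalues i| ≤ w).card :=
    card_filter_le_add fun i hi => by
      by_cases h : hA.eigenvalues i < 0
      · exact Or.inl h
      · exact Or.inr (abs_le.2 ⟨by linarith [not_lt.1 h], not_lt.1 hi⟩)
  have hN := Finset.card_filter_add_card_filter_not (s := (Finset.univ : Finset n))
    (fun i => w < hA.eigenvalues i)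
  have hNB := Finset.card_filter_add_card_filter_not (s := (Finset.univ : Finset n))
    (fun i => hB.eigenvalues i < 0)
  have hsub : (Finset.univ.filter fun i => 0 < hB.eigenvalues i).card ≤
      (Finset.univ.filter fun i => ¬ hB.eigenvalues i < 0).card :=
    Finset.card_le_card fun i hi => by
      rw [Finset.mem_filter] at hi ⊢
      exact ⟨hi.1, fun h => lt_asymm h hi.2⟩
  rw [abs_le]
  constructor <;> omega

end Pencil

/-! ## §6b The Wilson instance and TIGHT's integrand in Hermitian currency -/

section Wilson

variable {L : ℕ} [NeZero L]

/-- **Weyl window budget for the Hermitian Wilson–Dirac operator.** For every `SU(3)` gauge field and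
bare masses `a`, `b`: `|n₋(Γ₅D_W(U,a,1)) − n₋(Γ₅D_W(U,b,1))| ≤ #{eigenvalues λ of Γ₅D_W(U,a,1) with |λ| ≤ |b − a|}`
(`Γ₅D_W(U,b,1) = Γ₅D_W(U,a,1) + (b−a)Γ₅`, `‖Γ₅‖ = 1`, Weyl). -/
theorem abs_negCount_sub_le_windowCount (U : GaugeConfig 4 L SU3) (a b : ℝ) :
    |(Multiset.countP (fun z : ℂ => z.re < 0)
        (spinorLift gammaFive * wilsonDirac (fundamentalRep (Fin 3)) U a 1).charpoly.roots : ℤ) -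
      Multiset.countP (fun z : ℂ => z.re < 0)
        (spinorLift gammaFive * wilsonDirac (fundamentalRep (Fin 3)) U b 1).charpoly.roots| ≤
      Multiset.countP (fun z : ℂ => |z.re| ≤ |b - a|)
        (spinorLift gammaFive * wilsonDirac (fundamentalRep (Fin 3)) U a 1).charpoly.roots := by
  have hρ : ∀ g : SU3, fundamentalRep (Fin 3) g ∈ Matrix.unitaryGroup (Fin 3) ℂ :=
    fundamentalRep_mem_unitaryGroup
  rw [hermitianWilsonDirac_eq_pencil _ hρ U a, hermitianWilsonDirac_eq_pencil _ hρ U b]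
  exact pencil_negCount_sub_le_window conjTranspose_spinorLift_gammaFive' spinorLift_gammaFive_mul_self
    (Literature.Barriers.QuantumFields.WilsonDeterminant.isHermitian_hermitianWilsonDirac _ hρ U 0 1) a b

/-- **TIGHT's integrand in Hermitian currency** (sharpening of `tight_integrand_le_signDefects_add_band`).
For a line at `m_crit`, a flavour window `w_f ≥ 0` and a probe depth `w_M ≥ 0`, on EVERY gauge field:
`|n₋(Γ₅D_W(U, m_crit − w_M, 1)) − 6L⁴| ≤ #{λ(Γ₅D_W(U, m_crit + w_f, 1)) : |λ| ≤ w_f + w_M}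
  + #{real λ(D_W(U,0,1)) : λ ≤ −(m_crit + w_f)}` —
a WINDOW count of the Hermitian operator AT THE FLAVOUR MASS (the currency of EXTINCT(b)) plus the real
modes at or below the flavour threshold (EXTINCT(a)'s sign defects plus the boundary atom). Weyl from the
flavour mass down to the probe, crossing budget (`abs_index_le_realModeCount`) from the flavour mass up. -/
theorem tight_integrand_le_window_add_realModes (U : GaugeConfig 4 L SU3) (mcrit wf wM : ℝ)
    (hwf : 0 ≤ wf) (hwM : 0 ≤ wM) :
    |(Multiset.countP (fun z : ℂ => z.re < 0)
        (spinorLift gammaFive * wilsonDirac (fundamentalRep (Fin 3)) U (mcrit - wM) 1).charpoly.roots : ℤ) -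
      6 * (L : ℤ) ^ 4| ≤
      (Multiset.countP (fun z : ℂ => |z.re| ≤ wf + wM)
          (spinorLift gammaFive * wilsonDirac (fundamentalRep (Fin 3)) U (mcrit + wf) 1).charpoly.roots : ℤ) +
        (Multiset.countP (fun z : ℂ => z.im = 0 ∧ z.re ≤ -(mcrit + wf))
          (wilsonDirac (fundamentalRep (Fin 3)) U 0 1).charpoly.roots : ℤ) := by
  have h1 := abs_negCount_sub_le_windowCount U (mcrit + wf) (mcrit - wM)
  have h2 := abs_index_le_realModeCount U (mcrit + wf)
  have hw : |mcrit - wM - (mcrit + wf)| = wf + wM := by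
    rw [show mcrit - wM - (mcrit + wf) = -(wf + wM) by ring, abs_neg, abs_of_nonneg (by linarith)]
  rw [hw, abs_sub_comm] at h1
  set nP := (Multiset.countP (fun z : ℂ => z.re < 0)
    (spinorLift gammaFive * wilsonDirac (fundamentalRep (Fin 3)) U (mcrit - wM) 1).charpoly.roots : ℤ)
  set nF := (Multiset.countP (fun z : ℂ => z.re < 0)
    (spinorLift gammaFive * wilsonDirac (fundamentalRep (Fin 3)) U (mcrit + wf) 1).charpoly.roots : ℤ)
  calc |nP - 6 * (L : ℤ) ^ 4| = |(nP - nF) + (nF - 6 * (L : ℤ) ^ 4)| := by ring_nf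
    _ ≤ |nP - nF| + |nF - 6 * (L : ℤ) ^ 4| := abs_add_le _ _
    _ ≤ _ := add_le_add h1 h2

/-- **A real eigenvalue of `D_W(U,0,1)` at `−μ` kills the determinant of `D_W(U,μ,1)`.** -/
theorem fermionDet_eq_zero_of_root (U : GaugeConfig 4 L SU3) (μ : ℝ) {z : ℂ}
    (hz : z ∈ (wilsonDirac (fundamentalRep (Fin 3)) U 0 1).charpoly.roots) (hzμ : z = ((-μ : ℝ) : ℂ)) :
    fermionDet (wilsonDirac (fundamentalRep (Fin 3)) U μ 1) = 0 := by
  set D₀ := wilsonDirac (fundamentalRep (Fin 3)) U 0 1 with hD₀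
  have hne : D₀.charpoly ≠ 0 := (Matrix.charpoly_monic _).ne_zero
  have heval : (Matrix.scalar _ z - D₀).det = 0 := by
    rw [← Matrix.eval_charpoly]; exact (Polynomial.mem_roots hne).1 hz
  show (wilsonDirac (fundamentalRep (Fin 3)) U μ 1).det = 0
  rw [wilsonDirac_mass_eq_add_scalar (fundamentalRep (Fin 3)) U μ 1]
  have hmat : wilsonDirac (fundamentalRep (Fin 3)) U 0 1 + Matrix.scalar _ ((μ : ℝ) : ℂ) =
      -(Matrix.scalar _ z - D₀) := by
    rw [neg_sub, sub_eq_add_neg, ← map_neg, hzμ, Complex.ofReal_neg, neg_neg]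
  rw [hmat, Matrix.det_neg, heval, mul_zero]

/-- Real modes at or below a threshold = sign defects strictly below + the boundary atom. -/
theorem countP_realModes_le_eq (U : GaugeConfig 4 L SU3) (t : ℝ) :
    Multiset.countP (fun z : ℂ => z.im = 0 ∧ z.re ≤ t) (wilsonDirac (fundamentalRep (Fin 3)) U 0 1).charpoly.roots =
      Multiset.countP (fun z : ℂ => z.im = 0 ∧ z.re < t) (wilsonDirac (fundamentalRep (Fin 3)) U 0 1).charpoly.roots +
        Multiset.countP (fun z : ℂ => z = ((t : ℝ) : ℂ)) (wilsonDirac (fundamentalRep (Fin 3)) U 0 1).charpoly.roots := by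
  set R := (wilsonDirac (fundamentalRep (Fin 3)) U 0 1).charpoly.roots
  rw [Multiset.countP_eq_countP_filter_add R (fun z : ℂ => z.im = 0 ∧ z.re ≤ t) (fun z : ℂ => z.re < t),
    Multiset.countP_filter, Multiset.countP_filter]
  congr 1
  · exact Multiset.countP_congr rfl fun z _ => propext
      ⟨fun h => ⟨h.1.1, h.2⟩, fun h => ⟨⟨h.1, h.2.le⟩, h.2⟩⟩
  · refine Multiset.countP_congr rfl fun z _ => propext ⟨fun h => ?_, fun h => ?_⟩
    · have hre : z.re = t := le_antisymm h.1.2 (not_lt.1 h.2)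
      exact Complex.ext (by simp [hre]) (by simp [h.1.1])
    · subst h
      exact ⟨⟨by simp, by simp⟩, by simp⟩

/-- **Pointwise domination of TIGHT by EXTINCT (one flavour's window is enough).** For witness data
`(reg, c)` at step `k`, a mass tuple `m`, a probe parameter `M ≥ 0` and a flavour `f₀` with `m_{f₀} ≥ 0` and
`m_{f₀} + M < c · m_{f₀}` (possible iff `c > 1`), on EVERY gauge field of the torus of side `2L'+1`: the
TIGHT integrand times the phase-quenched weight `∏_f |det D_W(U, m_f(k), 1)|` is at most the EXTINCT
integrand times the same weight. (Weyl window `a_k(m_{f₀}+M)/Z_k` inside EXTINCT(b)'s window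
`c a_k m_{f₀}/Z_k`; the real modes `≤ −m_{f₀}(k)` are EXTINCT(a)'s sign defects plus the atom at
`−m_{f₀}(k)`, on which the weight vanishes: `det D_W(U, m_{f₀}(k), 1) = 0`.) -/
theorem tightIntegrand_mul_le_extinctIntegrand_mul {Nf L' : ℕ} (U : GaugeConfig 4 (2 * L' + 1) SU3)
    (reg : QCDRegularisation Nf) (c : ℝ) (k : ℕ) (m : Fin Nf → ℝ) (M : ℝ) (f₀ : Fin Nf)
    (hm : 0 ≤ m f₀) (hM : 0 ≤ M) (hwin : m f₀ + M < c * m f₀) :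
    |(Multiset.countP (fun z : ℂ => z.re < 0) (spinorLift gammaFive * wilsonDirac (fundamentalRep (Fin 3)) U (reg.mcrit k - reg.a k * M / reg.Zm k) 1).charpoly.roots : ℝ) - 6 * (2 * L' + 1 : ℝ) ^ 4| * ∏ f : Fin Nf, ‖fermionDet (wilsonDirac (fundamentalRep (Fin 3)) U (reg.mcrit k + reg.a k * m f / reg.Zm k) 1)‖ ≤
      (∑ f : Fin Nf, ((Multiset.countP (fun z : ℂ => z.im = 0 ∧ z.re < -(reg.mcrit k + reg.a k * m f / reg.Zm k)) (wilsonDirac (fundamentalRep (Fin 3)) U 0 1).charpoly.roots : ℝ) + (Multiset.countP (fun z : ℂ => |z.re| < c * (reg.a k * m f / reg.Zm k)) (spinorLift gammaFive * wilsonDirac (fundamentalRep (Fin 3)) U (reg.mcrit k + reg.a k * m f / reg.Zm k) 1).charpoly.roots : ℝ))) * ∏ f : Fin Nf, ‖fermionDet (wilsonDirac (fundamentalRep (Fin 3)) U (reg.mcrit k + reg.a k * m f / reg.Zm k) 1)‖ := by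
  set wf : ℝ := reg.a k * m f₀ / reg.Zm k with hwf
  set wM : ℝ := reg.a k * M / reg.Zm k with hwM
  set W : ℝ := ∏ f : Fin Nf, ‖fermionDet (wilsonDirac (fundamentalRep (Fin 3)) U
    (reg.mcrit k + reg.a k * m f / reg.Zm k) 1)‖ with hW
  have hwf0 : 0 ≤ wf := div_nonneg (mul_nonneg (reg.a_pos k).le hm) (reg.Zm_pos k).le
  have hwM0 : 0 ≤ wM := div_nonneg (mul_nonneg (reg.a_pos k).le hM) (reg.Zm_pos k).le
  have hW0 : 0 ≤ W := Finset.prod_nonneg fun f _ => norm_nonneg _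
  -- the window of `f₀` fits inside EXTINCT(b)'s window
  have hwin' : wf + wM < c * wf := by
    have h1 : reg.a k * (m f₀ + M) / reg.Zm k < reg.a k * (c * m f₀) / reg.Zm k :=
      div_lt_div_of_pos_right (mul_lt_mul_of_pos_left hwin (reg.a_pos k)) (reg.Zm_pos k)
    have e1 : reg.a k * (m f₀ + M) / reg.Zm k = wf + wM := by rw [hwf, hwM]; ring
    have e2 : reg.a k * (c * m f₀) / reg.Zm k = c * wf := by rw [hwf]; ring
    linarith
  -- the atom
  by_cases hatom : Multiset.countP (fun z : ℂ => z = ((-(reg.mcrit k + wf) : ℝ) : ℂ)) (wilsonDirac (fundamentalRep (Fin 3)) U 0 1).charpoly.roots = 0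
  · -- no real eigenvalue exactly at the flavour threshold: Hermitian-currency budget, cast to `ℝ`
    have hZ := tight_integrand_le_window_add_realModes U (reg.mcrit k) wf wM hwf0 hwM0
    rw [countP_realModes_le_eq U, hatom, add_zero] at hZ
    have hRe : |(Multiset.countP (fun z : ℂ => z.re < 0) (spinorLift gammaFive * wilsonDirac (fundamentalRep (Fin 3)) U (reg.mcrit k - wM) 1).charpoly.roots : ℝ) - 6 * (2 * L' + 1 : ℝ) ^ 4| ≤
        (Multiset.countP (fun z : ℂ => |z.re| ≤ wf + wM) (spinorLift gammaFive * wilsonDirac (fundamentalRep (Fin 3)) U (reg.mcrit k + wf) 1).charpoly.roots : ℝ) +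
          (Multiset.countP (fun z : ℂ => z.im = 0 ∧ z.re < -(reg.mcrit k + wf)) (wilsonDirac (fundamentalRep (Fin 3)) U 0 1).charpoly.roots : ℝ) := by
      exact_mod_cast hZ
    -- window ≤ coercivity defects of `f₀`, sign defects of `f₀` ≤ the flavour sum
    have hwin_le : (Multiset.countP (fun z : ℂ => |z.re| ≤ wf + wM) (spinorLift gammaFive * wilsonDirac (fundamentalRep (Fin 3)) U (reg.mcrit k + wf) 1).charpoly.roots : ℝ) ≤
        (Multiset.countP (fun z : ℂ => |z.re| < c * wf) (spinorLift gammaFive * wilsonDirac (fundamentalRep (Fin 3)) U (reg.mcrit k + wf) 1).charpoly.roots : ℝ) := by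
      exact_mod_cast countP_le_countP_of_imp (p := fun z : ℂ => |z.re| ≤ wf + wM)
        (q := fun z : ℂ => |z.re| < c * wf) _ fun z hz => lt_of_le_of_lt hz hwin'
    have hsum : (Multiset.countP (fun z : ℂ => z.im = 0 ∧ z.re < -(reg.mcrit k + wf)) (wilsonDirac (fundamentalRep (Fin 3)) U 0 1).charpoly.roots : ℝ) +
        (Multiset.countP (fun z : ℂ => |z.re| < c * wf) (spinorLift gammaFive * wilsonDirac (fundamentalRep (Fin 3)) U (reg.mcrit k + wf) 1).charpoly.roots : ℝ) ≤
        ∑ f : Fin Nf, ((Multiset.countP (fun z : ℂ => z.im = 0 ∧ z.re < -(reg.mcrit k + reg.a k * m f / reg.Zm k)) (wilsonDirac (fundamentalRep (Fin 3)) U 0 1).charpoly.roots : ℝ) + (Multiset.countP (fun z : ℂ => |z.re| < c * (reg.a k * m f / reg.Zm k)) (spinorLift gammaFive * wilsonDirac (fundamentalRep (Fin 3)) U (reg.mcrit k + reg.a k * m f / reg.Zm k) 1).charpoly.roots : ℝ)) :=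
      Finset.single_le_sum (f := fun f : Fin Nf => ((Multiset.countP (fun z : ℂ => z.im = 0 ∧ z.re < -(reg.mcrit k + reg.a k * m f / reg.Zm k)) (wilsonDirac (fundamentalRep (Fin 3)) U 0 1).charpoly.roots : ℝ) + (Multiset.countP (fun z : ℂ => |z.re| < c * (reg.a k * m f / reg.Zm k)) (spinorLift gammaFive * wilsonDirac (fundamentalRep (Fin 3)) U (reg.mcrit k + reg.a k * m f / reg.Zm k) 1).charpoly.roots : ℝ)))
        (fun f _ => by positivity) (Finset.mem_univ f₀)
    have key := (hRe.trans (add_le_add hwin_le le_rfl)).trans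
      (le_of_eq_of_le (add_comm _ _) hsum)
    exact mul_le_mul_of_nonneg_right key hW0
  · -- a real eigenvalue exactly at `−m_{f₀}(k)`: the weight vanishes
    obtain ⟨z, hzR, hz⟩ : ∃ z ∈ (wilsonDirac (fundamentalRep (Fin 3)) U 0 1).charpoly.roots, z = ((-(reg.mcrit k + wf) : ℝ) : ℂ) := by
      by_contra hcon
      push Not at hcon
      exact hatom (Multiset.countP_eq_zero.2 fun z hz h => hcon z hz h)
    have hdet : fermionDet (wilsonDirac (fundamentalRep (Fin 3)) U (reg.mcrit k + wf) 1) = 0 :=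
      fermionDet_eq_zero_of_root U (reg.mcrit k + wf) hzR hz
    have hWz : W = 0 :=
      Finset.prod_eq_zero (Finset.mem_univ f₀) (by rw [← hwf, hdet, norm_zero])
    rw [hWz, mul_zero, mul_zero]

end Wilson

/-! ## §6c Measurability and integrability of the EXTINCT integrand -/

section Measurable

variable {L : ℕ} [NeZero L]

/-- `1/(k+1) ≤ 1/(j+1)` for `j ≤ k`. -/
private theorem one_div_succ_anti {j k : ℕ} (h : j ≤ k) : (1 : ℝ) / (k + 1) ≤ 1 / (j + 1) :=
  one_div_le_one_div_of_le (by positivity) (by exact_mod_cast Nat.succ_le_succ h)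

/-- **The sign-defect count is measurable in the gauge field**: `U ↦ #{real roots of charpoly D_W(U,0,1)
below t}` (with multiplicity) — the truth set `{im = 0, re < t}` is exhausted by the closed sets
`{im = 0, re ≤ t − 1/(j+1)}` (`countMeas_measurable_countP`). This is the measurability EXTINCT(a) and the
support item `PositivityDeficitLeDefects` silently need. -/
theorem measurable_signDefectCount (t : ℝ) :
    Measurable fun U : GaugeConfig 4 L SU3 => Multiset.countP (fun z : ℂ => z.im = 0 ∧ z.re < t)
      (wilsonDirac (fundamentalRep (Fin 3)) U 0 1).charpoly.roots := by
  have hA : Continuous fun U : GaugeConfig 4 L SU3 => wilsonDirac (fundamentalRep (Fin 3)) U 0 1 :=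
    continuous_wilsonDirac _ (continuous_fundamentalRep (Fin 3)) 0 1
  refine countMeas_measurable_countP hA (fun z : ℂ => z.im = 0 ∧ z.re < t)
    (fun j => {z : ℂ | z.im = 0 ∧ z.re ≤ t - 1 / (j + 1)}) (fun j => ?_) (fun j k hjk => ?_) (fun z => ?_)
  · exact (isClosed_eq Complex.continuous_im continuous_const).inter
      (isClosed_le Complex.continuous_re continuous_const)
  · rintro z ⟨h0, h1⟩
    have := one_div_succ_anti hjk
    exact ⟨h0, by linarith⟩
  · constructor
    · rintro ⟨h0, h1⟩
      obtain ⟨j, hj⟩ := exists_nat_one_div_lt (sub_pos.mpr h1)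
      exact ⟨j, h0, by linarith⟩
    · rintro ⟨j, h0, h1⟩
      have : (0 : ℝ) < 1 / (j + 1) := by positivity
      exact ⟨h0, by linarith⟩

/-- **The coercivity-defect count is measurable in the gauge field**: `U ↦ #{eigenvalues of
Γ₅D_W(U,μ,1) with |re| < η}`. -/
theorem measurable_coercivityDefectCount (μ η : ℝ) :
    Measurable fun U : GaugeConfig 4 L SU3 => Multiset.countP (fun z : ℂ => |z.re| < η)
      (spinorLift gammaFive * wilsonDirac (fundamentalRep (Fin 3)) U μ 1).charpoly.roots := by
  have hA : Continuous fun U : GaugeConfig 4 L SU3 =>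
      spinorLift gammaFive * wilsonDirac (fundamentalRep (Fin 3)) U μ 1 :=
    continuous_const.matrix_mul (continuous_wilsonDirac _ (continuous_fundamentalRep (Fin 3)) μ 1)
  refine countMeas_measurable_countP hA (fun z : ℂ => |z.re| < η)
    (fun j => {z : ℂ | |z.re| ≤ η - 1 / (j + 1)}) (fun j => ?_) (fun j k hjk => ?_) (fun z => ?_)
  · exact isClosed_le (continuous_abs.comp Complex.continuous_re) continuous_const
  · intro z hz
    simp only [Set.mem_setOf_eq] at hz ⊢
    linarith [one_div_succ_anti hjk]
  · constructor
    · intro h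
      obtain ⟨j, hj⟩ := exists_nat_one_div_lt (sub_pos.mpr h)
      exact ⟨j, by simp only [Set.mem_setOf_eq]; linarith⟩
    · rintro ⟨j, hj⟩
      simp only [Set.mem_setOf_eq] at hj
      have : (0 : ℝ) < 1 / (j + 1) := by positivity
      linarith

/-- **The closed-window count is measurable**: `U ↦ #{eigenvalues of Γ₅D_W(U,μ,1) with |re| ≤ η}`. -/
theorem measurable_windowCount (μ η : ℝ) :
    Measurable fun U : GaugeConfig 4 L SU3 => Multiset.countP (fun z : ℂ => |z.re| ≤ η)
      (spinorLift gammaFive * wilsonDirac (fundamentalRep (Fin 3)) U μ 1).charpoly.roots := by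
  have hA : Continuous fun U : GaugeConfig 4 L SU3 =>
      spinorLift gammaFive * wilsonDirac (fundamentalRep (Fin 3)) U μ 1 :=
    continuous_const.matrix_mul (continuous_wilsonDirac _ (continuous_fundamentalRep (Fin 3)) μ 1)
  exact countMeas_measurable_countP hA (fun z : ℂ => |z.re| ≤ η) (fun _ => {z : ℂ | |z.re| ≤ η})
    (fun _ => isClosed_le (continuous_abs.comp Complex.continuous_re) continuous_const)
    (fun _ _ _ => le_rfl) (fun z => ⟨fun h => ⟨0, h⟩, fun ⟨_, h⟩ => h⟩)

/-- **The shell count is measurable**: `U ↦ #{eigenvalues of Γ₅D_W(U,μ,1) with w ≤ |re| ≤ d}`. -/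
theorem measurable_shellCount (μ w d : ℝ) :
    Measurable fun U : GaugeConfig 4 L SU3 => Multiset.countP (fun z : ℂ => w ≤ |z.re| ∧ |z.re| ≤ d)
      (spinorLift gammaFive * wilsonDirac (fundamentalRep (Fin 3)) U μ 1).charpoly.roots := by
  have hA : Continuous fun U : GaugeConfig 4 L SU3 =>
      spinorLift gammaFive * wilsonDirac (fundamentalRep (Fin 3)) U μ 1 :=
    continuous_const.matrix_mul (continuous_wilsonDirac _ (continuous_fundamentalRep (Fin 3)) μ 1)
  exact countMeas_measurable_countP hA (fun z : ℂ => w ≤ |z.re| ∧ |z.re| ≤ d)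
    (fun _ => {z : ℂ | w ≤ |z.re| ∧ |z.re| ≤ d})
    (fun _ => (isClosed_le continuous_const (continuous_abs.comp Complex.continuous_re)).inter
      (isClosed_le (continuous_abs.comp Complex.continuous_re) continuous_const))
    (fun _ _ _ => le_rfl) (fun z => ⟨fun h => ⟨0, h⟩, fun ⟨_, h⟩ => h⟩)

/-- **The negative-eigenvalue count (TIGHT's `n₋`) is measurable**: `U ↦ #{eigenvalues of Γ₅D_W(U,μ,1)
with re < 0}`. -/
theorem measurable_negCount (μ : ℝ) :
    Measurable fun U : GaugeConfig 4 L SU3 => Multiset.countP (fun z : ℂ => z.re < 0)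
      (spinorLift gammaFive * wilsonDirac (fundamentalRep (Fin 3)) U μ 1).charpoly.roots := by
  have hA : Continuous fun U : GaugeConfig 4 L SU3 =>
      spinorLift gammaFive * wilsonDirac (fundamentalRep (Fin 3)) U μ 1 :=
    continuous_const.matrix_mul (continuous_wilsonDirac _ (continuous_fundamentalRep (Fin 3)) μ 1)
  refine countMeas_measurable_countP hA (fun z : ℂ => z.re < 0)
    (fun j => {z : ℂ | z.re ≤ -(1 / (j + 1))}) (fun j => ?_) (fun j k hjk => ?_) (fun z => ?_)
  · exact isClosed_le Complex.continuous_re continuous_const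
  · intro z hz
    simp only [Set.mem_setOf_eq] at hz ⊢
    linarith [one_div_succ_anti hjk]
  · constructor
    · intro h
      obtain ⟨j, hj⟩ := exists_nat_one_div_lt (neg_pos.mpr h)
      exact ⟨j, by simp only [Set.mem_setOf_eq]; linarith⟩
    · rintro ⟨j, hj⟩
      simp only [Set.mem_setOf_eq] at hj
      have : (0 : ℝ) < 1 / (j + 1) := by positivity
      linarith

/-- A root count is at most the matrix size. -/
theorem countP_roots_charpoly_le_card {ι : Type*} [Fintype ι] [DecidableEq ι] (A : Matrix ι ι ℂ)
    (p : ℂ → Prop) [DecidablePred p] : Multiset.countP p A.charpoly.roots ≤ Fintype.card ι :=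
  ((Multiset.countP_le_card _ _).trans (Polynomial.card_roots' _)).trans
    (le_of_eq (Matrix.charpoly_natDegree_eq_dim A))

/-- **A bounded measurable functional times the phase-quenched weight is integrable** against the
Wilson measure (the weight `∏_f |det D_W(U, m_f, 1)| = |det D(U)|` is continuous on the compact
configuration space, `integrable_norm_det_diracMatrix`). -/
theorem integrable_mul_weight {Nf : ℕ} (mq : Fin Nf → ℝ) (β : ℝ) {φ : GaugeConfig 4 L SU3 → ℝ}
    (hφ : Measurable φ) {C : ℝ} (hC : ∀ U, |φ U| ≤ C) :
    Integrable (fun U => φ U * ∏ f : Fin Nf, ‖fermionDet (wilsonDirac (fundamentalRep (Fin 3)) U (mq f) 1)‖)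
      (wilsonMeasure (d := 4) (L := L) (fundamentalRep (Fin 3)) β) := by
  obtain ⟨CW, hCW⟩ := exists_norm_det_diracMatrix_le (S := L) mq
  have hW : ∀ U : GaugeConfig 4 L SU3, (∏ f : Fin Nf, ‖fermionDet (wilsonDirac (fundamentalRep (Fin 3)) U (mq f) 1)‖) =
      ‖(diracMatrix U mq).det‖ := fun U => (norm_det_diracMatrix U mq).symm
  simp_rw [hW]
  refine Integrable.of_bound (hφ.aestronglyMeasurable.mul
    (measurable_norm_det_diracMatrix mq).aestronglyMeasurable) (C * CW)
    (Eventually.of_forall fun U => ?_)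
  rw [norm_mul, Real.norm_eq_abs, Real.norm_eq_abs, abs_of_nonneg (norm_nonneg _)]
  have hC0 : 0 ≤ C := (abs_nonneg _).trans (hC U)
  exact mul_le_mul (hC U) (hCW U) (norm_nonneg _) hC0

/-- An `ℕ`-valued measurable spectral count, bounded by `N`, times the phase-quenched weight is integrable. -/
theorem integrable_natCount_mul_weight {Nf : ℕ} (mq : Fin Nf → ℝ) (β : ℝ) {g : GaugeConfig 4 L SU3 → ℕ}
    (hg : Measurable g) {N : ℕ} (hN : ∀ U, g U ≤ N) :
    Integrable (fun U => (g U : ℝ) * ∏ f : Fin Nf, ‖fermionDet (wilsonDirac (fundamentalRep (Fin 3)) U (mq f) 1)‖)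
      (wilsonMeasure (d := 4) (L := L) (fundamentalRep (Fin 3)) β) :=
  integrable_mul_weight mq β (φ := fun U => (g U : ℝ)) (measurable_from_nat.comp hg) (C := (N : ℝ))
    (fun U => by rw [Nat.abs_cast]; exact_mod_cast hN U)

/-- **The EXTINCT integrand is integrable** (witness data `(reg, c)`, step `k`, tuple `m`, any torus and
coupling): finitely many measurable spectral counts, each bounded by `12·L⁴`, times the continuous weight.
Without this the EXTINCT clause of `SD` would be contentless (a bound on a junk-zero Bochner integral). -/
theorem integrable_extinctIntegrand {Nf : ℕ} (reg : QCDRegularisation Nf) (c : ℝ) (k : ℕ)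
    (m : Fin Nf → ℝ) (β : ℝ) :
    Integrable (fun U : GaugeConfig 4 L SU3 => (∑ f : Fin Nf, ((Multiset.countP (fun z : ℂ => z.im = 0 ∧ z.re < -(reg.mcrit k + reg.a k * m f / reg.Zm k)) (wilsonDirac (fundamentalRep (Fin 3)) U 0 1).charpoly.roots : ℝ) + (Multiset.countP (fun z : ℂ => |z.re| < c * (reg.a k * m f / reg.Zm k)) (spinorLift gammaFive * wilsonDirac (fundamentalRep (Fin 3)) U (reg.mcrit k + reg.a k * m f / reg.Zm k) 1).charpoly.roots : ℝ))) * ∏ f : Fin Nf, ‖fermionDet (wilsonDirac (fundamentalRep (Fin 3)) U (reg.mcrit k + reg.a k * m f / reg.Zm k) 1)‖)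
      (wilsonMeasure (d := 4) (L := L) (fundamentalRep (Fin 3)) β) := by
  refine integrable_mul_weight (fun f => reg.mcrit k + reg.a k * m f / reg.Zm k) β
    (Finset.measurable_sum _ fun f _ => ?_) (C := ∑ _f : Fin Nf, ((Fintype.card (QuarkIdx L) : ℝ) +
      Fintype.card (QuarkIdx L))) (fun U => ?_)
  · have hc : ∀ g : GaugeConfig 4 L SU3 → ℕ, Measurable g → Measurable fun U => (g U : ℝ) :=
      fun g hg => measurable_from_nat.comp hg
    exact (hc _ (measurable_signDefectCount (-(reg.mcrit k + reg.a k * m f / reg.Zm k)))).add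
      (hc _ (measurable_coercivityDefectCount (reg.mcrit k + reg.a k * m f / reg.Zm k)
        (c * (reg.a k * m f / reg.Zm k))))
  · rw [abs_of_nonneg (Finset.sum_nonneg fun f _ => by positivity)]
    refine Finset.sum_le_sum fun f _ => add_le_add ?_ ?_
    · exact_mod_cast countP_roots_charpoly_le_card _ _
    · exact_mod_cast countP_roots_charpoly_le_card _ _

end Measurable

/-! ## §6d The coercivity ceiling `c ≤ 1` -/

section Ceiling

variable {Nf : ℕ}

/-- The EXTINCT ratio of witness data `(reg, c)` at step `k`, mass tuple `m`, on the torus of half-side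
`S` (EXTINCT itself is `extinct_iff_extinctRatio`; verbatim from the route file). -/
noncomputable def extinctRatio (reg : QCDRegularisation Nf) (c : ℝ) (k S : ℕ) (m : Fin Nf → ℝ) : ℝ :=
  (∫ U, ((∑ f : Fin Nf, ((Multiset.countP (fun z : ℂ => z.im = 0 ∧ z.re < -(reg.mcrit k + reg.a k * m f / reg.Zm k)) (wilsonDirac (fundamentalRep (Fin 3)) U 0 1).charpoly.roots : ℝ) + (Multiset.countP (fun z : ℂ => |z.re| < c * (reg.a k * m f / reg.Zm k)) (spinorLift gammaFive * wilsonDirac (fundamentalRep (Fin 3)) U (reg.mcrit k + reg.a k * m f / reg.Zm k) 1).charpoly.roots : ℝ)))) * ∏ f : Fin Nf, ‖fermionDet (wilsonDirac (fundamentalRep (Fin 3)) U (reg.mcrit k + reg.a k * m f / reg.Zm k) 1)‖ ∂(wilsonMeasure (d := 4) (L := 2 * S + 1) (fundamentalRep (Fin 3)) (reg.β k))) / (∫ U, ∏ f : Fin Nf, ‖fermionDet (wilsonDirac (fundamentalRep (Fin 3)) U (reg.mcrit k + reg.a k * m f / reg.Zm k) 1)‖ ∂(wilsonMeasure (d :=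 4) (L := 2 * S + 1) (fundamentalRep (Fin 3)) (reg.β k)))

/-- EXTINCT is "for every `ε > 0`, eventually in `k`, on every torus `S ≥ L_k` the ratio is
`≤ ε((2S+1)/(2L_k+1))⁴`" (definitional). -/
theorem extinct_iff_extinctRatio (reg : QCDRegularisation Nf) (c : ℝ) (m : Fin Nf → ℝ) :
    Extinct Nf reg c m ↔ ∀ ε : ℝ, 0 < ε → ∀ᶠ k : ℕ in Filter.atTop, ∀ S : ℕ, reg.L k ≤ S →
      extinctRatio reg c k S m ≤ ε * ((2 * S + 1 : ℝ) / (2 * reg.L k + 1)) ^ 4 :=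
  Iff.rfl

/-- **EXTINCT is monotone in the window constant**: for non-negative masses a smaller `c` clears a smaller
window, so `extinctRatio` decreases with `c` — the `∃ c > 0` of `SD` may always be taken small; together with the
ceiling below, WLOG `c ∈ (0, 1]`. -/
theorem extinctRatio_mono (reg : QCDRegularisation Nf) {c c' : ℝ} (hc : c' ≤ c) (k S : ℕ) {m : Fin Nf → ℝ}
    (hm : ∀ f, 0 ≤ m f) : extinctRatio reg c' k S m ≤ extinctRatio reg c k S m := by
  unfold extinctRatio
  refine div_le_div_of_nonneg_right ?_
    (integral_nonneg fun U => Finset.prod_nonneg fun f _ => norm_nonneg _)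
  refine integral_mono_of_nonneg (Eventually.of_forall fun U => ?_)
    (integrable_extinctIntegrand reg c k m (reg.β k)) (Eventually.of_forall fun U => ?_)
  · exact mul_nonneg (Finset.sum_nonneg fun f _ => by positivity) (Finset.prod_nonneg fun f _ => norm_nonneg _)
  · refine mul_le_mul_of_nonneg_right (Finset.sum_le_sum fun f _ => add_le_add le_rfl ?_)
      (Finset.prod_nonneg fun f _ => norm_nonneg _)
    have hw : c' * (reg.a k * m f / reg.Zm k) ≤ c * (reg.a k * m f / reg.Zm k) :=
      mul_le_mul_of_nonneg_right hc (div_nonneg (mul_nonneg (reg.a_pos k).le (hm f)) (reg.Zm_pos k).le)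
    exact_mod_cast countP_le_countP_of_imp (p := fun z : ℂ => |z.re| < c' * (reg.a k * m f / reg.Zm k))
      (q := fun z : ℂ => |z.re| < c * (reg.a k * m f / reg.Zm k)) _ fun z hz => lt_of_lt_of_le hz hw

/-- `Extinct` with constant `c` implies `Extinct` with any smaller constant (non-negative masses). -/
theorem Extinct.mono (reg : QCDRegularisation Nf) {c c' : ℝ} (hc : c' ≤ c) {m : Fin Nf → ℝ}
    (hm : ∀ f, 0 ≤ m f) (h : Extinct Nf reg c m) : Extinct Nf reg c' m := by
  rw [extinct_iff_extinctRatio] at h ⊢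
  intro ε hε
  filter_upwards [h ε hε] with k hk S hS
  exact (extinctRatio_mono reg hc k S hm).trans (hk S hS)

/-- **TIGHT ≤ EXTINCT whenever one flavour's Weyl window fits inside its coercivity window.** For any
witness data, step `k`, torus half-side `S`, non-negative masses, probe parameter `M ≥ 0` and a flavour
`f₀` with `m_{f₀} + M < c·m_{f₀}`: the TIGHT ratio on the torus `(2S+1)⁴` is at most the EXTINCT ratio
there (pointwise domination `tightIntegrand_mul_le_extinctIntegrand_mul`, integrability of the EXTINCT
integrand, common denominator). -/
theorem tightRatio_le_extinctRatio (reg : QCDRegularisation Nf) (c : ℝ) (k S : ℕ) {m : Fin Nf → ℝ}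
    {M : ℝ} (f₀ : Fin Nf) (hm : 0 ≤ m f₀) (hM : 0 ≤ M) (hwin : m f₀ + M < c * m f₀) :
    tightRatio reg k S m M ≤ extinctRatio reg c k S m := by
  unfold tightRatio extinctRatio
  refine div_le_div_of_nonneg_right ?_
    (integral_nonneg fun U => Finset.prod_nonneg fun f _ => norm_nonneg _)
  refine integral_mono_of_nonneg (Eventually.of_forall fun U => ?_)
    (integrable_extinctIntegrand reg c k m (reg.β k)) (Eventually.of_forall fun U => ?_)
  · exact mul_nonneg (abs_nonneg _) (Finset.prod_nonneg fun f _ => norm_nonneg _)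
  · exact tightIntegrand_mul_le_extinctIntegrand_mul U reg c k m M f₀ hm hM hwin

/-- **THE COERCIVITY CEILING.** For ANY regularisation `reg`, threshold `M₀ ≥ 0`, window constant `c`
and at least one flavour: if every mass tuple above `M₀` is EXTINCT (with `c`) and TIGHT, then `c ≤ 1`.
Proof: were `c > 1`, take all masses `= K` with `(c−1)K > M₀+1` and the probe `M = M₀+1`; eventually in
`k`, TIGHT gives `1 ≤ tightRatio`, EXTINCT at `ε = 1/2` on the scheme torus gives `extinctRatio ≤ 1/2`,
and `tightRatio ≤ extinctRatio`. MEANING: TIGHT makes the line critical (near-zero modes of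
`H_W(m_f(k))` within `a_k(m_f+M)/Z_k`, mean `≥ 1−ε`), so the coercivity window EXTINCT(b) can clear is at
most the bare distance `a_k m_f/Z_k` to the line — the statistical Vafa–Witten bound the bridge extracts,
`‖(D_W + m_f(k))⁻¹‖ ≤ Z_k/(c a_k m_f)` off the defect gas, never has `c > 1`. -/
theorem c_le_one_of_extinct_tight (reg : QCDRegularisation Nf) {M₀ c : ℝ} (hM₀ : 0 ≤ M₀)
    (f₀ : Fin Nf) (h : ∀ m : Fin Nf → ℝ, (∀ f, M₀ < m f) → Extinct Nf reg c m ∧ Tight Nf reg M₀ m) :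
    c ≤ 1 := by
  by_contra hc
  push Not at hc
  have hc1 : 0 < c - 1 := by linarith
  -- masses `K` with `(c - 1) K > M₀ + 1`, probe `M = M₀ + 1`
  set K : ℝ := (M₀ + 2) / (c - 1) + (M₀ + 1) with hK
  have hKdiv : (c - 1) * ((M₀ + 2) / (c - 1)) = M₀ + 2 := by
    rw [mul_comm]; exact div_mul_cancel₀ (M₀ + 2) hc1.ne'
  have hK₀ : M₀ < K := by
    have : 0 ≤ (M₀ + 2) / (c - 1) := by positivity
    linarith
  have hKnn : 0 ≤ K := by linarith
  have hwin : K + (M₀ + 1) < c * K := by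
    have h2 : 0 ≤ (c - 1) * (M₀ + 1) := mul_nonneg hc1.le (by linarith)
    have h3 : c * K = K + (c - 1) * ((M₀ + 2) / (c - 1)) + (c - 1) * (M₀ + 1) := by rw [hK]; ring
    rw [h3, hKdiv]
    linarith
  obtain ⟨hE, hT⟩ := h (fun _ => K) fun _ => hK₀
  have hE' := hE (1 / 2) (by norm_num)
  have hT' := hT (M₀ + 1) (by linarith)
  obtain ⟨k, hEk, hTk⟩ := (hE'.and hT').exists
  have hEk' : extinctRatio reg c k (reg.L k) (fun _ => K) ≤
      1 / 2 * ((2 * (reg.L k : ℕ) + 1 : ℝ) / (2 * reg.L k + 1)) ^ 4 := hEk (reg.L k) le_rfl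
  have hTk' : 1 ≤ tightRatio reg k (reg.L k) (fun _ => K) (M₀ + 1) := hTk
  have hone : ((2 * (reg.L k : ℕ) + 1 : ℝ) / (2 * reg.L k + 1)) = 1 := div_self (by positivity)
  rw [hone, one_pow, mul_one] at hEk'
  have hle := tightRatio_le_extinctRatio reg c k (reg.L k) (m := fun _ => K) (M := M₀ + 1) f₀ hKnn
    (by linarith) hwin
  linarith

/-- **Every `SD` witness has window constant `c ≤ 1`** (`N_f ≥ 1`). -/
theorem SDHyp.c_le_one (hNf : 0 < Nf) {reg : QCDRegularisation Nf} {M₀ c : ℝ} (hM₀ : 0 ≤ M₀)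
    (h : ∀ m : Fin Nf → ℝ, (∀ f, M₀ < m f) → Extinct Nf reg c m ∧ Tight Nf reg M₀ m) : c ≤ 1 :=
  c_le_one_of_extinct_tight reg hM₀ ⟨0, hNf⟩ h

/-- **The natural strengthening "`SD` with `c > 1`" is unsatisfiable** for every `N_f ≥ 1` (in
particular `WindowExtinction` with `1 < c` in place of `0 < c` is FALSE, and the bridge with that
hypothesis is vacuously true): EXTINCT(b)'s window can never be wider than the bare distance to a TIGHT
line. No scaling hypothesis is used. -/
theorem not_sdHyp_with_one_lt (hNf : 0 < Nf) :
    ¬ ∃ reg : QCDRegularisation Nf, ∃ M₀ : ℝ, 0 ≤ M₀ ∧ ∃ c : ℝ, 1 < c ∧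
      ∀ m : Fin Nf → ℝ, (∀ f, M₀ < m f) → Extinct Nf reg c m ∧ Tight Nf reg M₀ m := by
  rintro ⟨reg, M₀, hM₀, c, hc, h⟩
  have := SDHyp.c_le_one hNf hM₀ h
  linarith

/-- Reading for the sibling crux: any witness of `WindowExtinction` at `N_f ∈ {2,3}` has `c ≤ 1`. -/
theorem windowExtinction_c_le_one (h : WindowExtinction) {Nf : ℕ} (hNf : Nf = 2 ∨ Nf = 3) :
    ∃ reg : QCDRegularisation Nf, reg.HasMassScaling ∧ (reg.scheme 0 0 0).HasAsymptoticScaling ∧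
      ∃ M₀ : ℝ, 0 ≤ M₀ ∧ ∃ c : ℝ, 0 < c ∧ c ≤ 1 ∧ ∀ m : Fin Nf → ℝ, (∀ f, M₀ < m f) →
        Extinct Nf reg c m ∧ Tight Nf reg M₀ m := by
  obtain ⟨reg, h1, h2, M₀, hM₀, c, hc, h⟩ := sdHyp_of_sdPlus (h Nf hNf)
  have hNf' : 0 < Nf := by rcases hNf with rfl | rfl <;> norm_num
  exact ⟨reg, h1, h2, M₀, hM₀, c, hc, SDHyp.c_le_one hNf' hM₀ h, h⟩

/-- The same for SD⁺-witnesses directly: the restated hypothesis keeps `c`, so EVERY SD⁺ witness has `c ≤ 1`. -/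
theorem SDPlus.c_le_one (h : WindowExtinction) {Nf : ℕ} (hNf : Nf = 2 ∨ Nf = 3) :
    ∃ reg : QCDRegularisation Nf, ∃ M₀ : ℝ, 0 ≤ M₀ ∧ ∃ c : ℝ, 0 < c ∧ c ≤ 1 ∧ ∀ m : Fin Nf → ℝ, (∀ f, M₀ < m f) →
        Extinct Nf reg c m ∧ TightPlus Nf reg M₀ m := by
  obtain ⟨reg, -, -, -, -, M₀, hM₀, c, hc, h⟩ := h Nf hNf
  have hNf' : 0 < Nf := by rcases hNf with rfl | rfl <;> norm_num
  exact ⟨reg, M₀, hM₀, c, hc,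
    SDHyp.c_le_one hNf' hM₀ (fun m hm => ⟨(h m hm).1, tight_of_tightPlus (h m hm).2⟩), h⟩

end Ceiling


/-! ## §6a′ Operator-norm form of the Weyl window budget (for lines perturbing by an arbitrary Hermitian `E`) -/

section OpNorm

variable {n : Type*} [Fintype n] [DecidableEq n]

/-- **Weyl window budget from a form bound.** For Hermitian `A`, `B` with `|Re v†(B − A)v| ≤ w·Σ‖v‖²`:
`|n₋(B) − n₋(A)| ≤ #{eigenvalues λ of A with |λ| ≤ w}` (roots of the characteristic polynomial, with multiplicity). -/
theorem abs_negCount_sub_le_windowCount_of_form {A B : Matrix n n ℂ} (hA : A.IsHermitian) (hB : B.IsHermitian)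
    {w : ℝ} (hw0 : 0 ≤ w) (hE : ∀ v : n → ℂ, |(star v ⬝ᵥ (B - A) *ᵥ v).re| ≤ w * ∑ i, ‖v i‖ ^ 2) :
    |(B.charpoly.roots.countP (fun z => z.re < 0) : ℤ) - A.charpoly.roots.countP (fun z => z.re < 0)| ≤
      A.charpoly.roots.countP (fun z => |z.re| ≤ w) := by
  have h1 : (Finset.univ.filter fun i => hA.eigenvalues i < -w).card ≤
      (Finset.univ.filter fun i => hB.eigenvalues i < 0).card := by
    convert card_filter_lt_neg_le hA hB (σ := 1) (δ := w) (Or.inl rfl) hE using 3 <;> simp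
  have h2 : (Finset.univ.filter fun i => w < hA.eigenvalues i).card ≤
      (Finset.univ.filter fun i => 0 < hB.eigenvalues i).card := by
    convert card_filter_lt_neg_le hA hB (σ := -1) (δ := w) (Or.inr rfl) hE using 3 <;> simp
  have htri := countP_neg_add_pos_add_zero hB
  rw [countP_roots_eq_card_filter hB (· < 0), countP_roots_eq_card_filter hB (0 < ·),
    countP_roots_eq_card_filter hB (· = 0)] at htri
  rw [countP_roots_eq_card_filter hA (· < 0), countP_roots_eq_card_filter hB (· < 0),
    countP_roots_eq_card_filter hA (fun x => |x| ≤ w)]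
  have ha : (Finset.univ.filter fun i => hA.eigenvalues i < 0).card ≤
      (Finset.univ.filter fun i => hA.eigenvalues i < -w).card +
        (Finset.univ.filter fun i => |hA.eigenvalues i| ≤ w).card :=
    card_filter_le_add fun i hi => by
      by_cases h : hA.eigenvalues i < -w
      · exact Or.inl h
      · exact Or.inr (abs_le.2 ⟨not_lt.1 h, by linarith⟩)
  have hb : (Finset.univ.filter fun i => ¬ w < hA.eigenvalues i).card ≤
      (Finset.univ.filter fun i => hA.eigenvalues i < 0).card +
        (Finset.univ.filter fun i => |hA.eigenvalues i| ≤ w).card :=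
    card_filter_le_add fun i hi => by
      by_cases h : hA.eigenvalues i < 0
      · exact Or.inl h
      · exact Or.inr (abs_le.2 ⟨by linarith [not_lt.1 h], not_lt.1 hi⟩)
  have hN := Finset.card_filter_add_card_filter_not (s := (Finset.univ : Finset n))
    (fun i => w < hA.eigenvalues i)
  have hNB := Finset.card_filter_add_card_filter_not (s := (Finset.univ : Finset n))
    (fun i => hB.eigenvalues i < 0)
  have hsub : (Finset.univ.filter fun i => 0 < hB.eigenvalues i).card ≤
      (Finset.univ.filter fun i => ¬ hB.eigenvalues i < 0).card :=
    Finset.card_le_card fun i hi => by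
      rw [Finset.mem_filter] at hi ⊢
      exact ⟨hi.1, fun h => lt_asymm h hi.2⟩
  rw [abs_le]
  constructor <;> omega

open scoped Matrix.Norms.L2Operator in
/-- **Weyl's inequality in counting form, operator-norm version** (card `weyl-transport-unitary-pin`'s stub
`negCount_sub_negCount_le_modCount`, general form): for Hermitian `A`, `B`,
`|n₋(B) − n₋(A)| ≤ #{eigenvalues λ of A with |λ| ≤ ‖B − A‖}` (`ℓ²`-operator norm). No gap, margin or eigenvector
information is used. -/
theorem abs_negCount_sub_le_windowCount_opNorm {A B : Matrix n n ℂ} (hA : A.IsHermitian) (hB : B.IsHermitian) :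
    |(B.charpoly.roots.countP (fun z => z.re < 0) : ℤ) - A.charpoly.roots.countP (fun z => z.re < 0)| ≤
      A.charpoly.roots.countP (fun z => |z.re| ≤ ‖B - A‖) :=
  abs_negCount_sub_le_windowCount_of_form hA hB (norm_nonneg _) fun v =>
    (Complex.abs_re_le_norm _).trans (norm_star_dotProduct_mulVec_le (B - A) v)

end OpNorm

/-! ## §6e What TIGHT ∧ EXTINCT buy, in both currencies: the two-sided pin at the flavour mass -/

section Pin

variable {Nf : ℕ}

/-- One flavour's defect counts (sign + coercivity) are at most the EXTINCT integrand (flavour sum of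
non-negative counts). -/
theorem flavourDefects_le_extinctSum {L : ℕ} [NeZero L] (U : GaugeConfig 4 L SU3) (reg : QCDRegularisation Nf)
    (c : ℝ) (k : ℕ) (m : Fin Nf → ℝ) (f₀ : Fin Nf) :
    (Multiset.countP (fun z : ℂ => z.im = 0 ∧ z.re < -(reg.mcrit k + reg.a k * m f₀ / reg.Zm k)) (wilsonDirac (fundamentalRep (Fin 3)) U 0 1).charpoly.roots : ℝ) + (Multiset.countP (fun z : ℂ => |z.re| < c * (reg.a k * m f₀ / reg.Zm k)) (spinorLift gammaFive * wilsonDirac (fundamentalRep (Fin 3)) U (reg.mcrit k + reg.a k * m f₀ / reg.Zm k) 1).charpoly.roots : ℝ) ≤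
      ∑ f : Fin Nf, ((Multiset.countP (fun z : ℂ => z.im = 0 ∧ z.re < -(reg.mcrit k + reg.a k * m f / reg.Zm k)) (wilsonDirac (fundamentalRep (Fin 3)) U 0 1).charpoly.roots : ℝ) + (Multiset.countP (fun z : ℂ => |z.re| < c * (reg.a k * m f / reg.Zm k)) (spinorLift gammaFive * wilsonDirac (fundamentalRep (Fin 3)) U (reg.mcrit k + reg.a k * m f / reg.Zm k) 1).charpoly.roots : ℝ)) :=
  Finset.single_le_sum (f := fun f : Fin Nf => ((Multiset.countP (fun z : ℂ => z.im = 0 ∧ z.re < -(reg.mcrit k + reg.a k * m f / reg.Zm k)) (wilsonDirac (fundamentalRep (Fin 3)) U 0 1).charpoly.roots : ℝ) + (Multiset.countP (fun z : ℂ => |z.re| < c * (reg.a k * m f / reg.Zm k)) (spinorLift gammaFive * wilsonDirac (fundamentalRep (Fin 3)) U (reg.mcrit k + reg.a k * m f / reg.Zm k) 1).charpoly.roots : ℝ)))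
    (fun _ _ => add_nonneg (Nat.cast_nonneg _) (Nat.cast_nonneg _)) (Finset.mem_univ f₀)

/-- One flavour's sign-defect count is at most the EXTINCT integrand. -/
theorem signDefects_le_extinctSum {L : ℕ} [NeZero L] (U : GaugeConfig 4 L SU3) (reg : QCDRegularisation Nf)
    (c : ℝ) (k : ℕ) (m : Fin Nf → ℝ) (f₀ : Fin Nf) :
    (Multiset.countP (fun z : ℂ => z.im = 0 ∧ z.re < -(reg.mcrit k + reg.a k * m f₀ / reg.Zm k)) (wilsonDirac (fundamentalRep (Fin 3)) U 0 1).charpoly.roots : ℝ) ≤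
      ∑ f : Fin Nf, ((Multiset.countP (fun z : ℂ => z.im = 0 ∧ z.re < -(reg.mcrit k + reg.a k * m f / reg.Zm k)) (wilsonDirac (fundamentalRep (Fin 3)) U 0 1).charpoly.roots : ℝ) + (Multiset.countP (fun z : ℂ => |z.re| < c * (reg.a k * m f / reg.Zm k)) (spinorLift gammaFive * wilsonDirac (fundamentalRep (Fin 3)) U (reg.mcrit k + reg.a k * m f / reg.Zm k) 1).charpoly.roots : ℝ)) :=
  le_trans (le_add_of_nonneg_right (Nat.cast_nonneg _)) (flavourDefects_le_extinctSum U reg c k m f₀)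

/-- `countP p ≤ countP q + countP r` when `p → q ∨ r` (any multiset). -/
theorem countP_le_countP_add_countP {α : Type*} (s : Multiset α) {p q r : α → Prop} [DecidablePred p]
    [DecidablePred q] [DecidablePred r] (h : ∀ x, p x → q x ∨ r x) :
    s.countP p ≤ s.countP q + s.countP r := by
  induction s using Multiset.induction_on with
  | empty => simp
  | cons a s ih =>
    simp only [Multiset.countP_cons]
    by_cases hp : p a
    · rcases h a hp with hq | hr
      · rw [if_pos hp, if_pos hq]; split_ifs <;> omega
      · rw [if_pos hp, if_pos hr]; split_ifs <;> omega
    · rw [if_neg hp]; split_ifs <;> omega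

/-- **The band count is measurable**: `U ↦ #{real roots of charpoly D_W(U,0,1) in [t₁, t₂]}` (a closed
predicate). -/
theorem measurable_bandCount {L : ℕ} [NeZero L] (t₁ t₂ : ℝ) :
    Measurable fun U : GaugeConfig 4 L SU3 => Multiset.countP (fun z : ℂ => z.im = 0 ∧ t₁ ≤ z.re ∧ z.re ≤ t₂)
      (wilsonDirac (fundamentalRep (Fin 3)) U 0 1).charpoly.roots := by
  have hA : Continuous fun U : GaugeConfig 4 L SU3 => wilsonDirac (fundamentalRep (Fin 3)) U 0 1 :=
    continuous_wilsonDirac _ (continuous_fundamentalRep (Fin 3)) 0 1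
  exact countMeas_measurable_countP hA (fun z : ℂ => z.im = 0 ∧ t₁ ≤ z.re ∧ z.re ≤ t₂)
    (fun _ => {z : ℂ | z.im = 0 ∧ t₁ ≤ z.re ∧ z.re ≤ t₂})
    (fun _ => (isClosed_eq Complex.continuous_im continuous_const).inter
      ((isClosed_le continuous_const Complex.continuous_re).inter
        (isClosed_le Complex.continuous_re continuous_const)))
    (fun _ _ _ => le_rfl) (fun z => ⟨fun h => ⟨0, h⟩, fun ⟨_, h⟩ => h⟩)

/-- **Pointwise, Hermitian currency: TIGHT ≤ window at the flavour mass + EXTINCT.** For any witness data,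
step `k`, tuple `m`, probe `M ≥ 0` and flavour `f₀` with `m_{f₀} ≥ 0`, on every gauge field of the torus
`(2L'+1)⁴`, weighted by `W = ∏_f |det D_W(U, m_f(k), 1)|`:
`|index(m_crit − w_M)|·W ≤ #{λ(Γ₅D_W(U, m_{f₀}(k), 1)) : |λ| ≤ a_k(m_{f₀}+M)/Z_k}·W + (EXTINCT integrand)·W`. -/
theorem tightIntegrand_mul_le_window_add_extinct_mul {L' : ℕ} (U : GaugeConfig 4 (2 * L' + 1) SU3)
    (reg : QCDRegularisation Nf) (c : ℝ) (k : ℕ) (m : Fin Nf → ℝ) (M : ℝ) (f₀ : Fin Nf)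
    (hm : 0 ≤ m f₀) (hM : 0 ≤ M) :
    |(Multiset.countP (fun z : ℂ => z.re < 0) (spinorLift gammaFive * wilsonDirac (fundamentalRep (Fin 3)) U (reg.mcrit k - reg.a k * M / reg.Zm k) 1).charpoly.roots : ℝ) - 6 * (2 * L' + 1 : ℝ) ^ 4| * ∏ f : Fin Nf, ‖fermionDet (wilsonDirac (fundamentalRep (Fin 3)) U (reg.mcrit k + reg.a k * m f / reg.Zm k) 1)‖ ≤
      (Multiset.countP (fun z : ℂ => |z.re| ≤ reg.a k * m f₀ / reg.Zm k + reg.a k * M / reg.Zm k) (spinorLift gammaFive * wilsonDirac (fundamentalRep (Fin 3)) U (reg.mcrit k + reg.a k * m f₀ / reg.Zm k) 1).charpoly.roots : ℝ) * ∏ f : Fin Nf, ‖fermionDet (wilsonDirac (fundamentalRep (Fin 3)) U (reg.mcrit k + reg.a k * m f / reg.Zm k) 1)‖ +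
      (∑ f : Fin Nf, ((Multiset.countP (fun z : ℂ => z.im = 0 ∧ z.re < -(reg.mcrit k + reg.a k * m f / reg.Zm k)) (wilsonDirac (fundamentalRep (Fin 3)) U 0 1).charpoly.roots : ℝ) + (Multiset.countP (fun z : ℂ => |z.re| < c * (reg.a k * m f / reg.Zm k)) (spinorLift gammaFive * wilsonDirac (fundamentalRep (Fin 3)) U (reg.mcrit k + reg.a k * m f / reg.Zm k) 1).charpoly.roots : ℝ))) * ∏ f : Fin Nf, ‖fermionDet (wilsonDirac (fundamentalRep (Fin 3)) U (reg.mcrit k + reg.a k * m f / reg.Zm k) 1)‖ := by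
  have hwf0 : 0 ≤ reg.a k * m f₀ / reg.Zm k := div_nonneg (mul_nonneg (reg.a_pos k).le hm) (reg.Zm_pos k).le
  have hwM0 : 0 ≤ reg.a k * M / reg.Zm k := div_nonneg (mul_nonneg (reg.a_pos k).le hM) (reg.Zm_pos k).le
  refine le_of_le_of_eq ?_ (add_mul _ _ _)
  by_cases hdet : fermionDet (wilsonDirac (fundamentalRep (Fin 3)) U (reg.mcrit k + reg.a k * m f₀ / reg.Zm k) 1) = 0
  · -- a real eigenvalue of `D_W(U,0,1)` exactly at `−m_{f₀}(k)`: the weight vanishes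
    have hWz : (∏ f : Fin Nf, ‖fermionDet (wilsonDirac (fundamentalRep (Fin 3)) U
        (reg.mcrit k + reg.a k * m f / reg.Zm k) 1)‖) = 0 :=
      Finset.prod_eq_zero (Finset.mem_univ f₀) (by rw [hdet, norm_zero])
    rw [hWz, mul_zero, mul_zero]
  · refine mul_le_mul_of_nonneg_right ?_ (Finset.prod_nonneg fun f _ => norm_nonneg _)
    -- no atom: Hermitian-currency budget, cast to `ℝ`
    have hatom : Multiset.countP (fun z : ℂ => z = ((-(reg.mcrit k + reg.a k * m f₀ / reg.Zm k) : ℝ) : ℂ))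
        (wilsonDirac (fundamentalRep (Fin 3)) U 0 1).charpoly.roots = 0 :=
      Multiset.countP_eq_zero.2 fun z hz h => hdet (fermionDet_eq_zero_of_root U _ hz h)
    have hZ := tight_integrand_le_window_add_realModes U (reg.mcrit k) (reg.a k * m f₀ / reg.Zm k)
      (reg.a k * M / reg.Zm k) hwf0 hwM0
    rw [countP_realModes_le_eq U, hatom, add_zero] at hZ
    have hRe : |(Multiset.countP (fun z : ℂ => z.re < 0) (spinorLift gammaFive * wilsonDirac (fundamentalRep (Fin 3)) U (reg.mcrit k - reg.a k * M / reg.Zm k) 1).charpoly.roots : ℝ) - 6 * (2 * L' + 1 : ℝ) ^ 4| ≤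
        (Multiset.countP (fun z : ℂ => |z.re| ≤ reg.a k * m f₀ / reg.Zm k + reg.a k * M / reg.Zm k) (spinorLift gammaFive * wilsonDirac (fundamentalRep (Fin 3)) U (reg.mcrit k + reg.a k * m f₀ / reg.Zm k) 1).charpoly.roots : ℝ) +
          (Multiset.countP (fun z : ℂ => z.im = 0 ∧ z.re < -(reg.mcrit k + reg.a k * m f₀ / reg.Zm k)) (wilsonDirac (fundamentalRep (Fin 3)) U 0 1).charpoly.roots : ℝ) := by
      exact_mod_cast hZ
    have hsum := signDefects_le_extinctSum U reg c k m f₀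
    linarith

/-- **Pointwise, real-mode currency: TIGHT ≤ band at the line + EXTINCT** (`tight_integrand_le_signDefects_add_band`
weighted and with the flavour sum): the band is `[−m_{f₀}(k), −(m_crit(k) − a_kM/Z_k)]`, of bare width
`a_k(m_{f₀}+M)/Z_k` around `−m_crit(k)`. -/
theorem tightIntegrand_mul_le_band_add_extinct_mul {L' : ℕ} (U : GaugeConfig 4 (2 * L' + 1) SU3)
    (reg : QCDRegularisation Nf) (c : ℝ) (k : ℕ) (m : Fin Nf → ℝ) (M : ℝ) (f₀ : Fin Nf)
    (hm : 0 ≤ m f₀) (hM : 0 ≤ M) :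
    |(Multiset.countP (fun z : ℂ => z.re < 0) (spinorLift gammaFive * wilsonDirac (fundamentalRep (Fin 3)) U (reg.mcrit k - reg.a k * M / reg.Zm k) 1).charpoly.roots : ℝ) - 6 * (2 * L' + 1 : ℝ) ^ 4| * ∏ f : Fin Nf, ‖fermionDet (wilsonDirac (fundamentalRep (Fin 3)) U (reg.mcrit k + reg.a k * m f / reg.Zm k) 1)‖ ≤
      (Multiset.countP (fun z : ℂ => z.im = 0 ∧ -(reg.mcrit k + reg.a k * m f₀ / reg.Zm k) ≤ z.re ∧ z.re ≤ -(reg.mcrit k - reg.a k * M / reg.Zm k)) (wilsonDirac (fundamentalRep (Fin 3)) U 0 1).charpoly.roots : ℝ) * ∏ f : Fin Nf, ‖fermionDet (wilsonDirac (fundamentalRep (Fin 3)) U (reg.mcrit k + reg.a k * m f / reg.Zm k) 1)‖ +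
      (∑ f : Fin Nf, ((Multiset.countP (fun z : ℂ => z.im = 0 ∧ z.re < -(reg.mcrit k + reg.a k * m f / reg.Zm k)) (wilsonDirac (fundamentalRep (Fin 3)) U 0 1).charpoly.roots : ℝ) + (Multiset.countP (fun z : ℂ => |z.re| < c * (reg.a k * m f / reg.Zm k)) (spinorLift gammaFive * wilsonDirac (fundamentalRep (Fin 3)) U (reg.mcrit k + reg.a k * m f / reg.Zm k) 1).charpoly.roots : ℝ))) * ∏ f : Fin Nf, ‖fermionDet (wilsonDirac (fundamentalRep (Fin 3)) U (reg.mcrit k + reg.a k * m f / reg.Zm k) 1)‖ := by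
  have hwf0 : 0 ≤ reg.a k * m f₀ / reg.Zm k := div_nonneg (mul_nonneg (reg.a_pos k).le hm) (reg.Zm_pos k).le
  have hwM0 : 0 ≤ reg.a k * M / reg.Zm k := div_nonneg (mul_nonneg (reg.a_pos k).le hM) (reg.Zm_pos k).le
  refine le_of_le_of_eq ?_ (add_mul _ _ _)
  refine mul_le_mul_of_nonneg_right ?_ (Finset.prod_nonneg fun f _ => norm_nonneg _)
  have hZ := tight_integrand_le_signDefects_add_band U (reg.mcrit k) (reg.a k * m f₀ / reg.Zm k)
    (reg.a k * M / reg.Zm k) hwf0 hwM0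
  have hRe : |(Multiset.countP (fun z : ℂ => z.re < 0) (spinorLift gammaFive * wilsonDirac (fundamentalRep (Fin 3)) U (reg.mcrit k - reg.a k * M / reg.Zm k) 1).charpoly.roots : ℝ) - 6 * (2 * L' + 1 : ℝ) ^ 4| ≤
      (Multiset.countP (fun z : ℂ => z.im = 0 ∧ z.re < -(reg.mcrit k + reg.a k * m f₀ / reg.Zm k)) (wilsonDirac (fundamentalRep (Fin 3)) U 0 1).charpoly.roots : ℝ) +
        (Multiset.countP (fun z : ℂ => z.im = 0 ∧ -(reg.mcrit k + reg.a k * m f₀ / reg.Zm k) ≤ z.re ∧ z.re ≤ -(reg.mcrit k - reg.a k * M / reg.Zm k)) (wilsonDirac (fundamentalRep (Fin 3)) U 0 1).charpoly.roots : ℝ) := by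
    exact_mod_cast hZ
  have hsum := signDefects_le_extinctSum U reg c k m f₀
  linarith

/-- **Pointwise, unitary-shell currency: TIGHT ≤ SHELL at the flavour mass + EXTINCT.** The closed window
`|λ| ≤ a_k(m_{f₀}+M)/Z_k` splits into EXTINCT(b)'s open window `|λ| < c·a_k m_{f₀}/Z_k` and the SHELL
`c·a_k m_{f₀}/Z_k ≤ |λ| ≤ a_k(m_{f₀}+M)/Z_k`; the open window and the sign defects of `f₀` are both inside the EXTINCT
integrand, so `|index|·W ≤ #shell·W + (EXTINCT integrand)·W` — EXTINCT is spent ONCE. -/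
theorem tightIntegrand_mul_le_shell_add_extinct_mul {L' : ℕ} (U : GaugeConfig 4 (2 * L' + 1) SU3)
    (reg : QCDRegularisation Nf) (c : ℝ) (k : ℕ) (m : Fin Nf → ℝ) (M : ℝ) (f₀ : Fin Nf)
    (hm : 0 ≤ m f₀) (hM : 0 ≤ M) :
    |(Multiset.countP (fun z : ℂ => z.re < 0) (spinorLift gammaFive * wilsonDirac (fundamentalRep (Fin 3)) U (reg.mcrit k - reg.a k * M / reg.Zm k) 1).charpoly.roots : ℝ) - 6 * (2 * L' + 1 : ℝ) ^ 4| * ∏ f : Fin Nf, ‖fermionDet (wilsonDirac (fundamentalRep (Fin 3)) U (reg.mcrit k + reg.a k * m f / reg.Zm k) 1)‖ ≤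
      (Multiset.countP (fun z : ℂ => c * (reg.a k * m f₀ / reg.Zm k) ≤ |z.re| ∧ |z.re| ≤ reg.a k * m f₀ / reg.Zm k + reg.a k * M / reg.Zm k) (spinorLift gammaFive * wilsonDirac (fundamentalRep (Fin 3)) U (reg.mcrit k + reg.a k * m f₀ / reg.Zm k) 1).charpoly.roots : ℝ) * ∏ f : Fin Nf, ‖fermionDet (wilsonDirac (fundamentalRep (Fin 3)) U (reg.mcrit k + reg.a k * m f / reg.Zm k) 1)‖ +
      (∑ f : Fin Nf, ((Multiset.countP (fun z : ℂ => z.im = 0 ∧ z.re < -(reg.mcrit k + reg.a k * m f / reg.Zm k)) (wilsonDirac (fundamentalRep (Fin 3)) U 0 1).charpoly.roots : ℝ) + (Multiset.countP (fun z : ℂ => |z.re| < c * (reg.a k * m f / reg.Zm k)) (spinorLift gammaFive * wilsonDirac (fundamentalRep (Fin 3)) U (reg.mcrit k + reg.a k * m f / reg.Zm k) 1).charpoly.roots : ℝ))) * ∏ f : Fin Nf, ‖fermionDet (wilsonDirac (fundamentalRep (Fin 3)) U (reg.mcrit k + reg.a k * m f / reg.Zm k) 1)‖ := by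
  have hwf0 : 0 ≤ reg.a k * m f₀ / reg.Zm k := div_nonneg (mul_nonneg (reg.a_pos k).le hm) (reg.Zm_pos k).le
  have hwM0 : 0 ≤ reg.a k * M / reg.Zm k := div_nonneg (mul_nonneg (reg.a_pos k).le hM) (reg.Zm_pos k).le
  refine le_of_le_of_eq ?_ (add_mul _ _ _)
  by_cases hdet : fermionDet (wilsonDirac (fundamentalRep (Fin 3)) U (reg.mcrit k + reg.a k * m f₀ / reg.Zm k) 1) = 0
  · have hWz : (∏ f : Fin Nf, ‖fermionDet (wilsonDirac (fundamentalRep (Fin 3)) U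
        (reg.mcrit k + reg.a k * m f / reg.Zm k) 1)‖) = 0 :=
      Finset.prod_eq_zero (Finset.mem_univ f₀) (by rw [hdet, norm_zero])
    rw [hWz, mul_zero, mul_zero]
  · refine mul_le_mul_of_nonneg_right ?_ (Finset.prod_nonneg fun f _ => norm_nonneg _)
    have hatom : Multiset.countP (fun z : ℂ => z = ((-(reg.mcrit k + reg.a k * m f₀ / reg.Zm k) : ℝ) : ℂ))
        (wilsonDirac (fundamentalRep (Fin 3)) U 0 1).charpoly.roots = 0 :=
      Multiset.countP_eq_zero.2 fun z hz h => hdet (fermionDet_eq_zero_of_root U _ hz h)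
    have hZ := tight_integrand_le_window_add_realModes U (reg.mcrit k) (reg.a k * m f₀ / reg.Zm k)
      (reg.a k * M / reg.Zm k) hwf0 hwM0
    rw [countP_realModes_le_eq U, hatom, add_zero] at hZ
    have hRe : |(Multiset.countP (fun z : ℂ => z.re < 0) (spinorLift gammaFive * wilsonDirac (fundamentalRep (Fin 3)) U (reg.mcrit k - reg.a k * M / reg.Zm k) 1).charpoly.roots : ℝ) - 6 * (2 * L' + 1 : ℝ) ^ 4| ≤
        (Multiset.countP (fun z : ℂ => |z.re| ≤ reg.a k * m f₀ / reg.Zm k + reg.a k * M / reg.Zm k) (spinorLift gammaFive * wilsonDirac (fundamentalRep (Fin 3)) U (reg.mcrit k + reg.a k * m f₀ / reg.Zm k) 1).charpoly.roots : ℝ) +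
          (Multiset.countP (fun z : ℂ => z.im = 0 ∧ z.re < -(reg.mcrit k + reg.a k * m f₀ / reg.Zm k)) (wilsonDirac (fundamentalRep (Fin 3)) U 0 1).charpoly.roots : ℝ) := by
      exact_mod_cast hZ
    have hsplit : (Multiset.countP (fun z : ℂ => |z.re| ≤ reg.a k * m f₀ / reg.Zm k + reg.a k * M / reg.Zm k) (spinorLift gammaFive * wilsonDirac (fundamentalRep (Fin 3)) U (reg.mcrit k + reg.a k * m f₀ / reg.Zm k) 1).charpoly.roots : ℝ) ≤
        (Multiset.countP (fun z : ℂ => c * (reg.a k * m f₀ / reg.Zm k) ≤ |z.re| ∧ |z.re| ≤ reg.a k * m f₀ / reg.Zm k + reg.a k * M / reg.Zm k) (spinorLift gammaFive * wilsonDirac (fundamentalRep (Fin 3)) U (reg.mcrit k + reg.a k * m f₀ / reg.Zm k) 1).charpoly.roots : ℝ) +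
          (Multiset.countP (fun z : ℂ => |z.re| < c * (reg.a k * m f₀ / reg.Zm k)) (spinorLift gammaFive * wilsonDirac (fundamentalRep (Fin 3)) U (reg.mcrit k + reg.a k * m f₀ / reg.Zm k) 1).charpoly.roots : ℝ) := by
      exact_mod_cast countP_le_countP_add_countP _
        (p := fun z : ℂ => |z.re| ≤ reg.a k * m f₀ / reg.Zm k + reg.a k * M / reg.Zm k)
        (q := fun z : ℂ => c * (reg.a k * m f₀ / reg.Zm k) ≤ |z.re| ∧ |z.re| ≤ reg.a k * m f₀ / reg.Zm k + reg.a k * M / reg.Zm k)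
        (r := fun z : ℂ => |z.re| < c * (reg.a k * m f₀ / reg.Zm k))
        fun z hz => (le_or_gt (c * (reg.a k * m f₀ / reg.Zm k)) |z.re|).imp (fun h => ⟨h, hz⟩) id
    have hsum := flavourDefects_le_extinctSum U reg c k m f₀
    linarith

/-- The phase-quenched mean, on the torus of half-side `S` at step `k` of witness data `reg` with tuple `m`,
of the WINDOW count of flavour `f` at probe parameter `M`: `E₊ #{λ(Γ₅D_W(U, m_f(k), 1)) : |λ| ≤ a_k(m_f+M)/Z_k}`. -/
noncomputable def windowRatio (reg : QCDRegularisation Nf) (k S : ℕ) (m : Fin Nf → ℝ) (f : Fin Nf)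
    (M : ℝ) : ℝ :=
  (∫ U, (Multiset.countP (fun z : ℂ => |z.re| ≤ reg.a k * m f / reg.Zm k + reg.a k * M / reg.Zm k) (spinorLift gammaFive * wilsonDirac (fundamentalRep (Fin 3)) U (reg.mcrit k + reg.a k * m f / reg.Zm k) 1).charpoly.roots : ℝ) * ∏ f : Fin Nf, ‖fermionDet (wilsonDirac (fundamentalRep (Fin 3)) U (reg.mcrit k + reg.a k * m f / reg.Zm k) 1)‖ ∂(wilsonMeasure (d := 4) (L := 2 * S + 1) (fundamentalRep (Fin 3)) (reg.β k))) / (∫ U, ∏ f : Fin Nf, ‖fermionDet (wilsonDirac (fundamentalRep (Fin 3)) U (reg.mcrit k + reg.a k * m f / reg.Zm k) 1)‖ ∂(wilsonMeasure (d := 4) (L := 2 * S + 1) (fundamentalRep (Fin 3)) (reg.β k)))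

/-- The phase-quenched mean of the BAND count of flavour `f`:
`E₊ #{real λ(D_W(U,0,1)) ∈ [−m_f(k), −m_crit(k) + a_kM/Z_k]}`. -/
noncomputable def bandRatio (reg : QCDRegularisation Nf) (k S : ℕ) (m : Fin Nf → ℝ) (f : Fin Nf)
    (M : ℝ) : ℝ :=
  (∫ U, (Multiset.countP (fun z : ℂ => z.im = 0 ∧ -(reg.mcrit k + reg.a k * m f / reg.Zm k) ≤ z.re ∧ z.re ≤ -(reg.mcrit k - reg.a k * M / reg.Zm k)) (wilsonDirac (fundamentalRep (Fin 3)) U 0 1).charpoly.roots : ℝ) * ∏ f : Fin Nf, ‖fermionDet (wilsonDirac (fundamentalRep (Fin 3)) U (reg.mcrit k + reg.a k * m f / reg.Zm k) 1)‖ ∂(wilsonMeasure (d := 4) (L := 2 * S + 1) (fundamentalRep (Fin 3)) (reg.β k))) / (∫ U, ∏ f : Fin Nf, ‖fermionDet (wilsonDirac (fundamentalRep (Fin 3)) U (reg.mcrit k + reg.a k * m f / reg.Zm k) 1)‖ ∂(wilsonMeasure (d := 4) (L := 2 * S + 1) (fundamentalRep (Fin 3)) (reg.β k)))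

/-- The phase-quenched mean of the UNITARY SHELL count of flavour `f`:
`E₊ #{λ(Γ₅D_W(U, m_f(k), 1)) : c·a_k m_f/Z_k ≤ |λ| ≤ a_k(m_f+M)/Z_k}` (card `weyl-transport-unitary-pin`'s
`shellCount`, verbatim predicate). -/
noncomputable def shellRatio (reg : QCDRegularisation Nf) (c : ℝ) (k S : ℕ) (m : Fin Nf → ℝ) (f : Fin Nf)
    (M : ℝ) : ℝ :=
  (∫ U, (Multiset.countP (fun z : ℂ => c * (reg.a k * m f / reg.Zm k) ≤ |z.re| ∧ |z.re| ≤ reg.a k * m f / reg.Zm k + reg.a k * M / reg.Zm k) (spinorLift gammaFive * wilsonDirac (fundamentalRep (Fin 3)) U (reg.mcrit k + reg.a k * m f / reg.Zm k) 1).charpoly.roots : ℝ) * ∏ f : Fin Nf, ‖fermionDet (wilsonDirac (fundamentalRep (Fin 3)) U (reg.mcrit k + reg.a k * m f / reg.Zm k) 1)‖ ∂(wilsonMeasure (d := 4) (L := 2 * S + 1) (fundamentalRep (Fin 3)) (reg.β k))) / (∫ U, ∏ f : Fin Nf, ‖fermionDet (wilsonDirac (fundamentalRep (Fin 3)) U (reg.mcrit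 k + reg.a k * m f / reg.Zm k) 1)‖ ∂(wilsonMeasure (d := 4) (L := 2 * S + 1) (fundamentalRep (Fin 3)) (reg.β k)))

/-- **TIGHT ≤ WINDOW + EXTINCT (ratios).** -/
theorem tightRatio_le_windowRatio_add_extinctRatio (reg : QCDRegularisation Nf) (c : ℝ) (k S : ℕ)
    {m : Fin Nf → ℝ} {M : ℝ} (f₀ : Fin Nf) (hm : 0 ≤ m f₀) (hM : 0 ≤ M) :
    tightRatio reg k S m M ≤ windowRatio reg k S m f₀ M + extinctRatio reg c k S m := by
  unfold tightRatio windowRatio extinctRatio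
  rw [← add_div, ← integral_add]
  · refine div_le_div_of_nonneg_right ?_
      (integral_nonneg fun U => Finset.prod_nonneg fun f _ => norm_nonneg _)
    refine integral_mono_of_nonneg (Eventually.of_forall fun U => ?_) ?_ (Eventually.of_forall fun U => ?_)
    · exact mul_nonneg (abs_nonneg _) (Finset.prod_nonneg fun f _ => norm_nonneg _)
    · exact (integrable_natCount_mul_weight _ _ (measurable_windowCount _ _)
        (fun U => countP_roots_charpoly_le_card _ _)).add
        (integrable_extinctIntegrand reg c k m (reg.β k))
    · exact tightIntegrand_mul_le_window_add_extinct_mul U reg c k m M f₀ hm hM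
  · exact integrable_natCount_mul_weight _ _ (measurable_windowCount _ _)
        (fun U => countP_roots_charpoly_le_card _ _)
  · exact integrable_extinctIntegrand reg c k m (reg.β k)

/-- **TIGHT ≤ BAND + EXTINCT (ratios).** -/
theorem tightRatio_le_bandRatio_add_extinctRatio (reg : QCDRegularisation Nf) (c : ℝ) (k S : ℕ)
    {m : Fin Nf → ℝ} {M : ℝ} (f₀ : Fin Nf) (hm : 0 ≤ m f₀) (hM : 0 ≤ M) :
    tightRatio reg k S m M ≤ bandRatio reg k S m f₀ M + extinctRatio reg c k S m := by
  unfold tightRatio bandRatio extinctRatio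
  rw [← add_div, ← integral_add]
  · refine div_le_div_of_nonneg_right ?_
      (integral_nonneg fun U => Finset.prod_nonneg fun f _ => norm_nonneg _)
    refine integral_mono_of_nonneg (Eventually.of_forall fun U => ?_) ?_ (Eventually.of_forall fun U => ?_)
    · exact mul_nonneg (abs_nonneg _) (Finset.prod_nonneg fun f _ => norm_nonneg _)
    · exact (integrable_natCount_mul_weight _ _ (measurable_bandCount _ _)
        (fun U => countP_roots_charpoly_le_card _ _)).add
        (integrable_extinctIntegrand reg c k m (reg.β k))
    · exact tightIntegrand_mul_le_band_add_extinct_mul U reg c k m M f₀ hm hM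
  · exact integrable_natCount_mul_weight _ _ (measurable_bandCount _ _)
        (fun U => countP_roots_charpoly_le_card _ _)
  · exact integrable_extinctIntegrand reg c k m (reg.β k)

/-- **TIGHT ≤ SHELL + EXTINCT (ratios).** -/
theorem tightRatio_le_shellRatio_add_extinctRatio (reg : QCDRegularisation Nf) (c : ℝ) (k S : ℕ)
    {m : Fin Nf → ℝ} {M : ℝ} (f₀ : Fin Nf) (hm : 0 ≤ m f₀) (hM : 0 ≤ M) :
    tightRatio reg k S m M ≤ shellRatio reg c k S m f₀ M + extinctRatio reg c k S m := by
  unfold tightRatio shellRatio extinctRatio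
  rw [← add_div, ← integral_add]
  · refine div_le_div_of_nonneg_right ?_
      (integral_nonneg fun U => Finset.prod_nonneg fun f _ => norm_nonneg _)
    refine integral_mono_of_nonneg (Eventually.of_forall fun U => ?_) ?_ (Eventually.of_forall fun U => ?_)
    · exact mul_nonneg (abs_nonneg _) (Finset.prod_nonneg fun f _ => norm_nonneg _)
    · exact (integrable_natCount_mul_weight _ _ (measurable_shellCount _ _ _)
        (fun U => countP_roots_charpoly_le_card _ _)).add
        (integrable_extinctIntegrand reg c k m (reg.β k))
    · exact tightIntegrand_mul_le_shell_add_extinct_mul U reg c k m M f₀ hm hM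
  · exact integrable_natCount_mul_weight _ _ (measurable_shellCount _ _ _)
        (fun U => countP_roots_charpoly_le_card _ _)
  · exact integrable_extinctIntegrand reg c k m (reg.β k)

/-- **THE TWO-SIDED PIN, Hermitian currency (what TIGHT ∧ EXTINCT deliver to a bridge prover).** For
witness data `(reg, M₀, c)` EXTINCT and TIGHT at a tuple `m` above `M₀ ≥ 0`, every flavour `f`, every probe
parameter `M > M₀` and every `ε > 0`: eventually in `k`, on the scheme torus, the phase-quenched mean of
`#{eigenvalues λ of Γ₅D_W(U, m_f(k), 1) with |λ| ≤ a_k(m_f + M)/Z_k}` is `≥ 1 − ε` — while EXTINCT(b) makes the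
mean of `#{|λ| < c·a_k m_f/Z_k}` `≤ ε`. The Hermitian Wilson operator AT THE FLAVOUR MASS has, on average,
a near-zero mode at scale exactly `a_k m_f/Z_k` (up to the factor `[c, 1 + M₀/m_f]`): the line is critical. -/
theorem eventually_windowRatio_ge (reg : QCDRegularisation Nf) {M₀ c : ℝ} (hM₀ : 0 ≤ M₀) {m : Fin Nf → ℝ}
    (hm : ∀ f, M₀ < m f) (h : Extinct Nf reg c m ∧ Tight Nf reg M₀ m) (f : Fin Nf) {M : ℝ} (hM : M₀ < M)
    {ε : ℝ} (hε : 0 < ε) :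
    ∀ᶠ k : ℕ in Filter.atTop, 1 - ε ≤ windowRatio reg k (reg.L k) m f M := by
  filter_upwards [h.1 ε hε, h.2 M hM] with k hE hT
  have hT' : 1 ≤ tightRatio reg k (reg.L k) m M := hT
  have hE' : extinctRatio reg c k (reg.L k) m ≤ ε * ((2 * (reg.L k : ℕ) + 1 : ℝ) / (2 * reg.L k + 1)) ^ 4 :=
    hE (reg.L k) le_rfl
  have hone : ((2 * (reg.L k : ℕ) + 1 : ℝ) / (2 * reg.L k + 1)) = 1 := div_self (by positivity)
  rw [hone, one_pow, mul_one] at hE'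
  have := tightRatio_le_windowRatio_add_extinctRatio reg c k (reg.L k) (m := m) (M := M) f
    (by linarith [hm f]) (by linarith)
  linarith

/-- **THE TWO-SIDED PIN, real-mode currency.** Same hypotheses: eventually in `k`, on the scheme torus, the
phase-quenched mean of `#{real eigenvalues of D_W(U,0,1) in [−m_f(k), −m_crit(k) + a_kM/Z_k]}` is `≥ 1 − ε`
(a real-mode accumulation edge at `−m_crit(k)`, sharp to `a_k(m_f+M)/Z_k`; EXTINCT(a) empties everything
below `−m_f(k)`). This is the content of card `tight-two-sided-pin`, now a theorem about the hypothesis. -/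
theorem eventually_bandRatio_ge (reg : QCDRegularisation Nf) {M₀ c : ℝ} (hM₀ : 0 ≤ M₀) {m : Fin Nf → ℝ}
    (hm : ∀ f, M₀ < m f) (h : Extinct Nf reg c m ∧ Tight Nf reg M₀ m) (f : Fin Nf) {M : ℝ} (hM : M₀ < M)
    {ε : ℝ} (hε : 0 < ε) :
    ∀ᶠ k : ℕ in Filter.atTop, 1 - ε ≤ bandRatio reg k (reg.L k) m f M := by
  filter_upwards [h.1 ε hε, h.2 M hM] with k hE hT
  have hT' : 1 ≤ tightRatio reg k (reg.L k) m M := hT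
  have hE' : extinctRatio reg c k (reg.L k) m ≤ ε * ((2 * (reg.L k : ℕ) + 1 : ℝ) / (2 * reg.L k + 1)) ^ 4 :=
    hE (reg.L k) le_rfl
  have hone : ((2 * (reg.L k : ℕ) + 1 : ℝ) / (2 * reg.L k + 1)) = 1 := div_self (by positivity)
  rw [hone, one_pow, mul_one] at hE'
  have := tightRatio_le_bandRatio_add_extinctRatio reg c k (reg.L k) (m := m) (M := M) f
    (by linarith [hm f]) (by linarith)
  linarith

/-- **THE SEA-SHELL PIN (unitary currency; card `weyl-transport-unitary-pin`'s stub `seaShellPin`, proved in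
a STRONGER form: bound `1 − ε` instead of `1 − 2ε`, no `hline`/`0 < c` hypotheses).** For witness data
`(reg, M₀, c)` EXTINCT and TIGHT at a tuple `m` above `M₀ ≥ 0`, every flavour `f`, every `M > M₀` and every `ε > 0`:
eventually in `k`, on the scheme torus, the phase-quenched mean of
`#{eigenvalues λ of Γ₅D_W(U, m_f(k), 1) with c·a_k m_f/Z_k ≤ |λ| ≤ a_k(m_f+M)/Z_k}` is `≥ 1 − ε`: the Hermitian
Wilson operator AT THE UNITARY POINT (valence mass = sea mass) has, on average, a mode in the running-mass
shell — lightness at the unitary point, the certificate the card's non-decoupling transfer consumes. -/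
theorem eventually_shellRatio_ge (reg : QCDRegularisation Nf) {M₀ c : ℝ} (hM₀ : 0 ≤ M₀) {m : Fin Nf → ℝ}
    (hm : ∀ f, M₀ < m f) (h : Extinct Nf reg c m ∧ Tight Nf reg M₀ m) (f : Fin Nf) {M : ℝ} (hM : M₀ < M)
    {ε : ℝ} (hε : 0 < ε) :
    ∀ᶠ k : ℕ in Filter.atTop, 1 - ε ≤ shellRatio reg c k (reg.L k) m f M := by
  filter_upwards [h.1 ε hε, h.2 M hM] with k hE hT
  have hT' : 1 ≤ tightRatio reg k (reg.L k) m M := hT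
  have hE' : extinctRatio reg c k (reg.L k) m ≤ ε * ((2 * (reg.L k : ℕ) + 1 : ℝ) / (2 * reg.L k + 1)) ^ 4 :=
    hE (reg.L k) le_rfl
  have hone : ((2 * (reg.L k : ℕ) + 1 : ℝ) / (2 * reg.L k + 1)) = 1 := div_self (by positivity)
  rw [hone, one_pow, mul_one] at hE'
  have := tightRatio_le_shellRatio_add_extinctRatio reg c k (reg.L k) (m := m) (M := M) f
    (by linarith [hm f]) (by linarith)
  linarith

/-- The card's stub `seaShellPin` verbatim (route objects, its own constant `1 − 2ε`), as a COROLLARY — its extra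
hypotheses (`0 < c`, the line eventually negative) are not needed. -/
theorem seaShellPin {Nf : ℕ} (reg : QCDRegularisation Nf) (M₀ c : ℝ) (m : Fin Nf → ℝ) (hm : ∀ f, M₀ < m f)
    (hM₀ : 0 ≤ M₀) (hE : Extinct Nf reg c m) (hT : Tight Nf reg M₀ m) (f : Fin Nf) (M : ℝ) (hM : M₀ < M)
    (ε : ℝ) (hε : 0 < ε) :
    ∀ᶠ k : ℕ in atTop, 1 - 2 * ε ≤
      (∫ U, (Multiset.countP (fun z : ℂ => c * (reg.a k * m f / reg.Zm k) ≤ |z.re| ∧ |z.re| ≤ reg.a k * m f / reg.Zm k + reg.a k * M / reg.Zm k) (spinorLift gammaFive * wilsonDirac (fundamentalRep (Fin 3)) U (reg.mcrit k + reg.a k * m f / reg.Zm k) 1).charpoly.roots : ℝ) *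
          ∏ g : Fin Nf, ‖fermionDet (wilsonDirac (fundamentalRep (Fin 3)) U
            (reg.mcrit k + reg.a k * m g / reg.Zm k) 1)‖
        ∂(wilsonMeasure (d := 4) (L := 2 * reg.L k + 1) (fundamentalRep (Fin 3)) (reg.β k))) /
      (∫ U, ∏ g : Fin Nf, ‖fermionDet (wilsonDirac (fundamentalRep (Fin 3)) U
            (reg.mcrit k + reg.a k * m g / reg.Zm k) 1)‖
        ∂(wilsonMeasure (d := 4) (L := 2 * reg.L k + 1) (fundamentalRep (Fin 3)) (reg.β k))) := by
  filter_upwards [eventually_shellRatio_ge reg hM₀ hm ⟨hE, hT⟩ f hM hε] with k hk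
  have hk' : 1 - ε ≤ shellRatio reg c k (reg.L k) m f M := hk
  have : 1 - 2 * ε ≤ shellRatio reg c k (reg.L k) m f M := by linarith
  exact this

/-- **Reading for the sibling crux.** Any witness `(reg, M₀, c)` of `SD(N_f)` delivers, for every tuple above
`M₀`, every flavour, every `M > M₀` and `ε > 0`, eventually in `k`: window mean `≥ 1 − ε` AND band mean
`≥ 1 − ε` on the scheme torus — the two-sided pin in both currencies — and has `c ≤ 1`. -/
theorem SDHyp.two_sided_pin (h : SDHyp Nf) :
    ∃ reg : QCDRegularisation Nf, ∃ M₀ : ℝ, 0 ≤ M₀ ∧ ∃ c : ℝ, 0 < c ∧ c ≤ 1 ∧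
      ∀ m : Fin Nf → ℝ, (∀ f, M₀ < m f) → ∀ f : Fin Nf, ∀ M : ℝ, M₀ < M → ∀ ε : ℝ, 0 < ε →
        ∀ᶠ k : ℕ in Filter.atTop, 1 - ε ≤ windowRatio reg k (reg.L k) m f M ∧
          1 - ε ≤ bandRatio reg k (reg.L k) m f M ∧ 1 - ε ≤ shellRatio reg c k (reg.L k) m f M := by
  obtain ⟨reg, -, -, M₀, hM₀, c, hc, h⟩ := h
  rcases Nat.eq_zero_or_pos Nf with hNf | hNf
  · subst hNf
    exact ⟨reg, M₀, hM₀, min c 1, lt_min hc one_pos, min_le_right _ _,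
      fun m hm f => f.elim0⟩
  · exact ⟨reg, M₀, hM₀, c, hc, SDHyp.c_le_one hNf hM₀ h, fun m hm f M hM ε hε =>
      (eventually_windowRatio_ge reg hM₀ hm (h m hm) f hM hε).and
        ((eventually_bandRatio_ge reg hM₀ hm (h m hm) f hM hε).and
          (eventually_shellRatio_ge reg hM₀ hm (h m hm) f hM hε))⟩

end Pin

end CycleThree

end Summit.QuantumFields.QCD.Cruxes.ExtinctionBuildsQCD.Disproof
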